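import Literature.LinearAlgebra.MatrixPolynomials.CameronPsarrakos2019.General
import Literature.Algebra.Polynomial.DescartesSignVariations
import Literature.AlgebraicGeometry.DeterminantalHypersurfaces.HermitianPencilLinearity
import HarnessLib

/-!
# Cameron–Psarrakos (2019): the PROVED content around the matrix sign rule `z⁺(P) ≤ n·α(P)` —
# Lemma 2, Proposition 4 and (6) for `P` diagonalizable by congruence, Lemma 6 (`α(P) ∈ {0, 1, m}`),
# Theorem 7 for `m ≤ 2`, Theorem 8 (sharpness), and Fourier's parity rule (Theorem 9)

Source: T. R. Cameron, P. J. Psarrakos, *On Descartes' rule of signs for matrix polynomials*,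
Operators and Matrices **13** (2019) 643–652, doi:10.7153/oam-2019-13-48 [CameronPsarrakos2019]
(held: `paper:doi-10-7153-oam-2019-13-48`; statements checked against the authors' preprint
`paper:galaxy-pdf-7017698612302551480`, pp. 2–10, whose displays are intact).

CONTEXT AND SCOPE (read this first).  The module
`Literature.LinearAlgebra.MatrixPolynomials.CameronPsarrakos2019.General` types the paper's class `S`
(`InS`: every coefficient positive definite, negative definite or null), `α(P)` (`alpha`, null
coefficients ignored), `z⁺(P)` (`zplus`, positive real eigenvalues WITH multiplicity) and the rule
(6) `z⁺(P) ≤ n·α(P)` (`CameronPsarrakosRule`), which the paper CONJECTURES for all of `S` (p. 646) and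
which is **REFUTED** in the tree: `cameronPsarrakosRule_real_false` / `cameronPsarrakosRule_complex_false`
(ibid.) and, in the currency of the Valiant-side crux `MatrixDescartes`, `not_matrixDescartes_two_two`
(`…CameronPsarrakos2019.Witness`).  The present file vendors, as THEOREMS over the same vocabulary
(`matPoly` / `InS` / `alpha` / `zplus` by name, `𝕜 = ℝ` or `ℂ`), the TRUE RESTRICTIONS of the refuted
rule that the paper proves — nothing here is a `…Rule…holds`:

* **Lemma 6, cases `α(P) = 0` and `α(P) = m`** (p. 6 of the preprint / p. 647): `z⁺(P) ≤ n·α(P)` when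
  `α(P) ∈ {0, m}` — `lemma_6_of_alpha_eq_zero` (indeed `z⁺(P) = 0`: for a kernel vector `v` of `P(t)`,
  `t > 0`, the real numbers `tⁱ · v*Aᵢv` all have the sign of the common sign of the non-null
  coefficients and one of them is non-zero — the argument of the proof of Thm 3, "did not rely on the
  matrix polynomial being hyperbolic") and `lemma_6_of_alpha_eq_degree` (`z⁺(P) ≤ nm` always:
  `deg det P ≤ nm`).
* **Lemma 6, case `α(P) = 1`** (ibid.; printed proof: Markus' spectral factorisation, Thm 30.6 of
  [16]) — `lemma_6_of_alpha_eq_one` (`z⁺(P) ≤ n`, WITH multiplicity), whence `lemma_6`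
  (`α(P) ∈ {0, 1, m}`, as printed) and **Theorem 7 for `m ≤ 2`** — `thm_7_of_degree_le_two` ("the only
  cases to consider are covered by Lemma 6").  Self-contained proof here (§5): with `j` the split index
  (the non-null coefficients of index `< j` have a common sign `σ`, those of index `≥ j` the sign `−σ`,
  `Rules.exists_pivot_of_alpha_eq_one`), the Hermitian forms `x ↦ −σ t^{−j} x* P(t) x` increase with
  `t > 0` (`Rules.gform_mono`) and strictly so along kernel vectors (`Rules.transversal`:
  `0 < −σ · y* P′(τ) y` for `0 ≠ y ∈ ker P(τ)`), so the kernels `ker P(τ)`, `τ > 0`, form an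
  independent family with `Σ_τ dim ker P(τ) ≤ n` (`Rules.kernel_chain`, `Rules.sum_finrank_ker_le`),
  and the multiplicity of a root `τ > 0` of `det P` is at most `dim ker P(τ)`
  (`Rules.rootMultiplicity_le_finrank_ker`: in a unitary eigenbasis of `P(τ)` the kernel rows of
  `U* P(X) U` are divisible by `X − τ`, and the kernel block of `U* P′(τ) U` is definite).
* **Theorem 9, first assertion** (p. 9–10 / p. 650): for every regular `P ∈ S`, `z⁺(P)` and `n·α(P)`
  have the same parity — `thm_9` (`Even (zplus A) ↔ Even (n * alpha A)`).  Proof as printed: with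
  `k₀ ≤ k₁` the least and the largest non-null indices, `det P = X^{n k₀} q₁`, `q₁(0) = det A_{k₀}`,
  `lead q₁ = det A_{k₁}` (degree `n(k₁ − k₀)`, top coefficient by
  `Literature.AlgebraicGeometry.DeterminantalHypersurfaces.coeff_det_of_natDegree_le`), a definite
  `n × n` matrix has determinant of sign `+1` resp. `(−1)^n`, the parity of the number of positive
  roots of a real polynomial is read off `sign (lead · const)`
  (`Literature.Algebra.Polynomial.Descartes.even_countP_roots_pos_iff`), and `α(P)` is even iff the
  first and the last non-null signs agree (`Rules.even_alternations_iff`).  The second assertion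
  (`z⁻(P) ≡ n·π(P)`) "follows by changing `P(λ)` into `P(−λ)`" (ibid.): the paper's permanence count
  `π(P)` IS `α(P(−λ))` ("this is the same as counting the alternations of `P(−λ)`", p. 2 / p. 644) and
  `z⁻(P) = z⁺(P(−λ))`; the reflected coefficient sequence is `i ↦ (−1)ⁱ Aᵢ` (§6: it stays in `S`,
  `Rules.inS_reflect`; `det` becomes `(det P) ∘ (−X)`, `Rules.det_matPoly_reflect`; `z⁺(P(−λ))` is the
  number of NEGATIVE eigenvalues of `P` with multiplicity, `Rules.zplus_reflect` /
  `zplus_reflect_eq_card_neg`) — `thm_9_neg`; likewise both halves of (6) for `m ≤ 2`,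
  `thm_7_of_degree_le_two'`.

* **Lemma 2** (p. 3–4 / p. 645; de Gua's construction): if `A_k`, `A_{k−1}` are of opposite sign
  then `G(λ) = −kP(λ) + λP′(λ) = ∑ (i − k) Aᵢ λⁱ` has exactly one alternation less — `lemma_2`
  (`alpha G + 1 = alpha A`, `G` the sequence `i ↦ (i − k) • Aᵢ`; `Rules.matPoly_deGua`:
  its matrix polynomial is `X • P′ − C k • P`; `Rules.inS_deGua`: it stays in `S`), and the version
  with null coefficients between the two opposite ones, `Rules.alpha_deGua` (§7: the alternation count
  only sees the non-null signs; in front of `a, −a` the earlier signs are negated — `Rules.alternations_deGua`).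
* **Proposition 4 and (6) for `P` diagonalizable by congruence** (p. 5 / p. 646): with a nonsingular
  `M` and real `d` such that `M Aᵢ Mᴴ = diag(d·,ᵢ)` for all `i` — `prop_4` ((3):
  `z⁺(P) ≤ z⁺(P′) + n`, `P′` the shifted sequence `i ↦ (i+1) A_{i+1}`, whose matrix polynomial is the
  derivative, `Rules.matPoly_derivSeq`) and `zplus_le_of_congruence_diagonalizable` ((6) for such
  `P`, "the following proposition implies that (6) holds for all `P(λ) ∈ S` that are diagonalizable
  by congruence").  §8: `z⁺(P)` is the number of positive roots of the diagonal entries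
  `dₐ = ∑ᵢ d_{a,i} Xⁱ` (`Rules.zplus_eq_diagCount`: `det(M P Mᴴ) = |det M|² det P = ∏ dₐ`), whose
  coefficient signs are the signs of the `Aᵢ` (`Rules.diag_sign`); Rolle's theorem entry by entry in
  the de Gua form `#pos.roots(p) ≤ #pos.roots(X p′ − k p) + 1` with multiplicity
  (`Rules.countP_roots_le_deGua`, after Mathlib's `Polynomial.card_roots_le_derivative`); and the
  paper's induction on `α(P)` ("(3) ⇒ (6)", proof of Thm 3) run on the diagonal count
  (`Rules.diagCount_le`; base case: Descartes' rule without sign variation,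
  `Literature.Algebra.Polynomial.Descartes.signVariations_eq_zero_of_coeff_nonneg`).
* **Theorem 8** (p. 9 / p. 650; sharpness): if (6) holds (both halves, as hypotheses) and `det P` has
  `nm` real roots, then `z⁺(P) = n·α(P)` and `z⁻(P) = n·π(P)` — `thm_8`, under the paper's
  normalisation `A_0 ≠ 0`; §9 proves `α(P) + π(P) ≤ m` (`Rules.alpha_add_alpha_reflect_le`) and
  `#real eigenvalues = z⁺ + z⁻` (`Rules.card_real_roots_eq`).

TYPED-vs-PRINTED.  (i) The paper fixes `A_m ≠ 0`; the tree's encoding `A : Fin (m+1) → …` allows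
trailing null coefficients (degree `≤ m`), and every statement here holds in that generality (Theorem 9
uses the largest non-null index `k₁` in place of `m`).  (ii) "Regular" = `det P ≢ 0` = the hypothesis
`(matPoly A).det ≠ 0`, as in `CameronPsarrakosRule`.  (iii) `z⁺` counts WITH multiplicity (`zplus`); the
Valiant-side `MatrixDescartes` (stmt-ValiantsHypothesis-18050) counts DISTINCT zeros of real symmetric
pencils — bridge `Rules.card_toFinset_filter_le_zplus` (distinct ≤ with multiplicity).  (iv) `det P`
of a Hermitian-coefficient matrix polynomial is a REAL polynomial (`Rules.exists_map_eq_det_matPoly`: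
conjugating the coefficients transposes `P`) and `z⁺(P)` is its number of positive roots counted with
multiplicity (`Rules.zplus_eq_countP`) — the dictionary to Mathlib's `Polynomial.roots.countP` used by
Descartes' rule (`Polynomial.roots_countP_pos_le_signVariations`).

NOT TYPED (and no fact minted): Lemma 1 / Theorem 3 (hyperbolic `P`: every spectral zone carries
exactly `n` eigenvalues — Markus 1988 Thm 31.5, Li–Rodman 1994 Thm 3.1) and Theorem 7 for `m = 3`
(Markus' spectral factorisation Thm 26.19); Example 5 (a numerical `2 × 2` quintic); the converse of
Theorem 8 (p. 650, a remark).  (v) In the encoding a SINGULAR `P` (`det P ≡ 0`) has `zplus = 0`, so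
upper bounds on `z⁺` need no regularity hypothesis, while `prop_4` must assume `P′` regular.

HONEST FRAMING: dictionary literature for rung V1 (`MatrixDescartes`): where a matrix Descartes rule IS
a theorem; census-neutral (no named fact typed or discharged); VP ≠ VNP is NOT proved and nothing here
bears on it.  Elementary; Mathlib + the two Literature files imported; no definitions.
-/

noncomputable section

open Polynomial Matrix
open scoped ComplexOrder

namespace Literature.LinearAlgebra.MatrixPolynomials.CameronPsarrakos2019

namespace Rules

variable {𝕜 : Type*} [RCLike 𝕜] {n m : ℕ}

/-! ### §0. Sign sequences: the alternation count of a list of signs `∈ {1, 0, −1}` -/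

/-- The list of non-null signs. [folklore] -/
private theorem alternations_eq (l : List ℤ) :
    alternations l = ((l.filter (fun s => s ≠ 0)).zip (l.filter (fun s => s ≠ 0)).tail).countP
      (fun p => p.1 * p.2 < 0) := rfl

/-- Auxiliary. [folklore] -/
@[simp] private theorem alternations_nil : alternations [] = 0 := by
  simp [alternations]

/-- Auxiliary. [folklore] -/
private theorem filter_cons_zero (l : List ℤ) :
    (0 :: l).filter (fun s => s ≠ 0) = l.filter (fun s => s ≠ 0) := by
  simp

/-- Auxiliary. [folklore] -/
private theorem filter_cons_of_ne {a : ℤ} (ha : a ≠ 0) (l : List ℤ) :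
    (a :: l).filter (fun s => s ≠ 0) = a :: l.filter (fun s => s ≠ 0) := by
  simp [ha]

/-- Auxiliary. [folklore] -/
@[simp] private theorem alternations_cons_zero (l : List ℤ) : alternations (0 :: l) = alternations l := by
  rw [alternations_eq, alternations_eq, filter_cons_zero]

/-- A non-null sign in front of a list without non-null signs: no alternation. [folklore] -/
private theorem alternations_cons_of_filter_eq_nil {a : ℤ} (ha : a ≠ 0) {l : List ℤ}
    (h : l.filter (fun s => s ≠ 0) = []) : alternations (a :: l) = 0 := by
  rw [alternations_eq, filter_cons_of_ne ha, h]
  simp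

/-- A non-null sign `a` in front of a list whose first non-null sign is `b`: one more alternation
iff `a b < 0`. [folklore] -/
private theorem alternations_cons_of_filter_eq_cons {a b : ℤ} (ha : a ≠ 0) {l r : List ℤ}
    (h : l.filter (fun s => s ≠ 0) = b :: r) :
    alternations (a :: l) = alternations l + (if a * b < 0 then 1 else 0) := by
  rw [alternations_eq, alternations_eq, filter_cons_of_ne ha, h]
  simp only [List.tail_cons, List.zip_cons_cons, List.countP_cons]
  split_ifs <;> simp_all

/-- Auxiliary. [folklore] -/
private theorem alternations_singleton (a : ℤ) : alternations [a] = 0 := by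
  by_cases ha : a = 0
  · subst ha; simp
  · exact alternations_cons_of_filter_eq_nil ha (by simp)

/-- No alternation: all non-null signs coincide. [folklore] -/
private theorem exists_forall_eq_of_alternations_eq_zero :
    ∀ l : List ℤ, (∀ x ∈ l, x = 0 ∨ x = 1 ∨ x = -1) → alternations l = 0 →
      ∃ σ : ℤ, (σ = 1 ∨ σ = -1) ∧ ∀ x ∈ l, x ≠ 0 → x = σ
  | [], _, _ => ⟨1, Or.inl rfl, by simp⟩
  | a :: l, hl, h => by
    have hl' : ∀ x ∈ l, x = 0 ∨ x = 1 ∨ x = -1 := fun x hx => hl x (List.mem_cons_of_mem a hx)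
    by_cases ha : a = 0
    · subst ha
      rw [alternations_cons_zero] at h
      obtain ⟨σ, hσ, hall⟩ := exists_forall_eq_of_alternations_eq_zero l hl' h
      exact ⟨σ, hσ, fun x hx hx0 => by
        rcases List.mem_cons.1 hx with rfl | hx
        · exact absurd rfl hx0
        · exact hall x hx hx0⟩
    · have ha' : a = 1 ∨ a = -1 := by
        rcases hl a List.mem_cons_self with h | h <;> tauto
      cases hf : l.filter (fun s => s ≠ 0) with
      | nil =>
        refine ⟨a, ha', fun x hx hx0 => ?_⟩
        rcases List.mem_cons.1 hx with rfl | hx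
        · rfl
        · have : x ∈ l.filter (fun s => s ≠ 0) := List.mem_filter.2 ⟨hx, by simpa using hx0⟩
          rw [hf] at this
          simp at this
      | cons b r =>
        rw [alternations_cons_of_filter_eq_cons ha hf] at h
        have h0 : alternations l = 0 := by omega
        have hab : ¬ a * b < 0 := by
          intro hlt; simp [hlt] at h
        obtain ⟨σ, hσ, hall⟩ := exists_forall_eq_of_alternations_eq_zero l hl' h0
        have hb : b ∈ l.filter (fun s => s ≠ 0) := by rw [hf]; exact List.mem_cons_self
        have hbl : b ∈ l := List.mem_of_mem_filter hb
        have hb0 : b ≠ 0 := by simpa using (List.mem_filter.1 hb).2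
        have hbσ : b = σ := hall b hbl hb0
        have haσ : a = σ := by
          rcases ha' with rfl | rfl <;> rcases hσ with rfl | rfl <;> simp_all
        refine ⟨σ, hσ, fun x hx hx0 => ?_⟩
        rcases List.mem_cons.1 hx with rfl | hx
        · exact haσ
        · exact hall x hx hx0

/-- Conversely, if all non-null signs coincide there is no alternation. [folklore] -/
private theorem alternations_eq_zero_of_forall_eq :
    ∀ (l : List ℤ) (σ : ℤ), (∀ x ∈ l, x ≠ 0 → x = σ) → alternations l = 0
  | [], _, _ => by simp
  | a :: l, σ, h => by
    have hl : ∀ x ∈ l, x ≠ 0 → x = σ := fun x hx => h x (List.mem_cons_of_mem a hx)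
    by_cases ha : a = 0
    · subst ha; rw [alternations_cons_zero]; exact alternations_eq_zero_of_forall_eq l σ hl
    · cases hf : l.filter (fun s => s ≠ 0) with
      | nil => exact alternations_cons_of_filter_eq_nil ha hf
      | cons b r =>
        rw [alternations_cons_of_filter_eq_cons ha hf, alternations_eq_zero_of_forall_eq l σ hl]
        have hb : b ∈ l.filter (fun s => s ≠ 0) := by rw [hf]; exact List.mem_cons_self
        have hb0 : b ≠ 0 := by simpa using (List.mem_filter.1 hb).2
        have hbσ : b = σ := hl b (List.mem_of_mem_filter hb) hb0
        have haσ : a = σ := h a List.mem_cons_self ha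
        subst hbσ; subst haσ
        have : ¬ a * a < 0 := not_lt.2 (mul_self_nonneg a)
        simp [this]

/-- Exactly one alternation: the list splits into a first block whose non-null signs are all `σ`
and a second block whose non-null signs are all `−σ`, both blocks containing a non-null sign.
[folklore] -/
private theorem exists_split_of_alternations_eq_one :
    ∀ l : List ℤ, (∀ x ∈ l, x = 0 ∨ x = 1 ∨ x = -1) → alternations l = 1 →
      ∃ (σ : ℤ) (l₁ l₂ : List ℤ), (σ = 1 ∨ σ = -1) ∧ l = l₁ ++ l₂ ∧
        (∀ x ∈ l₁, x ≠ 0 → x = σ) ∧ (∀ x ∈ l₂, x ≠ 0 → x = -σ) ∧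
        (∃ x ∈ l₁, x ≠ 0) ∧ (∃ x ∈ l₂, x ≠ 0)
  | [], _, h => by simp at h
  | a :: l, hl, h => by
    have hl' : ∀ x ∈ l, x = 0 ∨ x = 1 ∨ x = -1 := fun x hx => hl x (List.mem_cons_of_mem a hx)
    by_cases ha : a = 0
    · subst ha
      rw [alternations_cons_zero] at h
      obtain ⟨σ, l₁, l₂, hσ, rfl, h₁, h₂, ⟨x₁, hx₁, hx₁0⟩, hne₂⟩ :=
        exists_split_of_alternations_eq_one l hl' h
      refine ⟨σ, 0 :: l₁, l₂, hσ, by simp, fun x hx hx0 => ?_, h₂,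
        ⟨x₁, List.mem_cons_of_mem _ hx₁, hx₁0⟩, hne₂⟩
      rcases List.mem_cons.1 hx with rfl | hx
      · exact absurd rfl hx0
      · exact h₁ x hx hx0
    · have ha' : a = 1 ∨ a = -1 := by
        rcases hl a List.mem_cons_self with h | h <;> tauto
      cases hf : l.filter (fun s => s ≠ 0) with
      | nil => rw [alternations_cons_of_filter_eq_nil ha hf] at h; exact absurd h (by norm_num)
      | cons b r =>
        have hb : b ∈ l.filter (fun s => s ≠ 0) := by rw [hf]; exact List.mem_cons_self
        have hbl : b ∈ l := List.mem_of_mem_filter hb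
        have hb0 : b ≠ 0 := by simpa using (List.mem_filter.1 hb).2
        have hb' : b = 1 ∨ b = -1 := by rcases hl' b hbl with h | h <;> tauto
        rw [alternations_cons_of_filter_eq_cons ha hf] at h
        by_cases hab : a * b < 0
        · -- the alternation is here; the tail has none
          simp only [hab, if_true] at h
          have h0 : alternations l = 0 := by omega
          obtain ⟨σ', hσ', hall⟩ := exists_forall_eq_of_alternations_eq_zero l hl' h0
          have hbσ' : b = σ' := hall b hbl hb0
          have hba : b = -a := by
            rcases ha' with rfl | rfl <;> rcases hb' with rfl | rfl <;> omega
          refine ⟨a, [a], l, ha', by simp, fun x hx _ => by simpa using hx, fun x hx hx0 => ?_,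
            ⟨a, by simp, ha⟩, ⟨b, hbl, hb0⟩⟩
          rw [hall x hx hx0, ← hbσ', hba]
        · simp only [hab, if_false, add_zero] at h
          obtain ⟨σ, l₁, l₂, hσ, hl12, h₁, h₂, ⟨x₁, hx₁, hx₁0⟩, hne₂⟩ :=
            exists_split_of_alternations_eq_one l hl' h
          -- the first non-null sign `b` of `l = l₁ ++ l₂` lies in `l₁`
          have hbl₁ : b ∈ l₁ := by
            have hf' : (l₁ ++ l₂).filter (fun s => s ≠ 0) = b :: r := by rw [← hl12]; exact hf
            rw [List.filter_append] at hf'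
            cases hf₁ : l₁.filter (fun s => s ≠ 0) with
            | nil =>
              have : x₁ ∈ l₁.filter (fun s => s ≠ 0) := List.mem_filter.2 ⟨hx₁, by simpa using hx₁0⟩
              rw [hf₁] at this; simp at this
            | cons c r' =>
              rw [hf₁, List.cons_append] at hf'
              have hcb : c = b := (List.cons.inj hf').1
              have : c ∈ l₁.filter (fun s => s ≠ 0) := by rw [hf₁]; exact List.mem_cons_self
              rw [hcb] at this
              exact List.mem_of_mem_filter this
          have hbσ : b = σ := h₁ b hbl₁ hb0
          have haσ : a = σ := by
            rw [← hbσ]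
            rcases ha' with rfl | rfl <;> rcases hb' with rfl | rfl <;> omega
          refine ⟨σ, a :: l₁, l₂, hσ, by rw [hl12]; rfl, fun x hx hx0 => ?_, h₂,
            ⟨a, List.mem_cons_self, ha⟩, hne₂⟩
          rcases List.mem_cons.1 hx with rfl | hx
          · exact haσ
          · exact h₁ x hx hx0

/-- Parity of the alternation count: even iff the first and the last non-null signs agree (both
absent when there is no non-null sign). [cite: CameronPsarrakos2019, proof of Thm 9 (p. 650): "a sequence of signs contains an even number of alternations if and only if its extremities are equal"] -/
theorem even_alternations_iff :
    ∀ l : List ℤ, (∀ x ∈ l, x = 0 ∨ x = 1 ∨ x = -1) →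
      (Even (alternations l) ↔
        (l.filter (fun s => s ≠ 0)).head? = (l.filter (fun s => s ≠ 0)).getLast?)
  | [], _ => by simp
  | a :: l, hl => by
    have hl' : ∀ x ∈ l, x = 0 ∨ x = 1 ∨ x = -1 := fun x hx => hl x (List.mem_cons_of_mem a hx)
    by_cases ha : a = 0
    · subst ha
      rw [alternations_cons_zero, filter_cons_zero]
      exact even_alternations_iff l hl'
    · have ha' : a = 1 ∨ a = -1 := by
        rcases hl a List.mem_cons_self with h | h <;> tauto
      rw [filter_cons_of_ne ha]
      cases hf : l.filter (fun s => s ≠ 0) with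
      | nil =>
        rw [alternations_cons_of_filter_eq_nil ha hf]
        simp
      | cons b r =>
        have hb : b ∈ l.filter (fun s => s ≠ 0) := by rw [hf]; exact List.mem_cons_self
        have hbl : b ∈ l := List.mem_of_mem_filter hb
        have hb' : b = 1 ∨ b = -1 := by
          rcases hl' b hbl with h | h
          · exact absurd h (by simpa using (List.mem_filter.1 hb).2)
          · exact h
        have ih := even_alternations_iff l hl'
        rw [hf] at ih
        rw [alternations_cons_of_filter_eq_cons ha hf, List.head?_cons, List.getLast?_cons_cons]
        simp only [List.head?_cons] at ih
        -- `getLast? (b :: r)` is some value `c ∈ {1,-1}`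
        obtain ⟨c, hc⟩ : ∃ c, (b :: r).getLast? = some c := ⟨_, List.getLast?_eq_some_getLast (List.cons_ne_nil b r)⟩
        have hcmem : c ∈ l.filter (fun s => s ≠ 0) := by
          rw [hf]; exact List.mem_of_getLast? hc
        have hc' : c = 1 ∨ c = -1 := by
          rcases hl' c (List.mem_of_mem_filter hcmem) with h | h
          · exact absurd h (by simpa using (List.mem_filter.1 hcmem).2)
          · exact h
        rw [hc] at ih ⊢
        simp only [Option.some.injEq] at ih ⊢
        by_cases hab : a * b < 0
        · simp only [hab, if_true]
          rw [Nat.even_add_one, ih]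
          rcases ha' with rfl | rfl <;> rcases hb' with rfl | rfl <;> rcases hc' with rfl | rfl <;>
            simp_all
        · simp only [hab, if_false, add_zero]
          rw [ih]
          rcases ha' with rfl | rfl <;> rcases hb' with rfl | rfl <;> rcases hc' with rfl | rfl <;>
            simp_all


/-- Auxiliary. [folklore] -/
private theorem getElem_ofFn_fin (s : Fin (m + 1) → ℤ) (i : Fin (m + 1)) :
    (List.ofFn s)[(i : ℕ)]'(by rw [List.length_ofFn]; exact i.2) = s i := by
  rw [List.getElem_ofFn]

/-- Entries of `List.ofFn s` before a split point lie in the first block. [folklore] -/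
private theorem mem_left_of_ofFn_eq_append {s : Fin (m + 1) → ℤ} {l₁ l₂ : List ℤ}
    (h : List.ofFn s = l₁ ++ l₂) (i : Fin (m + 1)) (hi : (i : ℕ) < l₁.length) : s i ∈ l₁ := by
  have hi' : (i : ℕ) < (l₁ ++ l₂).length := by
    rw [← h, List.length_ofFn]; exact i.2
  have h1 : s i = (l₁ ++ l₂)[(i : ℕ)]'hi' := by
    rw [← getElem_ofFn_fin s i]
    exact List.getElem_of_eq h _
  rw [h1, List.getElem_append_left hi]
  exact List.getElem_mem hi

/-- Entries of `List.ofFn s` after a split point lie in the second block. [folklore] -/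
private theorem mem_right_of_ofFn_eq_append {s : Fin (m + 1) → ℤ} {l₁ l₂ : List ℤ}
    (h : List.ofFn s = l₁ ++ l₂) (i : Fin (m + 1)) (hi : l₁.length ≤ (i : ℕ)) : s i ∈ l₂ := by
  have hi' : (i : ℕ) < (l₁ ++ l₂).length := by
    rw [← h, List.length_ofFn]; exact i.2
  have h1 : s i = (l₁ ++ l₂)[(i : ℕ)]'hi' := by
    rw [← getElem_ofFn_fin s i]
    exact List.getElem_of_eq h _
  rw [h1, List.getElem_append_right hi]
  exact List.getElem_mem _

/-- Auxiliary. [folklore] -/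
private theorem length_left_le_of_ofFn_eq_append {s : Fin (m + 1) → ℤ} {l₁ l₂ : List ℤ}
    (h : List.ofFn s = l₁ ++ l₂) : l₁.length ≤ m + 1 := by
  have := congrArg List.length h
  rw [List.length_ofFn, List.length_append] at this
  omega

/-- The first non-null entry of `List.ofFn s` is `s k₀` for the least non-null index `k₀`.
[folklore] -/
private theorem head?_filter_ofFn {s : Fin (m + 1) → ℤ} (k₀ : Fin (m + 1)) (hk₀ : s k₀ ≠ 0)
    (hlt : ∀ i : Fin (m + 1), i < k₀ → s i = 0) :
    ((List.ofFn s).filter (fun x => x ≠ 0)).head? = some (s k₀) := by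
  have hsplit : List.ofFn s = (List.ofFn s).take k₀ ++ (List.ofFn s).drop k₀ :=
    (List.take_append_drop _ _).symm
  have hk : (k₀ : ℕ) < (List.ofFn s).length := by rw [List.length_ofFn]; exact k₀.2
  have hdrop : (List.ofFn s).drop k₀ = s k₀ :: (List.ofFn s).drop (k₀ + 1) := by
    rw [List.drop_eq_getElem_cons hk, getElem_ofFn_fin]
  have htake : ((List.ofFn s).take k₀).filter (fun x => x ≠ 0) = [] := by
    rw [List.filter_eq_nil_iff]
    intro x hx
    obtain ⟨j, hj, rfl⟩ := List.mem_iff_getElem.1 hx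
    rw [List.length_take, List.length_ofFn] at hj
    have hj' : j < m + 1 := by omega
    rw [List.getElem_take, List.getElem_ofFn]
    have := hlt ⟨j, hj'⟩ (by rw [Fin.lt_def]; simp only; omega)
    simpa using this
  rw [hsplit, List.filter_append, htake, List.nil_append, hdrop]
  simp [hk₀]

/-- The last non-null entry of `List.ofFn s` is `s k₁` for the largest non-null index `k₁`.
[folklore] -/
private theorem getLast?_filter_ofFn {s : Fin (m + 1) → ℤ} (k₁ : Fin (m + 1)) (hk₁ : s k₁ ≠ 0)
    (hgt : ∀ i : Fin (m + 1), k₁ < i → s i = 0) :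
    ((List.ofFn s).filter (fun x => x ≠ 0)).getLast? = some (s k₁) := by
  have hsplit : List.ofFn s = (List.ofFn s).take (k₁ + 1) ++ (List.ofFn s).drop (k₁ + 1) :=
    (List.take_append_drop _ _).symm
  have hk : (k₁ : ℕ) < (List.ofFn s).length := by rw [List.length_ofFn]; exact k₁.2
  have htake : (List.ofFn s).take (k₁ + 1) = (List.ofFn s).take k₁ ++ [s k₁] := by
    rw [List.take_add_one, List.getElem?_eq_getElem hk, getElem_ofFn_fin]
    rfl
  have hdrop : ((List.ofFn s).drop (k₁ + 1)).filter (fun x => x ≠ 0) = [] := by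
    rw [List.filter_eq_nil_iff]
    intro x hx
    obtain ⟨j, hj, rfl⟩ := List.mem_iff_getElem.1 hx
    rw [List.length_drop, List.length_ofFn] at hj
    rw [List.getElem_drop, List.getElem_ofFn]
    have := hgt ⟨k₁ + 1 + j, by omega⟩ (by rw [Fin.lt_def]; simp only; omega)
    simpa using this
  rw [hsplit, List.filter_append, hdrop, List.append_nil, htake, List.filter_append]
  simp [hk₁]

/-! ### §1. The class `S`: signs, quadratic forms, evaluation -/

/-- `coeffSign B = 0` exactly for the null matrix. [folklore] -/
private theorem coeffSign_eq_zero_iff (B : Matrix (Fin n) (Fin n) 𝕜) : coeffSign B = 0 ↔ B = 0 := by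
  unfold coeffSign
  split_ifs with h1 h2 <;> simp [h1]

/-- `coeffSign` takes the values `0, 1, −1`. [folklore] -/
private theorem coeffSign_trichotomy (B : Matrix (Fin n) (Fin n) 𝕜) :
    coeffSign B = 0 ∨ coeffSign B = 1 ∨ coeffSign B = -1 := by
  unfold coeffSign
  split_ifs <;> simp

/-- `coeffSign B = 1` forces `B` positive definite. [folklore] -/
private theorem posDef_of_coeffSign_eq_one {B : Matrix (Fin n) (Fin n) 𝕜} (h : coeffSign B = 1) :
    B.PosDef := by
  unfold coeffSign at h
  split_ifs at h with h1 h2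
  all_goals first | assumption | simp at h

/-- In the class `S`, `coeffSign (A i) = −1` forces `−A i` positive definite. [folklore] -/
private theorem neg_posDef_of_coeffSign_eq_neg_one {A : Fin (m + 1) → Matrix (Fin n) (Fin n) 𝕜}
    (hA : InS A) (i : Fin (m + 1)) (h : coeffSign (A i) = -1) : (-(A i)).PosDef := by
  unfold coeffSign at h
  split_ifs at h with h1 h2; simp at h
  rcases hA i with h3 | h3 | h3
  · exact absurd h3 h2
  · exact h3
  · exact absurd h3 h1

/-- Every coefficient of a member of `S` is Hermitian. [folklore] -/
private theorem isHermitian_of_inS {A : Fin (m + 1) → Matrix (Fin n) (Fin n) 𝕜} (hA : InS A)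
    (i : Fin (m + 1)) : (A i).IsHermitian := by
  rcases hA i with h | h | h
  · exact h.isHermitian
  · have := h.isHermitian
    rw [Matrix.IsHermitian, conjTranspose_neg, neg_inj] at this
    exact this
  · rw [h]; exact isHermitian_zero

/-- The quadratic form of a negative definite matrix is negative. [folklore] -/
private theorem re_form_neg_of_neg_posDef {B : Matrix (Fin n) (Fin n) 𝕜} (hB : (-B).PosDef)
    {x : Fin n → 𝕜} (hx : x ≠ 0) : RCLike.re (star x ⬝ᵥ (B *ᵥ x)) < 0 := by
  have h := hB.re_dotProduct_pos hx
  rw [neg_mulVec, dotProduct_neg, map_neg] at h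
  linarith

/-- Sign of the quadratic form of a coefficient of `P ∈ S`: positive when `coeffSign = 1`. [folklore] -/
private theorem re_form_pos_of_coeffSign_eq_one {B : Matrix (Fin n) (Fin n) 𝕜} (h : coeffSign B = 1)
    {x : Fin n → 𝕜} (hx : x ≠ 0) : 0 < RCLike.re (star x ⬝ᵥ (B *ᵥ x)) :=
  (posDef_of_coeffSign_eq_one h).re_dotProduct_pos hx

/-- … negative when `coeffSign = −1`. [folklore] -/
private theorem re_form_neg_of_coeffSign_eq_neg_one {A : Fin (m + 1) → Matrix (Fin n) (Fin n) 𝕜}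
    (hA : InS A) {i : Fin (m + 1)} (h : coeffSign (A i) = -1) {x : Fin n → 𝕜} (hx : x ≠ 0) :
    RCLike.re (star x ⬝ᵥ (A i *ᵥ x)) < 0 :=
  re_form_neg_of_neg_posDef (neg_posDef_of_coeffSign_eq_neg_one hA i h) hx

/-- … zero when `coeffSign = 0`. [folklore] -/
private theorem re_form_eq_zero_of_coeffSign_eq_zero {B : Matrix (Fin n) (Fin n) 𝕜} (h : coeffSign B = 0)
    (x : Fin n → 𝕜) : RCLike.re (star x ⬝ᵥ (B *ᵥ x)) = 0 := by
  rw [(coeffSign_eq_zero_iff B).1 h]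
  simp

/-- The quadratic form of a real combination `∑ cᵢ Aᵢ` is the real combination of the quadratic
forms. [folklore] -/
private theorem re_form_sum_smul (A : Fin (m + 1) → Matrix (Fin n) (Fin n) 𝕜) (c : Fin (m + 1) → ℝ)
    (x : Fin n → 𝕜) :
    RCLike.re (star x ⬝ᵥ ((∑ i, ((c i : ℝ) : 𝕜) • A i) *ᵥ x))
      = ∑ i, c i * RCLike.re (star x ⬝ᵥ (A i *ᵥ x)) := by
  rw [Matrix.sum_mulVec, dotProduct_sum, map_sum]
  refine Finset.sum_congr rfl fun i _ => ?_
  rw [Matrix.smul_mulVec, dotProduct_smul, smul_eq_mul, RCLike.re_ofReal_mul]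

/-- A real combination of Hermitian matrices is Hermitian. [folklore] -/
private theorem isHermitian_sum_smul {A : Fin (m + 1) → Matrix (Fin n) (Fin n) 𝕜}
    (hA : ∀ i, (A i).IsHermitian) (c : Fin (m + 1) → ℝ) :
    (∑ i, ((c i : ℝ) : 𝕜) • A i).IsHermitian := by
  unfold Matrix.IsHermitian
  rw [Matrix.conjTranspose_sum]
  refine Finset.sum_congr rfl fun i _ => ?_
  rw [Matrix.conjTranspose_smul, (hA i).eq, RCLike.star_def, RCLike.conj_ofReal]

/-- Entries of the matrix polynomial. [folklore] -/
private theorem matPoly_apply (A : Fin (m + 1) → Matrix (Fin n) (Fin n) 𝕜) (a b : Fin n) :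
    matPoly A a b = ∑ i : Fin (m + 1), (X : 𝕜[X]) ^ (i : ℕ) * C (A i a b) := by
  unfold matPoly
  simp [Matrix.sum_apply, smul_eq_mul]

/-- Evaluating the matrix polynomial entrywise at a scalar `c` gives `∑ cⁱ Aᵢ`. [folklore] -/
private theorem matPoly_map_eval (A : Fin (m + 1) → Matrix (Fin n) (Fin n) 𝕜) (c : 𝕜) :
    (matPoly A).map (fun p => p.eval c) = ∑ i : Fin (m + 1), c ^ (i : ℕ) • A i := by
  refine Matrix.ext fun a b => ?_
  simp only [Matrix.map_apply, matPoly_apply, eval_finsetSum, eval_mul, eval_pow, eval_X, eval_C,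
    Matrix.sum_apply, Matrix.smul_apply, smul_eq_mul]

/-- `det` commutes with evaluation: `(det P)(c) = det (∑ cⁱ Aᵢ)`. [folklore] -/
private theorem eval_det_matPoly (A : Fin (m + 1) → Matrix (Fin n) (Fin n) 𝕜) (c : 𝕜) :
    (matPoly A).det.eval c = (∑ i : Fin (m + 1), c ^ (i : ℕ) • A i).det := by
  have h := RingHom.map_det (Polynomial.evalRingHom c) (matPoly A)
  rw [Polynomial.coe_evalRingHom] at h
  rw [h, ← matPoly_map_eval]
  rfl

/-- At a real point the evaluated polynomial is the real combination `∑ tⁱ Aᵢ`. [folklore] -/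
private theorem sum_pow_smul_eq_real (A : Fin (m + 1) → Matrix (Fin n) (Fin n) 𝕜) (t : ℝ) :
    (∑ i : Fin (m + 1), ((t : ℝ) : 𝕜) ^ (i : ℕ) • A i) = ∑ i : Fin (m + 1), (((t ^ (i : ℕ) : ℝ)) : 𝕜) • A i := by
  simp

/-- Entrywise degree bound `≤ m`. [folklore] -/
private theorem natDegree_matPoly_apply_le (A : Fin (m + 1) → Matrix (Fin n) (Fin n) 𝕜) (a b : Fin n) :
    (matPoly A a b).natDegree ≤ m := by
  rw [matPoly_apply]
  refine (natDegree_sum_le _ _).trans ?_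
  rw [Finset.fold_max_le]
  refine ⟨Nat.zero_le _, fun i _ => ?_⟩
  simp only [Function.comp_apply]
  refine (natDegree_mul_le).trans ?_
  rw [natDegree_C, add_zero]
  refine (natDegree_pow_le).trans ?_
  have := i.2
  calc (i : ℕ) * (X : 𝕜[X]).natDegree ≤ (i : ℕ) * 1 :=
        Nat.mul_le_mul_left _ natDegree_X_le
    _ ≤ m := by omega

/-- Degree of a determinant with entrywise degree bound. [folklore] -/
private theorem natDegree_det_le_of_forall {R : Type*} [CommRing R] {k : ℕ} (M : Matrix (Fin k) (Fin k) R[X])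
    (d : ℕ) (h : ∀ i j, (M i j).natDegree ≤ d) : M.det.natDegree ≤ k * d := by
  rw [Matrix.det_apply]
  refine (natDegree_sum_le _ _).trans ?_
  rw [Finset.fold_max_le]
  refine ⟨Nat.zero_le _, fun σ _ => ?_⟩
  simp only [Function.comp_apply]
  refine (natDegree_smul_le _ _).trans ((natDegree_prod_le _ _).trans ?_)
  calc ∑ i, (M (σ i) i).natDegree ≤ ∑ _i : Fin k, d := Finset.sum_le_sum fun i _ => h (σ i) i
    _ = k * d := by simp

/-- `deg det P ≤ n·m`. [folklore] -/
private theorem natDegree_det_matPoly_le (A : Fin (m + 1) → Matrix (Fin n) (Fin n) 𝕜) :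
    (matPoly A).det.natDegree ≤ n * m :=
  natDegree_det_le_of_forall _ m (natDegree_matPoly_apply_le A)

/-! ### §2. The determinant is a real polynomial; `z⁺` as a real root count -/

/-- Conjugating the coefficients of the matrix polynomial of a Hermitian sequence transposes it.
[folklore] -/
private theorem mapMatrix_conj_matPoly {A : Fin (m + 1) → Matrix (Fin n) (Fin n) 𝕜}
    (hA : ∀ i, (A i).IsHermitian) :
    (Polynomial.mapRingHom (starRingEnd 𝕜)).mapMatrix (matPoly A) = (matPoly A)ᵀ := by
  refine Matrix.ext fun a b => ?_
  rw [RingHom.mapMatrix_apply, Matrix.map_apply, Matrix.transpose_apply, Polynomial.coe_mapRingHom,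
    matPoly_apply, matPoly_apply, Polynomial.map_sum]
  refine Finset.sum_congr rfl fun i _ => ?_
  rw [Polynomial.map_mul, Polynomial.map_pow, Polynomial.map_X, Polynomial.map_C,
    ← (hA i).apply b a, RCLike.star_def]

/-- `det P` is invariant under conjugation of its coefficients. [folklore] -/
private theorem map_conj_det_matPoly {A : Fin (m + 1) → Matrix (Fin n) (Fin n) 𝕜}
    (hA : ∀ i, (A i).IsHermitian) :
    (matPoly A).det.map (starRingEnd 𝕜) = (matPoly A).det := by
  have h := RingHom.map_det (Polynomial.mapRingHom (starRingEnd 𝕜)) (matPoly A)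
  rw [Polynomial.coe_mapRingHom] at h
  rw [h, mapMatrix_conj_matPoly hA, det_transpose]

/-- Hence `det P` is (the image of) a REAL polynomial. [cite: CameronPsarrakos2019, proof of Thm 9 (p. 650): "p(λ) = det P(λ) … is a real scalar polynomial"] -/
theorem exists_map_eq_det_matPoly {A : Fin (m + 1) → Matrix (Fin n) (Fin n) 𝕜}
    (hA : ∀ i, (A i).IsHermitian) :
    ∃ q : ℝ[X], q.map (algebraMap ℝ 𝕜) = (matPoly A).det := by
  rw [← Polynomial.mem_lifts, Polynomial.lifts_iff_coeff_lifts]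
  intro k
  have h := congrArg (fun p => p.coeff k) (map_conj_det_matPoly hA)
  simp only [Polynomial.coeff_map] at h
  rw [RCLike.conj_eq_iff_re] at h
  exact ⟨_, h⟩

/-- The positive real roots of the image of a real polynomial `q` in `𝕜`, with multiplicity, are the
positive roots of `q`. [folklore] -/
private theorem filter_roots_map_eq (q : ℝ[X]) :
    (q.map (algebraMap ℝ 𝕜)).roots.filter (fun μ => RCLike.im μ = 0 ∧ 0 < RCLike.re μ)
      = (q.roots.filter (fun t => 0 < t)).map (algebraMap ℝ 𝕜) := by
  classical
  ext μ
  rw [Multiset.count_filter]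
  by_cases hμ : RCLike.im μ = 0 ∧ 0 < RCLike.re μ
  · rw [if_pos hμ]
    have hμeq : (algebraMap ℝ 𝕜) (RCLike.re μ) = μ := by
      rw [RCLike.algebraMap_eq_ofReal]; exact (RCLike.conj_eq_iff_re.1 (RCLike.conj_eq_iff_im.2 hμ.1))
    rw [← hμeq, Multiset.count_map_eq_count' _ _ (algebraMap ℝ 𝕜).injective, Multiset.count_filter,
      if_pos hμ.2, Polynomial.count_roots, Polynomial.count_roots,
      ← Polynomial.eq_rootMultiplicity_map (algebraMap ℝ 𝕜).injective]
  · rw [if_neg hμ]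
    symm
    rw [Multiset.count_eq_zero]
    intro hmem
    rw [Multiset.mem_map] at hmem
    obtain ⟨t, ht, rfl⟩ := hmem
    rw [Multiset.mem_filter] at ht
    apply hμ
    rw [RCLike.algebraMap_eq_ofReal]
    simp [ht.2]

/-- **`z⁺(P)` is the number of positive roots, with multiplicity, of the real polynomial `det P`.**
[cite: CameronPsarrakos2019, proof of Thm 9 (p. 650): "p(λ) = det P(λ) is a real scalar polynomial", z⁺(P) = number of its positive roots] -/
theorem zplus_eq_countP {A : Fin (m + 1) → Matrix (Fin n) (Fin n) 𝕜} {q : ℝ[X]}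
    (hq : q.map (algebraMap ℝ 𝕜) = (matPoly A).det) :
    zplus A = q.roots.countP (fun t => 0 < t) := by
  unfold zplus
  rw [← hq, filter_roots_map_eq, Multiset.card_map, Multiset.countP_eq_card_filter]

/-- The number of positive eigenvalues never exceeds `n·m` (for a regular `P`). [cite: CameronPsarrakos2019, proof of Lemma 6 (p. 647): "the total number of eigenvalues of P(λ) is equal to mn"] -/
theorem zplus_le (A : Fin (m + 1) → Matrix (Fin n) (Fin n) 𝕜) :
    zplus A ≤ n * m := by
  unfold zplus
  calc Multiset.card ((matPoly A).det.roots.filter _) ≤ Multiset.card (matPoly A).det.roots :=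
        Multiset.card_le_card (Multiset.filter_le _ _)
    _ ≤ (matPoly A).det.natDegree := Polynomial.card_roots' _
    _ ≤ n * m := natDegree_det_matPoly_le A

/-- Bridge to counts of DISTINCT roots (the currency of the Summit-side `MatrixDescartes`): the number
of distinct positive real eigenvalues is at most `z⁺(P)`. [cite: CameronPsarrakos2019, §1 (p. 644), z⁺(P) (positive eigenvalues, with multiplicity)] -/
theorem card_toFinset_filter_le_zplus (A : Fin (m + 1) → Matrix (Fin n) (Fin n) 𝕜) :
    ((matPoly A).det.roots.toFinset.filter (fun μ => RCLike.im μ = 0 ∧ 0 < RCLike.re μ)).card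
      ≤ zplus A := by
  classical
  unfold zplus
  rw [← Multiset.toFinset_filter]
  exact Multiset.toFinset_card_le _


/-! ### §3. Lemma 6, the cases `α(P) = 0` and `α(P) = m` -/

/-- `α(P)` is the alternation count of the sign sequence `(coeffSign A₀, …, coeffSign A_m)`. [folklore] -/
private theorem alpha_eq (A : Fin (m + 1) → Matrix (Fin n) (Fin n) 𝕜) :
    alpha A = alternations (List.ofFn fun i => coeffSign (A i)) := rfl

/-- The sign sequence takes values in `{0, 1, −1}`. [folklore] -/
private theorem signs_mem (A : Fin (m + 1) → Matrix (Fin n) (Fin n) 𝕜) :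
    ∀ x ∈ List.ofFn (fun i => coeffSign (A i)), x = 0 ∨ x = 1 ∨ x = -1 := by
  intro x hx
  rw [List.mem_ofFn] at hx
  obtain ⟨i, rfl⟩ := hx
  exact coeffSign_trichotomy (A i)

/-- If every coefficient is null the matrix polynomial vanishes. [folklore] -/
private theorem matPoly_eq_zero_of_forall {A : Fin (m + 1) → Matrix (Fin n) (Fin n) 𝕜} (h : ∀ i, A i = 0) :
    matPoly A = 0 := by
  unfold matPoly
  simp [h]

/-- A regular `P ∈ S` of positive size has a non-null coefficient. [folklore] -/
private theorem exists_coeffSign_ne_zero {A : Fin (m + 1) → Matrix (Fin n) (Fin n) 𝕜} (hn : 0 < n)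
    (hdet : (matPoly A).det ≠ 0) : ∃ i, coeffSign (A i) ≠ 0 := by
  by_contra h
  push Not at h
  have h0 : matPoly A = 0 := matPoly_eq_zero_of_forall fun i => (coeffSign_eq_zero_iff _).1 (h i)
  haveI : Nonempty (Fin n) := ⟨⟨0, hn⟩⟩
  exact hdet (by rw [h0, Matrix.det_zero])

/-- At a positive real eigenvalue `t` there is a kernel vector `v ≠ 0` of `P(t) = ∑ tⁱ Aᵢ`, and the
quadratic forms of the coefficients at `v` satisfy `∑ tⁱ · re (v* Aᵢ v) = 0`. [cite: CameronPsarrakos2019, §1 (p. 644): eigenvalue μ (det P(μ) = 0) and eigenvector v ≠ 0 with P(μ)v = 0] -/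
theorem exists_kernel_of_isRoot {A : Fin (m + 1) → Matrix (Fin n) (Fin n) 𝕜} {t : ℝ}
    (ht : (matPoly A).det.IsRoot ((t : ℝ) : 𝕜)) :
    ∃ v : Fin n → 𝕜, v ≠ 0 ∧ (∑ i : Fin (m + 1), ((t : ℝ) : 𝕜) ^ (i : ℕ) • A i) *ᵥ v = 0 := by
  classical
  have h : (∑ i : Fin (m + 1), ((t : ℝ) : 𝕜) ^ (i : ℕ) • A i).det = 0 := by
    rw [← eval_det_matPoly]; exact ht
  exact Matrix.exists_mulVec_eq_zero_iff.2 h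

/-- The relation `∑ tⁱ re (v* Aᵢ v) = re (v* P(t) v)`. [folklore] -/
private theorem sum_pow_mul_re_form (A : Fin (m + 1) → Matrix (Fin n) (Fin n) 𝕜) (t : ℝ) (v : Fin n → 𝕜) :
    ∑ i : Fin (m + 1), t ^ (i : ℕ) * RCLike.re (star v ⬝ᵥ (A i *ᵥ v))
      = RCLike.re (star v ⬝ᵥ ((∑ i : Fin (m + 1), ((t : ℝ) : 𝕜) ^ (i : ℕ) • A i) *ᵥ v)) := by
  rw [sum_pow_smul_eq_real, re_form_sum_smul]

/-- **Lemma 6, case `α(P) = 0`** [cite: CameronPsarrakos2019, Lemma 6]: if the non-null coefficients of a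
regular `P ∈ S` all have the same sign, `P` has no positive eigenvalue (the argument of the proof of
Thm 3: `x*P(λ)x` has no positive root for any `x ≠ 0`). [folklore] -/
private theorem zplus_eq_zero_of_alpha_eq_zero {A : Fin (m + 1) → Matrix (Fin n) (Fin n) 𝕜} (hA : InS A)
    (hdet : (matPoly A).det ≠ 0) (hα : alpha A = 0) : zplus A = 0 := by
  classical
  obtain ⟨σ, hσ, hall⟩ := exists_forall_eq_of_alternations_eq_zero _ (signs_mem A) (by rw [← alpha_eq]; exact hα)
  have hall' : ∀ i, coeffSign (A i) ≠ 0 → coeffSign (A i) = σ := fun i hi =>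
    hall _ (List.mem_ofFn.2 ⟨i, rfl⟩) hi
  unfold zplus
  rw [Multiset.card_eq_zero, Multiset.filter_eq_nil]
  rintro μ hμ ⟨him, hre⟩
  -- `μ = t` is a positive real root
  set t : ℝ := RCLike.re μ with ht
  have hμt : ((t : ℝ) : 𝕜) = μ := RCLike.conj_eq_iff_re.1 (RCLike.conj_eq_iff_im.2 him)
  have hroot : (matPoly A).det.IsRoot ((t : ℝ) : 𝕜) := by
    rw [hμt]; exact (Polynomial.mem_roots hdet).1 hμ
  obtain ⟨v, hv, hPv⟩ := exists_kernel_of_isRoot hroot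
  have hsum : ∑ i : Fin (m + 1), t ^ (i : ℕ) * RCLike.re (star v ⬝ᵥ (A i *ᵥ v)) = 0 := by
    rw [sum_pow_mul_re_form, hPv, dotProduct_zero, map_zero]
  have hn : 0 < n := by
    rcases Nat.eq_zero_or_pos n with h0 | h0
    · subst h0; exact absurd (Subsingleton.elim v 0) hv
    · exact h0
  -- every term of the sum has the sign of `σ`, and one of them is non-zero
  obtain ⟨i₀, hi₀⟩ := exists_coeffSign_ne_zero hn hdet
  have hti : ∀ i : Fin (m + 1), 0 < t ^ (i : ℕ) := fun i => pow_pos hre _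
  rcases hσ with rfl | rfl
  · -- all non-null coefficients positive definite
    have hterm : ∀ i : Fin (m + 1), 0 ≤ t ^ (i : ℕ) * RCLike.re (star v ⬝ᵥ (A i *ᵥ v)) := by
      intro i
      rcases coeffSign_trichotomy (A i) with h | h | h
      · rw [re_form_eq_zero_of_coeffSign_eq_zero h, mul_zero]
      · exact mul_nonneg (hti i).le (re_form_pos_of_coeffSign_eq_one h hv).le
      · exact absurd (hall' i (by rw [h]; norm_num)) (by rw [h]; norm_num)
    have h0 := (Finset.sum_eq_zero_iff_of_nonneg fun i _ => hterm i).1 hsum i₀ (Finset.mem_univ _)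
    have h1 : 0 < t ^ (i₀ : ℕ) * RCLike.re (star v ⬝ᵥ (A i₀ *ᵥ v)) :=
      mul_pos (hti i₀) (re_form_pos_of_coeffSign_eq_one (hall' i₀ hi₀) hv)
    linarith
  · have hterm : ∀ i : Fin (m + 1), t ^ (i : ℕ) * RCLike.re (star v ⬝ᵥ (A i *ᵥ v)) ≤ 0 := by
      intro i
      rcases coeffSign_trichotomy (A i) with h | h | h
      · rw [re_form_eq_zero_of_coeffSign_eq_zero h, mul_zero]
      · exact absurd (hall' i (by rw [h]; norm_num)) (by rw [h]; norm_num)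
      · exact mul_nonpos_of_nonneg_of_nonpos (hti i).le (re_form_neg_of_coeffSign_eq_neg_one hA h hv).le
    have hsum' : ∑ i : Fin (m + 1), -(t ^ (i : ℕ) * RCLike.re (star v ⬝ᵥ (A i *ᵥ v))) = 0 := by
      rw [Finset.sum_neg_distrib, hsum, neg_zero]
    have h0 := (Finset.sum_eq_zero_iff_of_nonneg fun i _ => neg_nonneg.2 (hterm i)).1 hsum' i₀
      (Finset.mem_univ _)
    have h1 : t ^ (i₀ : ℕ) * RCLike.re (star v ⬝ᵥ (A i₀ *ᵥ v)) < 0 :=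
      mul_neg_of_pos_of_neg (hti i₀) (re_form_neg_of_coeffSign_eq_neg_one hA (hall' i₀ hi₀) hv)
    linarith

/-! ### §4. Towards Theorem 9: shifted pencils, trailing and leading determinants -/

/-- Entries of a lacunary pencil `∑ X^{eᵢ} Aᵢ`. [folklore] -/
private theorem pencil_apply (e : Fin (m + 1) → ℕ) (A : Fin (m + 1) → Matrix (Fin n) (Fin n) 𝕜) (a b : Fin n) :
    (∑ i, (X : 𝕜[X]) ^ e i • (A i).map C) a b = ∑ i : Fin (m + 1), (X : 𝕜[X]) ^ e i * C (A i a b) := by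
  simp [Matrix.sum_apply, smul_eq_mul]

/-- Conjugating the coefficients of a pencil of Hermitian matrices transposes it. [folklore] -/
private theorem mapMatrix_conj_pencil (e : Fin (m + 1) → ℕ) {A : Fin (m + 1) → Matrix (Fin n) (Fin n) 𝕜}
    (hA : ∀ i, (A i).IsHermitian) :
    (Polynomial.mapRingHom (starRingEnd 𝕜)).mapMatrix (∑ i, (X : 𝕜[X]) ^ e i • (A i).map C)
      = (∑ i, (X : 𝕜[X]) ^ e i • (A i).map C)ᵀ := by
  refine Matrix.ext fun a b => ?_
  rw [RingHom.mapMatrix_apply, Matrix.map_apply, Matrix.transpose_apply, Polynomial.coe_mapRingHom,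
    pencil_apply, pencil_apply, Polynomial.map_sum]
  refine Finset.sum_congr rfl fun i _ => ?_
  rw [Polynomial.map_mul, Polynomial.map_pow, Polynomial.map_X, Polynomial.map_C,
    ← (hA i).apply b a, RCLike.star_def]

/-- The determinant of a pencil of Hermitian matrices is (the image of) a real polynomial. [folklore] -/
private theorem exists_map_eq_det_pencil (e : Fin (m + 1) → ℕ) {A : Fin (m + 1) → Matrix (Fin n) (Fin n) 𝕜}
    (hA : ∀ i, (A i).IsHermitian) :
    ∃ q : ℝ[X], q.map (algebraMap ℝ 𝕜) = (∑ i, (X : 𝕜[X]) ^ e i • (A i).map C).det := by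
  have hconj : (∑ i, (X : 𝕜[X]) ^ e i • (A i).map C).det.map (starRingEnd 𝕜)
      = (∑ i, (X : 𝕜[X]) ^ e i • (A i).map C).det := by
    have h := RingHom.map_det (Polynomial.mapRingHom (starRingEnd 𝕜))
      (∑ i, (X : 𝕜[X]) ^ e i • (A i).map C)
    rw [Polynomial.coe_mapRingHom] at h
    rw [h, mapMatrix_conj_pencil e hA, det_transpose]
  rw [← Polynomial.mem_lifts, Polynomial.lifts_iff_coeff_lifts]
  intro k
  have h := congrArg (fun p => p.coeff k) hconj
  simp only [Polynomial.coeff_map] at h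
  rw [RCLike.conj_eq_iff_re] at h
  exact ⟨_, h⟩

/-- Entrywise degree bound for a pencil. [folklore] -/
private theorem natDegree_pencil_apply_le (e : Fin (m + 1) → ℕ) (A : Fin (m + 1) → Matrix (Fin n) (Fin n) 𝕜)
    {d : ℕ} (hd : ∀ i, A i ≠ 0 → e i ≤ d) (a b : Fin n) :
    ((∑ i, (X : 𝕜[X]) ^ e i • (A i).map C) a b).natDegree ≤ d := by
  rw [pencil_apply]
  refine (natDegree_sum_le _ _).trans ?_
  rw [Finset.fold_max_le]
  refine ⟨Nat.zero_le _, fun i _ => ?_⟩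
  simp only [Function.comp_apply]
  by_cases h0 : A i = 0
  · simp [h0]
  · refine (natDegree_mul_le).trans ?_
    rw [natDegree_C, add_zero]
    refine (natDegree_pow_le).trans ?_
    calc e i * (X : 𝕜[X]).natDegree ≤ e i * 1 := Nat.mul_le_mul_left _ natDegree_X_le
      _ ≤ d := by rw [mul_one]; exact hd i h0

/-- The `X^K`-coefficient matrix of a pencil whose only exponent-`K` term with a non-null coefficient
is `i = k`. [folklore] -/
private theorem map_coeff_pencil_eq (e : Fin (m + 1) → ℕ) (A : Fin (m + 1) → Matrix (Fin n) (Fin n) 𝕜)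
    (K : ℕ) (k : Fin (m + 1)) (hk : e k = K) (hne : ∀ i, i ≠ k → A i ≠ 0 → e i ≠ K) :
    (∑ i, (X : 𝕜[X]) ^ e i • (A i).map C).map (fun p => p.coeff K) = A k := by
  refine Matrix.ext fun a b => ?_
  rw [Matrix.map_apply, pencil_apply, finsetSum_coeff, Finset.sum_eq_single k]
  · rw [coeff_X_pow_mul', if_pos (hk ▸ le_rfl), hk, Nat.sub_self, coeff_C_zero]
  · intro i _ hik
    by_cases h0 : A i = 0
    · simp [h0]
    · rw [Polynomial.coeff_X_pow_mul']
      split_ifs with hle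
      · rw [coeff_C, if_neg]
        have := hne i hik h0
        omega
      · rfl
  · intro h; exact absurd (Finset.mem_univ k) h

/-- Evaluating a pencil at `0` picks out the coefficients with exponent `0`. [folklore] -/
private theorem map_eval_zero_pencil_eq (e : Fin (m + 1) → ℕ) (A : Fin (m + 1) → Matrix (Fin n) (Fin n) 𝕜)
    (k : Fin (m + 1)) (hk : e k = 0) (hne : ∀ i, i ≠ k → A i ≠ 0 → e i ≠ 0) :
    (∑ i, (X : 𝕜[X]) ^ e i • (A i).map C).map (fun p => p.eval 0) = A k := by
  have h := map_coeff_pencil_eq e A 0 k hk hne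
  rw [← h]
  refine Matrix.ext fun a b => ?_
  simp only [Matrix.map_apply, Polynomial.coeff_zero_eq_eval_zero]

/-- `det` commutes with evaluation (pencil version). [folklore] -/
private theorem eval_det_pencil' (e : Fin (m + 1) → ℕ) (A : Fin (m + 1) → Matrix (Fin n) (Fin n) 𝕜) (c : 𝕜) :
    (∑ i, (X : 𝕜[X]) ^ e i • (A i).map C).det.eval c
      = ((∑ i, (X : 𝕜[X]) ^ e i • (A i).map C).map (fun p => p.eval c)).det := by
  have h := RingHom.map_det (Polynomial.evalRingHom c) (∑ i, (X : 𝕜[X]) ^ e i • (A i).map C)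
  rw [Polynomial.coe_evalRingHom] at h
  rw [h]
  rfl

/-- The determinant of a positive definite matrix is a positive real. [folklore] -/
private theorem exists_det_eq_of_posDef {B : Matrix (Fin n) (Fin n) 𝕜} (hB : B.PosDef) :
    ∃ d : ℝ, 0 < d ∧ B.det = ((d : ℝ) : 𝕜) := by
  have h := hB.det_pos
  rw [RCLike.pos_iff] at h
  exact ⟨RCLike.re B.det, h.1, (RCLike.conj_eq_iff_re.1 (RCLike.conj_eq_iff_im.2 h.2)).symm⟩

/-- The determinant of a negative definite `n × n` matrix is `(−1)^n` times a positive real. [folklore] -/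
private theorem exists_det_eq_of_neg_posDef {B : Matrix (Fin n) (Fin n) 𝕜} (hB : (-B).PosDef) :
    ∃ d : ℝ, 0 < d ∧ B.det = (((-1) ^ n * d : ℝ) : 𝕜) := by
  obtain ⟨d, hd, hdet⟩ := exists_det_eq_of_posDef hB
  refine ⟨d, hd, ?_⟩
  have h : B = -(-B) := (neg_neg B).symm
  rw [h, Matrix.det_neg (-B), hdet, Fintype.card_fin]
  push_cast
  ring


/-- Below the least non-null index the matrix polynomial is divisible by the corresponding power of
`X`: `P(X) = X^{k₀} · ∑ X^{i−k₀} Aᵢ`. [folklore] -/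
private theorem matPoly_eq_X_pow_smul (A : Fin (m + 1) → Matrix (Fin n) (Fin n) 𝕜) (k₀ : Fin (m + 1))
    (hlow : ∀ i, i < k₀ → A i = 0) :
    matPoly A = (X : 𝕜[X]) ^ (k₀ : ℕ) • ∑ i : Fin (m + 1), (X : 𝕜[X]) ^ ((i : ℕ) - k₀) • (A i).map C := by
  unfold matPoly
  rw [Finset.smul_sum]
  refine Finset.sum_congr rfl fun i _ => ?_
  by_cases hi : i < k₀
  · simp [hlow i hi]
  · rw [smul_smul, ← pow_add, Nat.add_sub_cancel' (Fin.not_lt.1 hi)]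

/-- **Theorem 9, first assertion** [cite: CameronPsarrakos2019, Thm 9]: for a regular `P ∈ S`, `z⁺(P)` and
`n·α(P)` have the same parity.  (Recall that the rule `z⁺ ≤ n·α` itself is FALSE in general:
`cameronPsarrakosRule_real_false`, `not_matrixDescartes_two_two`.) [folklore] -/
private theorem even_zplus_iff {A : Fin (m + 1) → Matrix (Fin n) (Fin n) 𝕜} (hA : InS A)
    (hdet : (matPoly A).det ≠ 0) : Even (zplus A) ↔ Even (n * alpha A) := by
  classical
  rcases Nat.eq_zero_or_pos n with hn | hn
  · subst hn
    have h1 : zplus A = 0 := Nat.eq_zero_of_le_zero (by simpa using zplus_le A)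
    simp [h1]
  -- the non-null indices, the least one `k₀` and the largest one `k₁`
  set S : Finset (Fin (m + 1)) := Finset.univ.filter (fun i => coeffSign (A i) ≠ 0) with hS
  have hSne : S.Nonempty := by
    obtain ⟨i, hi⟩ := exists_coeffSign_ne_zero hn hdet
    exact ⟨i, Finset.mem_filter.2 ⟨Finset.mem_univ _, hi⟩⟩
  set k₀ := S.min' hSne with hk₀def
  set k₁ := S.max' hSne with hk₁def
  have hk₀ : coeffSign (A k₀) ≠ 0 := (Finset.mem_filter.1 (S.min'_mem hSne)).2
  have hk₁ : coeffSign (A k₁) ≠ 0 := (Finset.mem_filter.1 (S.max'_mem hSne)).2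
  have hmemS : ∀ i, A i ≠ 0 → i ∈ S := fun i hi =>
    Finset.mem_filter.2 ⟨Finset.mem_univ _, fun h => hi ((coeffSign_eq_zero_iff _).1 h)⟩
  have hlow : ∀ i, i < k₀ → A i = 0 := fun i hi => by
    by_contra h
    exact absurd (S.min'_le i (hmemS i h)) (not_le.2 hi)
  have hhigh : ∀ i, k₁ < i → A i = 0 := fun i hi => by
    by_contra h
    exact absurd (S.le_max' i (hmemS i h)) (not_le.2 hi)
  have hlow' : ∀ i, i < k₀ → coeffSign (A i) = 0 := fun i hi =>
    (coeffSign_eq_zero_iff _).2 (hlow i hi)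
  have hhigh' : ∀ i, k₁ < i → coeffSign (A i) = 0 := fun i hi =>
    (coeffSign_eq_zero_iff _).2 (hhigh i hi)
  have hk₀₁ : k₀ ≤ k₁ := S.min'_le k₁ (S.max'_mem hSne)
  -- the shifted pencil `M = ∑ X^{i-k₀} Aᵢ`, `P = X^{k₀} M`
  set e : Fin (m + 1) → ℕ := fun i => (i : ℕ) - k₀ with he
  set M : Matrix (Fin n) (Fin n) 𝕜[X] := ∑ i, (X : 𝕜[X]) ^ e i • (A i).map C with hM
  have hfac : matPoly A = (X : 𝕜[X]) ^ (k₀ : ℕ) • M := matPoly_eq_X_pow_smul A k₀ hlow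
  have hdetfac : (matPoly A).det = X ^ (n * k₀) * M.det := by
    rw [hfac, det_smul, Fintype.card_fin, ← pow_mul, mul_comm (k₀ : ℕ) n]
  have hMdet : M.det ≠ 0 := fun h => hdet (by rw [hdetfac, h, mul_zero])
  -- real lift
  obtain ⟨q₁, hq₁⟩ := exists_map_eq_det_pencil e (isHermitian_of_inS hA)
  have hq : (X ^ (n * k₀) * q₁).map (algebraMap ℝ 𝕜) = (matPoly A).det := by
    rw [Polynomial.map_mul, Polynomial.map_pow, map_X, hq₁, hdetfac]
  have hq₁0 : q₁ ≠ 0 := by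
    rintro rfl
    rw [Polynomial.map_zero] at hq₁
    exact hMdet hq₁.symm
  have hz : zplus A = q₁.roots.countP (fun t => 0 < t) := by
    rw [zplus_eq_countP hq, roots_mul (mul_ne_zero (pow_ne_zero _ X_ne_zero) hq₁0), roots_X_pow,
      Multiset.countP_add, Multiset.countP_nsmul]
    have h0 : Multiset.countP (fun t : ℝ => 0 < t) {0} = 0 :=
      Multiset.countP_eq_zero.2 fun t ht => by
        rw [Multiset.mem_singleton] at ht; rw [ht]; exact lt_irrefl 0
    rw [h0, mul_zero, zero_add]
  -- trailing coefficient of `q₁`: `det A_{k₀}`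
  have hne₀ : ∀ i, i ≠ k₀ → A i ≠ 0 → e i ≠ 0 := by
    intro i hi hAi
    have h1 : ¬ i < k₀ := fun h => hAi (hlow i h)
    have h2 : k₀ < i := lt_of_le_of_ne (Fin.not_lt.1 h1) (Ne.symm hi)
    simp only [he]
    have := Fin.lt_def.1 h2
    omega
  have hc0 : (algebraMap ℝ 𝕜) (q₁.coeff 0) = (A k₀).det := by
    rw [← coeff_map, hq₁, coeff_zero_eq_eval_zero, eval_det_pencil',
      map_eval_zero_pencil_eq e A k₀ (by simp [he]) hne₀]
  -- leading coefficient of `q₁`: `det A_{k₁}`, in degree `N = n (k₁ - k₀)`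
  set N : ℕ := n * ((k₁ : ℕ) - k₀) with hN
  have hd : ∀ i, A i ≠ 0 → e i ≤ (k₁ : ℕ) - k₀ := by
    intro i hAi
    have h1 : ¬ k₁ < i := fun h => hAi (hhigh i h)
    have := Fin.not_lt.1 h1
    simp only [he]
    have := Fin.le_def.1 this
    omega
  have hne₁ : ∀ i, i ≠ k₁ → A i ≠ 0 → e i ≠ (k₁ : ℕ) - k₀ := by
    intro i hi hAi he1
    have h1 : ¬ k₁ < i := fun h => hAi (hhigh i h)
    have h2 : ¬ i < k₀ := fun h => hAi (hlow i h)
    have h3 := Fin.not_lt.1 h1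
    have h4 := Fin.not_lt.1 h2
    simp only [he] at he1
    apply hi
    apply Fin.ext
    have := Fin.le_def.1 h3
    have := Fin.le_def.1 h4
    have := Fin.le_def.1 hk₀₁
    omega
  have hdeg : M.det.natDegree ≤ N :=
    natDegree_det_le_of_forall M _ (natDegree_pencil_apply_le e A hd)
  have hcN : M.det.coeff N = (A k₁).det := by
    have h := Literature.AlgebraicGeometry.DeterminantalHypersurfaces.coeff_det_of_natDegree_le M
      ((k₁ : ℕ) - k₀) (natDegree_pencil_apply_le e A hd)
    rw [Fintype.card_fin] at h
    rw [h, map_coeff_pencil_eq e A _ k₁ rfl hne₁]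
  have hq₁N : (algebraMap ℝ 𝕜) (q₁.coeff N) = (A k₁).det := by
    rw [← coeff_map, hq₁, hcN]
  -- the two determinants as signed positive reals
  have hsign : ∀ k : Fin (m + 1), coeffSign (A k) ≠ 0 → ∃ d : ℝ, 0 < d ∧
      (A k).det = ((if coeffSign (A k) = 1 then d else (-1) ^ n * d : ℝ) : 𝕜) := by
    intro k hk
    rcases coeffSign_trichotomy (A k) with h | h | h
    · exact absurd h hk
    · obtain ⟨d, hd, hdet⟩ := exists_det_eq_of_posDef (posDef_of_coeffSign_eq_one h)
      exact ⟨d, hd, by rw [hdet, if_pos h]⟩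
    · obtain ⟨d, hd, hdet⟩ := exists_det_eq_of_neg_posDef (neg_posDef_of_coeffSign_eq_neg_one hA k h)
      refine ⟨d, hd, ?_⟩
      rw [hdet, if_neg (by rw [h]; norm_num)]
  obtain ⟨d₀, hd₀, hdet₀⟩ := hsign k₀ hk₀
  obtain ⟨d₁, hd₁, hdet₁⟩ := hsign k₁ hk₁
  have hc0' : q₁.coeff 0 = (if coeffSign (A k₀) = 1 then d₀ else (-1) ^ n * d₀) :=
    (algebraMap ℝ 𝕜).injective (by rw [hc0, hdet₀, RCLike.algebraMap_eq_ofReal])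
  have hcN' : q₁.coeff N = (if coeffSign (A k₁) = 1 then d₁ else (-1) ^ n * d₁) :=
    (algebraMap ℝ 𝕜).injective (by rw [hq₁N, hdet₁, RCLike.algebraMap_eq_ofReal])
  have hc0ne : q₁.coeff 0 ≠ 0 := by
    rw [hc0']; split_ifs <;> positivity
  have hcNne : q₁.coeff N ≠ 0 := by
    rw [hcN']; split_ifs <;> positivity
  have hq₁deg : q₁.natDegree = N := by
    refine le_antisymm ?_ (le_natDegree_of_ne_zero hcNne)
    rw [← natDegree_map_eq_of_injective (algebraMap ℝ 𝕜).injective, hq₁]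
    exact hdeg
  have hlc : q₁.leadingCoeff = q₁.coeff N := by rw [leadingCoeff, hq₁deg]
  -- parity of `z⁺`
  have hpar : Even (zplus A) ↔ 0 < q₁.leadingCoeff * q₁.coeff 0 := by
    rw [hz]
    exact Literature.Algebra.Polynomial.Descartes.even_countP_roots_pos_iff hc0ne
  -- parity of `α`
  have hα : Even (alpha A) ↔ coeffSign (A k₀) = coeffSign (A k₁) := by
    rw [alpha_eq, even_alternations_iff _ (signs_mem A),
      head?_filter_ofFn (s := fun i => coeffSign (A i)) k₀ hk₀ hlow',
      getLast?_filter_ofFn (s := fun i => coeffSign (A i)) k₁ hk₁ hhigh']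
    simp
  rw [hpar, Nat.even_mul, hα, hlc, hcN', hc0']
  have hs₀ : coeffSign (A k₀) = 1 ∨ coeffSign (A k₀) = -1 := by
    rcases coeffSign_trichotomy (A k₀) with h | h | h
    · exact absurd h hk₀
    · exact Or.inl h
    · exact Or.inr h
  have hs₁ : coeffSign (A k₁) = 1 ∨ coeffSign (A k₁) = -1 := by
    rcases coeffSign_trichotomy (A k₁) with h | h | h
    · exact absurd h hk₁
    · exact Or.inl h
    · exact Or.inr h
  rcases Nat.even_or_odd n with hev | hodd
  · simp only [hev, true_or, iff_true]
    rw [hev.neg_one_pow]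
    split_ifs <;> nlinarith
  · have hne : ¬ Even n := Nat.not_even_iff_odd.2 hodd
    simp only [hne, false_or]
    rw [hodd.neg_one_pow]
    rcases hs₀ with h₀ | h₀ <;> rcases hs₁ with h₁ | h₁ <;> simp only [h₀, h₁] <;> norm_num <;> nlinarith

end Rules

namespace Rules

variable {𝕜 : Type*} [RCLike 𝕜] {n m : ℕ}

/-! ### §5. Lemma 6, the case `α(P) = 1`: sign structure, Loewner monotonicity, transversality -/

/-- The quotient `p / (X − a)` of a polynomial vanishing at `a` evaluates at `a` to `p′(a)`. [folklore] -/
private theorem eval_divByMonic_X_sub_C_eq_derivative {R : Type*} [CommRing R] {p : R[X]} {a : R}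
    (h : p.IsRoot a) : (p /ₘ (X - C a)).eval a = p.derivative.eval a := by
  have hmul : (X - C a) * (p /ₘ (X - C a)) = p := mul_divByMonic_eq_iff_isRoot.2 h
  have hd := congrArg (fun q => (derivative q).eval a) hmul
  simp only [derivative_mul, derivative_sub, derivative_X, derivative_C, sub_zero, one_mul,
    eval_add, eval_mul, eval_sub, eval_X, eval_C, sub_self, zero_mul, add_zero] at hd
  exact hd

/-- One sign alternation: there are a sign `σ = ±1` and a split index `j` such that the non-null
coefficients of index `< j` have sign `σ`, those of index `≥ j` have sign `−σ`, and both kinds occur.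
[folklore] -/
private theorem exists_pivot_of_alpha_eq_one {A : Fin (m + 1) → Matrix (Fin n) (Fin n) 𝕜}
    (hα : alpha A = 1) :
    ∃ (σ : ℤ) (j : ℕ), (σ = 1 ∨ σ = -1) ∧
      (∀ i : Fin (m + 1), (i : ℕ) < j → coeffSign (A i) = 0 ∨ coeffSign (A i) = σ) ∧
      (∀ i : Fin (m + 1), j ≤ (i : ℕ) → coeffSign (A i) = 0 ∨ coeffSign (A i) = -σ) ∧
      (∃ i : Fin (m + 1), (i : ℕ) < j ∧ coeffSign (A i) = σ) ∧
      (∃ i : Fin (m + 1), j ≤ (i : ℕ) ∧ coeffSign (A i) = -σ) := by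
  obtain ⟨σ, l₁, l₂, hσ, hsplit, h₁, h₂, ⟨x₁, hx₁, hx₁0⟩, ⟨x₂, hx₂, hx₂0⟩⟩ :=
    exists_split_of_alternations_eq_one _ (signs_mem A) (by rw [← alpha_eq]; exact hα)
  refine ⟨σ, l₁.length, hσ, fun i hi => ?_, fun i hi => ?_, ?_, ?_⟩
  · have hmem := mem_left_of_ofFn_eq_append hsplit i hi
    by_cases h0 : coeffSign (A i) = 0
    · exact Or.inl h0
    · exact Or.inr (h₁ _ hmem h0)
  · have hmem := mem_right_of_ofFn_eq_append hsplit i hi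
    by_cases h0 : coeffSign (A i) = 0
    · exact Or.inl h0
    · exact Or.inr (h₂ _ hmem h0)
  · -- a non-null entry of `l₁` is some `coeffSign (A i)` with `i < |l₁|`
    obtain ⟨k, hk, hkx⟩ := List.mem_iff_getElem.1 hx₁
    have hlen := length_left_le_of_ofFn_eq_append hsplit
    have hk' : k < m + 1 := lt_of_lt_of_le hk hlen
    refine ⟨⟨k, hk'⟩, hk, ?_⟩
    have hget : coeffSign (A ⟨k, hk'⟩) = (l₁ ++ l₂)[k]'(by rw [List.length_append]; omega) := by
      rw [← getElem_ofFn_fin (fun i => coeffSign (A i)) ⟨k, hk'⟩]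
      exact List.getElem_of_eq hsplit _
    rw [hget, List.getElem_append_left hk, hkx]
    exact h₁ x₁ hx₁ hx₁0
  · obtain ⟨k, hk, hkx⟩ := List.mem_iff_getElem.1 hx₂
    have hlen : l₁.length + l₂.length = m + 1 := by
      have := congrArg List.length hsplit
      rw [List.length_ofFn, List.length_append] at this
      exact this.symm
    have hk' : l₁.length + k < m + 1 := by omega
    refine ⟨⟨l₁.length + k, hk'⟩, Nat.le_add_right _ _, ?_⟩
    have hget : coeffSign (A ⟨l₁.length + k, hk'⟩)
        = (l₁ ++ l₂)[l₁.length + k]'(by rw [List.length_append]; omega) := by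
      rw [← getElem_ofFn_fin (fun i => coeffSign (A i)) ⟨l₁.length + k, hk'⟩]
      exact List.getElem_of_eq hsplit _
    rw [hget, List.getElem_append_right (Nat.le_add_right _ _)]
    simp only [Nat.add_sub_cancel_left, hkx]
    exact h₂ x₂ hx₂ hx₂0

/-- In the class `S`, a coefficient of sign `σ = ±1` has quadratic form of sign `σ`. [folklore] -/
private theorem mul_re_form_pos_of_coeffSign_eq {A : Fin (m + 1) → Matrix (Fin n) (Fin n) 𝕜}
    (hA : InS A) {σ : ℤ} (hσ : σ = 1 ∨ σ = -1) {i : Fin (m + 1)} (h : coeffSign (A i) = σ)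
    {x : Fin n → 𝕜} (hx : x ≠ 0) : 0 < (σ : ℝ) * RCLike.re (star x ⬝ᵥ (A i *ᵥ x)) := by
  rcases hσ with rfl | rfl
  · rw [Int.cast_one, one_mul]; exact re_form_pos_of_coeffSign_eq_one h hx
  · have := re_form_neg_of_coeffSign_eq_neg_one hA h hx
    push_cast
    linarith

/-- … and a coefficient of sign `0` or `σ` has quadratic form of sign `σ` or zero. [folklore] -/
private theorem mul_re_form_nonneg_of_coeffSign {A : Fin (m + 1) → Matrix (Fin n) (Fin n) 𝕜}
    (hA : InS A) {σ : ℤ} (hσ : σ = 1 ∨ σ = -1) {i : Fin (m + 1)}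
    (h : coeffSign (A i) = 0 ∨ coeffSign (A i) = σ) (x : Fin n → 𝕜) :
    0 ≤ (σ : ℝ) * RCLike.re (star x ⬝ᵥ (A i *ᵥ x)) := by
  rcases h with h | h
  · rw [re_form_eq_zero_of_coeffSign_eq_zero h, mul_zero]
  · by_cases hx : x = 0
    · subst hx; simp
    · exact (mul_re_form_pos_of_coeffSign_eq hA hσ h hx).le

/-- Monotonicity of the weights `t ↦ tᵏ/tʲ` on `(0, ∞)`: non-decreasing for `k ≥ j`. [folklore] -/
private theorem pow_div_pow_le_of_le {s t : ℝ} (hs : 0 < s) (hst : s ≤ t) {k j : ℕ} (hkj : j ≤ k) :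
    s ^ k / s ^ j ≤ t ^ k / t ^ j := by
  have ht : 0 < t := lt_of_lt_of_le hs hst
  obtain ⟨d, rfl⟩ := Nat.exists_eq_add_of_le hkj
  rw [pow_add, pow_add, mul_div_cancel_left₀ _ (pow_ne_zero _ hs.ne'),
    mul_div_cancel_left₀ _ (pow_ne_zero _ ht.ne')]
  exact pow_le_pow_left₀ hs.le hst _

/-- … non-increasing for `k ≤ j`. [folklore] -/
private theorem pow_div_pow_le_of_le' {s t : ℝ} (hs : 0 < s) (hst : s ≤ t) {k j : ℕ} (hkj : k ≤ j) :
    t ^ k / t ^ j ≤ s ^ k / s ^ j := by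
  have ht : 0 < t := lt_of_lt_of_le hs hst
  obtain ⟨d, rfl⟩ := Nat.exists_eq_add_of_le hkj
  rw [div_le_div_iff₀ (pow_pos ht _) (pow_pos hs _), pow_add, pow_add]
  have h1 : s ^ d ≤ t ^ d := pow_le_pow_left₀ hs.le hst _
  have h2 : 0 ≤ t ^ k * s ^ k := by positivity
  calc t ^ k * (s ^ k * s ^ d) = (t ^ k * s ^ k) * s ^ d := by ring
    _ ≤ (t ^ k * s ^ k) * t ^ d := mul_le_mul_of_nonneg_left h1 h2
    _ = s ^ k * (t ^ k * t ^ d) := by ring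

/-- … strictly decreasing for `k < j`. [folklore] -/
private theorem pow_div_pow_lt_of_lt {s t : ℝ} (hs : 0 < s) (hst : s < t) {k j : ℕ} (hkj : k < j) :
    t ^ k / t ^ j < s ^ k / s ^ j := by
  have ht : 0 < t := hs.trans hst
  obtain ⟨d, rfl⟩ := Nat.exists_eq_add_of_le hkj.le
  have hd : d ≠ 0 := by omega
  rw [div_lt_div_iff₀ (pow_pos ht _) (pow_pos hs _), pow_add, pow_add]
  have h1 : s ^ d < t ^ d := pow_lt_pow_left₀ hst hs.le hd
  have h2 : 0 < t ^ k * s ^ k := by positivity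
  calc t ^ k * (s ^ k * s ^ d) = (t ^ k * s ^ k) * s ^ d := by ring
    _ < (t ^ k * s ^ k) * t ^ d := mul_lt_mul_of_pos_left h1 h2
    _ = s ^ k * (t ^ k * t ^ d) := by ring

/-- Cross terms vanish at a kernel vector: for Hermitian `P` with `P y = 0`,
`(u + y)* P (u + y) = u* P u`. [folklore] -/
private theorem form_add_of_mulVec_eq_zero {P : Matrix (Fin n) (Fin n) 𝕜} (hP : P.IsHermitian)
    {y : Fin n → 𝕜} (hy : P *ᵥ y = 0) (u : Fin n → 𝕜) :
    star (u + y) ⬝ᵥ (P *ᵥ (u + y)) = star u ⬝ᵥ (P *ᵥ u) := by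
  have h2 : star y ᵥ* P = star (Pᴴ *ᵥ y) := by rw [star_mulVec, conjTranspose_conjTranspose]
  have h1 : star y ⬝ᵥ (P *ᵥ u) = 0 := by
    rw [dotProduct_mulVec, h2, hP.eq, hy, star_zero, zero_dotProduct]
  rw [mulVec_add, hy, add_zero, star_add, add_dotProduct, h1, add_zero]

section OneAlternation

/-! The data of a one-alternation pattern: `σ = ±1`, split index `j`; low block (indices `< j`) of
sign `σ` or null, high block of sign `−σ` or null, a non-null low coefficient.  The Loewner family is
`G(t) = (−σ) t^{−j} P(t)`, with quadratic form
`g_t(x) = ∑ᵢ (tⁱ/tʲ) · (−σ) · re (x* Aᵢ x)`. -/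

variable {A : Fin (m + 1) → Matrix (Fin n) (Fin n) 𝕜} {σ : ℤ} {j : ℕ}

/-- The quadratic form `g_t(x)` is `(−σ/tʲ) · re (x* P(t) x)`. [folklore] -/
private theorem gform_eq (A : Fin (m + 1) → Matrix (Fin n) (Fin n) 𝕜) (σ : ℤ) (j : ℕ) (t : ℝ)
    (x : Fin n → 𝕜) :
    ∑ i : Fin (m + 1), (t ^ (i : ℕ) / t ^ j) * ((-σ : ℝ) * RCLike.re (star x ⬝ᵥ (A i *ᵥ x)))
      = ((-σ : ℝ) / t ^ j) *
        RCLike.re (star x ⬝ᵥ ((∑ i : Fin (m + 1), ((t : ℝ) : 𝕜) ^ (i : ℕ) • A i) *ᵥ x)) := by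
  rw [← sum_pow_mul_re_form, Finset.mul_sum]
  refine Finset.sum_congr rfl fun i _ => ?_
  ring

/-- At a kernel vector of `P(t)` the form `g_t` vanishes. [folklore] -/
private theorem gform_eq_zero_of_mulVec_eq_zero (σ : ℤ) (j : ℕ) {t : ℝ} {x : Fin n → 𝕜}
    (hx : (∑ i : Fin (m + 1), ((t : ℝ) : 𝕜) ^ (i : ℕ) • A i) *ᵥ x = 0) :
    ∑ i : Fin (m + 1), (t ^ (i : ℕ) / t ^ j) * ((-σ : ℝ) * RCLike.re (star x ⬝ᵥ (A i *ᵥ x))) = 0 := by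
  rw [gform_eq, hx, dotProduct_zero, map_zero, mul_zero]

/-- Cross terms: for a kernel vector `y` of the Hermitian `P(t)`, `g_t(u + y) = g_t(u)`. [folklore] -/
private theorem gform_add_of_mulVec_eq_zero (hA : InS A) (σ : ℤ) (j : ℕ) {t : ℝ}
    {y : Fin n → 𝕜} (hy : (∑ i : Fin (m + 1), ((t : ℝ) : 𝕜) ^ (i : ℕ) • A i) *ᵥ y = 0)
    (u : Fin n → 𝕜) :
    ∑ i : Fin (m + 1), (t ^ (i : ℕ) / t ^ j) *
        ((-σ : ℝ) * RCLike.re (star (u + y) ⬝ᵥ (A i *ᵥ (u + y))))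
      = ∑ i : Fin (m + 1), (t ^ (i : ℕ) / t ^ j) * ((-σ : ℝ) * RCLike.re (star u ⬝ᵥ (A i *ᵥ u))) := by
  have hP : (∑ i : Fin (m + 1), ((t : ℝ) : 𝕜) ^ (i : ℕ) • A i).IsHermitian := by
    rw [sum_pow_smul_eq_real]; exact isHermitian_sum_smul (isHermitian_of_inS hA) _
  rw [gform_eq, gform_eq, form_add_of_mulVec_eq_zero hP hy]

/-- **Loewner monotonicity.** `g_s(x) ≤ g_t(x)` for `0 < s ≤ t`. [folklore] -/
private theorem gform_mono (hA : InS A) (hσ : σ = 1 ∨ σ = -1)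
    (hlo : ∀ i : Fin (m + 1), (i : ℕ) < j → coeffSign (A i) = 0 ∨ coeffSign (A i) = σ)
    (hhi : ∀ i : Fin (m + 1), j ≤ (i : ℕ) → coeffSign (A i) = 0 ∨ coeffSign (A i) = -σ)
    {s t : ℝ} (hs : 0 < s) (hst : s ≤ t) (x : Fin n → 𝕜) :
    ∑ i : Fin (m + 1), (s ^ (i : ℕ) / s ^ j) * ((-σ : ℝ) * RCLike.re (star x ⬝ᵥ (A i *ᵥ x)))
      ≤ ∑ i : Fin (m + 1), (t ^ (i : ℕ) / t ^ j) * ((-σ : ℝ) * RCLike.re (star x ⬝ᵥ (A i *ᵥ x))) := by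
  have hσ' : (-σ) = 1 ∨ (-σ) = -1 := by omega
  refine Finset.sum_le_sum fun i _ => ?_
  by_cases hij : (i : ℕ) < j
  · -- low block: weight non-increasing, form `≤ 0`
    have hQ : (-σ : ℝ) * RCLike.re (star x ⬝ᵥ (A i *ᵥ x)) ≤ 0 := by
      have := mul_re_form_nonneg_of_coeffSign hA hσ (hlo i hij) x
      linarith
    exact mul_le_mul_of_nonpos_right (pow_div_pow_le_of_le' hs hst hij.le) hQ
  · have hQ : 0 ≤ (-σ : ℝ) * RCLike.re (star x ⬝ᵥ (A i *ᵥ x)) := by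
      have := mul_re_form_nonneg_of_coeffSign hA hσ' (hhi i (not_lt.1 hij)) x
      push_cast at this
      exact this
    exact mul_le_mul_of_nonneg_right (pow_div_pow_le_of_le hs hst (not_lt.1 hij)) hQ

/-- **Strict Loewner monotonicity.** `g_s(x) < g_t(x)` for `0 < s < t` and `x ≠ 0` (the non-null
low coefficient of sign `σ` contributes a strictly increasing term). [folklore] -/
private theorem gform_strictMono (hA : InS A) (hσ : σ = 1 ∨ σ = -1)
    (hlo : ∀ i : Fin (m + 1), (i : ℕ) < j → coeffSign (A i) = 0 ∨ coeffSign (A i) = σ)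
    (hhi : ∀ i : Fin (m + 1), j ≤ (i : ℕ) → coeffSign (A i) = 0 ∨ coeffSign (A i) = -σ)
    (hwit : ∃ i : Fin (m + 1), (i : ℕ) < j ∧ coeffSign (A i) = σ)
    {s t : ℝ} (hs : 0 < s) (hst : s < t) {x : Fin n → 𝕜} (hx : x ≠ 0) :
    ∑ i : Fin (m + 1), (s ^ (i : ℕ) / s ^ j) * ((-σ : ℝ) * RCLike.re (star x ⬝ᵥ (A i *ᵥ x)))
      < ∑ i : Fin (m + 1), (t ^ (i : ℕ) / t ^ j) * ((-σ : ℝ) * RCLike.re (star x ⬝ᵥ (A i *ᵥ x))) := by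
  have hσ' : (-σ) = 1 ∨ (-σ) = -1 := by omega
  obtain ⟨i₀, hi₀j, hi₀⟩ := hwit
  refine Finset.sum_lt_sum (fun i _ => ?_) ⟨i₀, Finset.mem_univ _, ?_⟩
  · by_cases hij : (i : ℕ) < j
    · have hQ : (-σ : ℝ) * RCLike.re (star x ⬝ᵥ (A i *ᵥ x)) ≤ 0 := by
        have := mul_re_form_nonneg_of_coeffSign hA hσ (hlo i hij) x
        linarith
      exact mul_le_mul_of_nonpos_right (pow_div_pow_le_of_le' hs hst.le hij.le) hQ
    · have hQ : 0 ≤ (-σ : ℝ) * RCLike.re (star x ⬝ᵥ (A i *ᵥ x)) := by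
        have := mul_re_form_nonneg_of_coeffSign hA hσ' (hhi i (not_lt.1 hij)) x
        push_cast at this
        exact this
      exact mul_le_mul_of_nonneg_right (pow_div_pow_le_of_le hs hst.le (not_lt.1 hij)) hQ
  · have hQ : (-σ : ℝ) * RCLike.re (star x ⬝ᵥ (A i₀ *ᵥ x)) < 0 := by
      have := mul_re_form_pos_of_coeffSign_eq hA hσ hi₀ hx
      linarith
    exact mul_lt_mul_of_neg_right (pow_div_pow_lt_of_lt hs hst hi₀j) hQ

/-- `k τ^{k−1} · τ = k τᵏ` for natural `k` (both sides vanish at `k = 0`). [folklore] -/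
private theorem natCast_mul_pow_pred_mul (k : ℕ) (τ : ℝ) :
    (k : ℝ) * τ ^ (k - 1) * τ = (k : ℝ) * τ ^ k := by
  rcases k with _ | k
  · simp
  · rw [Nat.add_sub_cancel, mul_assoc, ← pow_succ]

/-- **Transversality at a kernel vector.** If `P(τ) y = 0`, `y ≠ 0`, `τ > 0`, then the quadratic
form of the derivative `P′(τ) = ∑ k τ^{k−1} A_k` at `y` has the strict sign `−σ`:
`(−σ) · re (y* P′(τ) y) > 0`. [folklore] -/
private theorem transversal (hA : InS A) (hσ : σ = 1 ∨ σ = -1)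
    (hlo : ∀ i : Fin (m + 1), (i : ℕ) < j → coeffSign (A i) = 0 ∨ coeffSign (A i) = σ)
    (hhi : ∀ i : Fin (m + 1), j ≤ (i : ℕ) → coeffSign (A i) = 0 ∨ coeffSign (A i) = -σ)
    (hwit : ∃ i : Fin (m + 1), (i : ℕ) < j ∧ coeffSign (A i) = σ)
    {τ : ℝ} (hτ : 0 < τ) {y : Fin n → 𝕜} (hy0 : y ≠ 0)
    (hy : (∑ i : Fin (m + 1), ((τ : ℝ) : 𝕜) ^ (i : ℕ) • A i) *ᵥ y = 0) :
    0 < (-σ : ℝ) * RCLike.re (star y ⬝ᵥ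
      ((∑ i : Fin (m + 1), ((((i : ℕ) : ℝ) * τ ^ ((i : ℕ) - 1) : ℝ) : 𝕜) • A i) *ᵥ y)) := by
  have hσ' : (-σ) = 1 ∨ (-σ) = -1 := by omega
  rw [re_form_sum_smul]
  -- abbreviation for the forms `Qᵢ = re (y* Aᵢ y)`
  have hker : ∑ i : Fin (m + 1), τ ^ (i : ℕ) * RCLike.re (star y ⬝ᵥ (A i *ᵥ y)) = 0 := by
    rw [sum_pow_mul_re_form, hy, dotProduct_zero, map_zero]
  -- the signed sum `(−σ) ∑ (k − j) τᵏ Q_k` is positive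
  have hterm : ∀ i : Fin (m + 1),
      0 ≤ (((i : ℕ) : ℝ) - j) * τ ^ (i : ℕ) * ((-σ : ℝ) * RCLike.re (star y ⬝ᵥ (A i *ᵥ y))) := by
    intro i
    by_cases hij : (i : ℕ) < j
    · have hQ : (-σ : ℝ) * RCLike.re (star y ⬝ᵥ (A i *ᵥ y)) ≤ 0 := by
        have := mul_re_form_nonneg_of_coeffSign hA hσ (hlo i hij) y
        linarith
      have h1 : (((i : ℕ) : ℝ) - j) * τ ^ (i : ℕ) ≤ 0 :=
        mul_nonpos_of_nonpos_of_nonneg (by have : ((i:ℕ):ℝ) < j := (by exact_mod_cast hij); linarith)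
          (pow_pos hτ _).le
      exact mul_nonneg_of_nonpos_of_nonpos h1 hQ
    · have hQ : 0 ≤ (-σ : ℝ) * RCLike.re (star y ⬝ᵥ (A i *ᵥ y)) := by
        have := mul_re_form_nonneg_of_coeffSign hA hσ' (hhi i (not_lt.1 hij)) y
        push_cast at this
        exact this
      have h1 : 0 ≤ (((i : ℕ) : ℝ) - j) * τ ^ (i : ℕ) :=
        mul_nonneg (by have : (j:ℝ) ≤ ((i:ℕ):ℝ) := (by exact_mod_cast (not_lt.1 hij)); linarith)
          (pow_pos hτ _).le
      exact mul_nonneg h1 hQ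
  obtain ⟨i₀, hi₀j, hi₀⟩ := hwit
  have hwit' : 0 < (((i₀ : ℕ) : ℝ) - j) * τ ^ (i₀ : ℕ) *
      ((-σ : ℝ) * RCLike.re (star y ⬝ᵥ (A i₀ *ᵥ y))) := by
    have hQ : (-σ : ℝ) * RCLike.re (star y ⬝ᵥ (A i₀ *ᵥ y)) < 0 := by
      have := mul_re_form_pos_of_coeffSign_eq hA hσ hi₀ hy0
      linarith
    have h1 : (((i₀ : ℕ) : ℝ) - j) * τ ^ (i₀ : ℕ) < 0 :=
      mul_neg_of_neg_of_pos (by have : ((i₀:ℕ):ℝ) < j := (by exact_mod_cast hi₀j); linarith)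
        (pow_pos hτ _)
    exact mul_pos_of_neg_of_neg h1 hQ
  have hpos : 0 < ∑ i : Fin (m + 1), (((i : ℕ) : ℝ) - j) * τ ^ (i : ℕ) *
      ((-σ : ℝ) * RCLike.re (star y ⬝ᵥ (A i *ᵥ y))) :=
    Finset.sum_pos' (fun i _ => hterm i) ⟨i₀, Finset.mem_univ _, hwit'⟩
  -- rewrite: `∑ (k − j) τᵏ (−σ Q_k) = (−σ) τ · ∑ k τ^{k−1} Q_k − (−σ) j · ∑ τᵏ Q_k`
  have hid : ∑ i : Fin (m + 1), (((i : ℕ) : ℝ) - j) * τ ^ (i : ℕ) *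
      ((-σ : ℝ) * RCLike.re (star y ⬝ᵥ (A i *ᵥ y)))
      = (-σ : ℝ) * τ * ∑ i : Fin (m + 1), (((i : ℕ) : ℝ) * τ ^ ((i : ℕ) - 1)) *
          RCLike.re (star y ⬝ᵥ (A i *ᵥ y))
        - (-σ : ℝ) * j * ∑ i : Fin (m + 1), τ ^ (i : ℕ) * RCLike.re (star y ⬝ᵥ (A i *ᵥ y)) := by
    rw [Finset.mul_sum, Finset.mul_sum, ← Finset.sum_sub_distrib]
    refine Finset.sum_congr rfl fun i _ => ?_
    have := natCast_mul_pow_pred_mul (i : ℕ) τ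
    calc (((i : ℕ) : ℝ) - j) * τ ^ (i : ℕ) * ((-σ : ℝ) * RCLike.re (star y ⬝ᵥ (A i *ᵥ y)))
        = (-σ : ℝ) * (((i : ℕ) : ℝ) * τ ^ (i : ℕ)) * RCLike.re (star y ⬝ᵥ (A i *ᵥ y))
          - (-σ : ℝ) * j * (τ ^ (i : ℕ) * RCLike.re (star y ⬝ᵥ (A i *ᵥ y))) := by ring
      _ = _ := by rw [← this]; ring
  rw [hid, hker, mul_zero, sub_zero] at hpos
  have h2 : 0 < (-σ : ℝ) * ∑ i : Fin (m + 1), (((i : ℕ) : ℝ) * τ ^ ((i : ℕ) - 1)) *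
      RCLike.re (star y ⬝ᵥ (A i *ᵥ y)) := by
    have h3 : (-σ : ℝ) * τ * ∑ i : Fin (m + 1), (((i : ℕ) : ℝ) * τ ^ ((i : ℕ) - 1)) *
        RCLike.re (star y ⬝ᵥ (A i *ᵥ y))
        = τ * ((-σ : ℝ) * ∑ i : Fin (m + 1), (((i : ℕ) : ℝ) * τ ^ ((i : ℕ) - 1)) *
          RCLike.re (star y ⬝ᵥ (A i *ᵥ y))) := by ring
    rw [h3] at hpos
    exact pos_of_mul_pos_right hpos hτ.le
  exact h2

/-- **The inertia chain on kernel subspaces** (the tree's Summit-side `stub_inertiaChain` /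
`oneAlternation` argument, here for subspaces and with multiplicity in view): for a finite set `S` of
positive times, the kernels `ker P(τ)`, `τ ∈ S`, are independent — the dimension of their sum is the
sum of their dimensions — and `g_s` is positive definite on that sum for every `s` beyond `S`.
Induction on `S` by adjoining its maximum: cross terms vanish at the new kernel time, strict
monotonicity transports positivity to later times. [folklore] -/
private theorem kernel_chain (hA : InS A) (hσ : σ = 1 ∨ σ = -1)
    (hlo : ∀ i : Fin (m + 1), (i : ℕ) < j → coeffSign (A i) = 0 ∨ coeffSign (A i) = σ)
    (hhi : ∀ i : Fin (m + 1), j ≤ (i : ℕ) → coeffSign (A i) = 0 ∨ coeffSign (A i) = -σ)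
    (hwit : ∃ i : Fin (m + 1), (i : ℕ) < j ∧ coeffSign (A i) = σ)
    (V : ℝ → Submodule 𝕜 (Fin n → 𝕜))
    (hV : ∀ τ, V τ = LinearMap.ker (Matrix.toLin' (∑ i : Fin (m + 1), ((τ : ℝ) : 𝕜) ^ (i : ℕ) • A i)))
    (g : ℝ → (Fin n → 𝕜) → ℝ)
    (hg : ∀ s u, g s u = ∑ i : Fin (m + 1), (s ^ (i : ℕ) / s ^ j) *
      ((-σ : ℝ) * RCLike.re (star u ⬝ᵥ (A i *ᵥ u))))
    (S : Finset ℝ) (hS : ∀ τ ∈ S, 0 < τ) :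
    Module.finrank 𝕜 ↥(⨆ τ ∈ S, V τ) = ∑ τ ∈ S, Module.finrank 𝕜 ↥(V τ) ∧
      ∀ u ∈ (⨆ τ ∈ S, V τ), u ≠ 0 → ∀ s : ℝ, 0 < s → (∀ τ ∈ S, τ < s) → 0 < g s u := by
  have hmemV : ∀ τ u, u ∈ V τ ↔ (∑ i : Fin (m + 1), ((τ : ℝ) : 𝕜) ^ (i : ℕ) • A i) *ᵥ u = 0 := by
    intro τ u; rw [hV, LinearMap.mem_ker, Matrix.toLin'_apply]
  induction S using Finset.induction_on_max with
  | empty =>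
    refine ⟨by simp, fun u hu hu0 => ?_⟩
    simp only [Finset.notMem_empty, not_false_eq_true, iSup_neg, iSup_bot, Submodule.mem_bot] at hu
    exact absurd hu hu0
  | insert a S haS ih =>
    have hSpos : ∀ τ ∈ S, 0 < τ := fun τ hτ => hS τ (Finset.mem_insert_of_mem hτ)
    have ha : 0 < a := hS a (Finset.mem_insert_self a S)
    have haS' : a ∉ S := fun h => lt_irrefl a (haS a h)
    obtain ⟨ihrank, ihpos⟩ := ih hSpos
    rw [Finset.iSup_insert]
    -- (i) the new kernel meets the old sum trivially
    have hinf : V a ⊓ (⨆ τ ∈ S, V τ) = ⊥ := by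
      rw [Submodule.eq_bot_iff]
      intro y hy
      obtain ⟨hya, hyW⟩ := Submodule.mem_inf.1 hy
      by_contra hy0
      have h1 := ihpos y hyW hy0 a ha haS
      have h2 : g a y = 0 := by
        rw [hg]; exact gform_eq_zero_of_mulVec_eq_zero σ j ((hmemV a y).1 hya)
      linarith
    refine ⟨?_, ?_⟩
    · -- (ii) dimensions add up
      have h := Submodule.finrank_sup_add_finrank_inf_eq (V a) (⨆ τ ∈ S, V τ)
      rw [hinf, finrank_bot, add_zero] at h
      rw [h, ihrank, Finset.sum_insert haS']
    · -- (iii) positivity beyond the new maximum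
      intro u hu hu0 s hs hlt
      have has : a < s := hlt a (Finset.mem_insert_self a S)
      have hltS : ∀ τ ∈ S, τ < s := fun τ hτ => hlt τ (Finset.mem_insert_of_mem hτ)
      obtain ⟨y, hy, w, hw, hyw⟩ := Submodule.mem_sup.1 hu
      have hya : (∑ i : Fin (m + 1), ((a : ℝ) : 𝕜) ^ (i : ℕ) • A i) *ᵥ y = 0 := (hmemV a y).1 hy
      by_cases hw0 : w = 0
      · subst hw0
        rw [add_zero] at hyw
        subst hyw
        have h1 : g a y = 0 := by rw [hg]; exact gform_eq_zero_of_mulVec_eq_zero σ j hya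
        have h2 : g a y < g s y := by
          rw [hg, hg]; exact gform_strictMono hA hσ hlo hhi hwit ha has hu0
        linarith
      · have h1 : 0 < g a w := ihpos w hw hw0 a ha haS
        have h2 : g a u = g a w := by
          rw [← hyw, add_comm, hg, hg]
          exact gform_add_of_mulVec_eq_zero hA σ j hya w
        have h3 : g a u ≤ g s u := by
          rw [hg, hg]; exact gform_mono hA hσ hlo hhi ha has.le u
        linarith

/-- Consequently the kernel dimensions at finitely many positive times add up to at most `n`. [folklore] -/
private theorem sum_finrank_ker_le (hA : InS A) (hσ : σ = 1 ∨ σ = -1)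
    (hlo : ∀ i : Fin (m + 1), (i : ℕ) < j → coeffSign (A i) = 0 ∨ coeffSign (A i) = σ)
    (hhi : ∀ i : Fin (m + 1), j ≤ (i : ℕ) → coeffSign (A i) = 0 ∨ coeffSign (A i) = -σ)
    (hwit : ∃ i : Fin (m + 1), (i : ℕ) < j ∧ coeffSign (A i) = σ)
    (S : Finset ℝ) (hS : ∀ τ ∈ S, 0 < τ) :
    ∑ τ ∈ S, Module.finrank 𝕜
        ↥(LinearMap.ker (Matrix.toLin' (∑ i : Fin (m + 1), ((τ : ℝ) : 𝕜) ^ (i : ℕ) • A i))) ≤ n := by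
  obtain ⟨h, -⟩ := kernel_chain hA hσ hlo hhi hwit
    (fun τ => LinearMap.ker (Matrix.toLin' (∑ i : Fin (m + 1), ((τ : ℝ) : 𝕜) ^ (i : ℕ) • A i)))
    (fun _ => rfl) _ (fun _ _ => rfl) S hS
  rw [← h]
  calc _ ≤ Module.finrank 𝕜 (Fin n → 𝕜) := Submodule.finrank_le _
    _ = n := Module.finrank_fin_fun 𝕜

/-- Quadratic form of a principal block at a vector extended by zero. [folklore] -/
private theorem dotProduct_toSquareBlockProp_mulVec (N : Matrix (Fin n) (Fin n) 𝕜) (p : Fin n → Prop)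
    [DecidablePred p] (z : {i // p i} → 𝕜) :
    star z ⬝ᵥ (N.toSquareBlockProp p *ᵥ z)
      = star (fun d : Fin n => if h : p d then z ⟨d, h⟩ else 0) ⬝ᵥ
          (N *ᵥ fun d : Fin n => if h : p d then z ⟨d, h⟩ else 0) := by
  simp only [dotProduct, mulVec, toSquareBlockProp_def, of_apply, Pi.star_apply]
  rw [← Fintype.sum_subtype_add_sum_subtype p (fun i : Fin n =>
    star (if h : p i then z ⟨i, h⟩ else 0) * ∑ d, N i d * (if h : p d then z ⟨d, h⟩ else 0))]
  have hzero : ∑ i : {i // ¬p i}, star (if h : p (i : Fin n) then z ⟨i, h⟩ else 0) *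
      ∑ d, N i d * (if h : p d then z ⟨d, h⟩ else 0) = 0 := by
    refine Finset.sum_eq_zero fun i _ => ?_
    rw [dif_neg i.2, star_zero, zero_mul]
  rw [hzero, add_zero]
  refine Finset.sum_congr rfl fun i _ => ?_
  rw [dif_pos i.2]
  congr 1
  rw [← Fintype.sum_subtype_add_sum_subtype p (fun d : Fin n => N i d * (if h : p d then z ⟨d, h⟩ else 0))]
  have hzero' : ∑ d : {d // ¬p d}, N i d * (if h : p (d : Fin n) then z ⟨d, h⟩ else 0) = 0 := by
    refine Finset.sum_eq_zero fun d _ => ?_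
    rw [dif_neg d.2, mul_zero]
  rw [hzero', add_zero]
  refine Finset.sum_congr rfl fun d _ => ?_
  rw [dif_pos d.2]

/-- Entrywise derivative of the matrix polynomial, evaluated: `P′(c) = ∑ k c^{k−1} A_k`. [folklore] -/
private theorem eval_derivative_matPoly_apply (A : Fin (m + 1) → Matrix (Fin n) (Fin n) 𝕜) (c : 𝕜)
    (a b : Fin n) :
    (derivative (matPoly A a b)).eval c
      = (∑ k : Fin (m + 1), (((k : ℕ) : 𝕜) * c ^ ((k : ℕ) - 1)) • A k) a b := by
  rw [matPoly_apply, derivative_sum, eval_finsetSum]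
  simp only [Matrix.sum_apply, Matrix.smul_apply, smul_eq_mul, derivative_mul, derivative_X_pow,
    derivative_C, mul_zero, add_zero, eval_mul, eval_C, eval_pow, eval_X]

/-- Conjugating by constant matrices commutes with the entrywise derivative. [folklore] -/
private theorem map_derivative_conj (Xc Yc : Matrix (Fin n) (Fin n) 𝕜) (M : Matrix (Fin n) (Fin n) 𝕜[X]) :
    (Xc.map C * M * Yc.map C).map derivative = Xc.map C * M.map derivative * Yc.map C := by
  refine Matrix.ext fun i d => ?_
  simp only [Matrix.map_apply, Matrix.mul_apply, derivative_sum, derivative_mul, derivative_C,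
    zero_mul, zero_add, mul_zero, add_zero, Finset.sum_mul]

/-- Constant matrices are unchanged by `map C` followed by evaluation. [folklore] -/
private theorem map_C_map_eval (Xc : Matrix (Fin n) (Fin n) 𝕜) (c : 𝕜) :
    (Xc.map C).map (fun p => p.eval c) = Xc := by
  rw [Matrix.map_map]
  refine Matrix.ext fun i d => ?_
  simp

/-- **Root multiplicity equals kernel dimension at a transversal root** (here: `≤`, which is what
Lemma 6 needs).  With `U` a unitary diagonalising the Hermitian `P(τ)`, the rows of
`Q = U* P(X) U` indexed by the zero eigenvalues vanish at `τ`; dividing them by `X − τ` leaves a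
matrix whose value at `τ` is block triangular with blocks `U₀* P′(τ) U₀` (non-singular by
transversality) and the non-zero eigenvalues. [folklore] -/
private theorem rootMultiplicity_le_finrank_ker (hA : InS A) (hσ : σ = 1 ∨ σ = -1)
    (hlo : ∀ i : Fin (m + 1), (i : ℕ) < j → coeffSign (A i) = 0 ∨ coeffSign (A i) = σ)
    (hhi : ∀ i : Fin (m + 1), j ≤ (i : ℕ) → coeffSign (A i) = 0 ∨ coeffSign (A i) = -σ)
    (hwit : ∃ i : Fin (m + 1), (i : ℕ) < j ∧ coeffSign (A i) = σ)
    {τ : ℝ} (hτ : 0 < τ) :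
    (matPoly A).det.rootMultiplicity ((τ : ℝ) : 𝕜) ≤ Module.finrank 𝕜
      ↥(LinearMap.ker (Matrix.toLin' (∑ i : Fin (m + 1), ((τ : ℝ) : 𝕜) ^ (i : ℕ) • A i))) := by
  classical
  set c : 𝕜 := ((τ : ℝ) : 𝕜) with hc
  set P : Matrix (Fin n) (Fin n) 𝕜 := ∑ i : Fin (m + 1), c ^ (i : ℕ) • A i with hPdef
  have hP : P.IsHermitian := by
    rw [hPdef, hc, sum_pow_smul_eq_real]; exact isHermitian_sum_smul (isHermitian_of_inS hA) _
  set U : Matrix (Fin n) (Fin n) 𝕜 := (hP.eigenvectorUnitary : Matrix (Fin n) (Fin n) 𝕜) with hU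
  set ev : Fin n → ℝ := hP.eigenvalues with hev
  have hUU : star U * U = 1 := Unitary.coe_star_mul_self _
  have hUU' : U * star U = 1 := by
    have := Unitary.coe_mul_star_self hP.eigenvectorUnitary
    rwa [Unitary.coe_star] at this
  have hdiag : star U * P * U = diagonal (RCLike.ofReal ∘ ev) := by
    have := hP.conjStarAlgAut_star_eigenvectorUnitary
    rwa [Unitary.conjStarAlgAut_star_apply] at this
  have hPU : P * U = U * diagonal (RCLike.ofReal ∘ ev) := by
    rw [← hdiag, ← Matrix.mul_assoc, ← Matrix.mul_assoc, hUU', Matrix.one_mul]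
  -- the conjugated matrix polynomial and its determinant
  set Q : Matrix (Fin n) (Fin n) 𝕜[X] := (star U).map C * matPoly A * U.map C with hQ
  have hdetQ : Q.det = (matPoly A).det := by
    have h1 : ((star U).map C).det = C (star U).det := by
      rw [← RingHom.mapMatrix_apply, ← RingHom.map_det]
    have h2 : (U.map C).det = C U.det := by
      rw [← RingHom.mapMatrix_apply, ← RingHom.map_det]
    have h3 : (star U).det * U.det = 1 := by rw [← det_mul, hUU, det_one]
    rw [hQ, det_mul, det_mul, h1, h2, mul_comm (C (star U).det), mul_assoc, ← C_mul, h3, C_1,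
      mul_one]
  have hQeval : Q.map (fun p => p.eval c) = star U * P * U := by
    have h := Matrix.map_mul (L := (star U).map C * matPoly A) (M := U.map C) (f := evalRingHom c)
    have h' := Matrix.map_mul (L := (star U).map C) (M := matPoly A) (f := evalRingHom c)
    rw [Polynomial.coe_evalRingHom] at h h'
    change Q.map (eval c) = _
    rw [hQ, h, h', map_C_map_eval, map_C_map_eval]
    change star U * (matPoly A).map (fun p => p.eval c) * U = _
    rw [matPoly_map_eval]
  -- the rows of the zero eigenvalues vanish at `τ`
  have hroot : ∀ i d, ev i = 0 → (Q i d).IsRoot c := by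
    intro i d hi
    have h := congrFun (congrFun hQeval i) d
    rw [Matrix.map_apply, hdiag, diagonal_apply] at h
    rw [IsRoot, h]
    split_ifs with hid
    · simp [hi]
    · rfl
  -- divide those rows by `X − τ`
  set R : Matrix (Fin n) (Fin n) 𝕜[X] :=
    Matrix.of fun i d => if ev i = 0 then Q i d /ₘ (X - C c) else Q i d with hR
  have hQR : Q = diagonal (fun i => if ev i = 0 then X - C c else 1) * R := by
    refine Matrix.ext fun i d => ?_
    rw [diagonal_mul, hR, of_apply]
    split_ifs with hi
    · exact (mul_divByMonic_eq_iff_isRoot.2 (hroot i d hi)).symm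
    · rw [one_mul]
  have hcard : (Finset.univ.filter fun i : Fin n => ev i = 0).card = Fintype.card {i // ev i = 0} := by
    rw [Fintype.card_subtype]
  have hdetQR : Q.det = (X - C c) ^ Fintype.card {i // ev i = 0} * R.det := by
    rw [hQR, det_mul, det_diagonal, Finset.prod_ite, Finset.prod_const, Finset.prod_const_one, mul_one,
      hcard]
  -- the value of `R` at `τ`
  set Rc : Matrix (Fin n) (Fin n) 𝕜 := R.map (fun p => p.eval c) with hRc
  have hRc_ne : ∀ i d, ev i ≠ 0 → Rc i d = if i = d then ((ev i : ℝ) : 𝕜) else 0 := by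
    intro i d hi
    have h := congrFun (congrFun hQeval i) d
    rw [Matrix.map_apply, hdiag, diagonal_apply] at h
    rw [hRc, Matrix.map_apply, hR, of_apply, if_neg hi, h]
    split_ifs <;> rfl
  have hRc_eq : ∀ i d, ev i = 0 → Rc i d = (derivative (Q i d)).eval c := by
    intro i d hi
    rw [hRc, Matrix.map_apply, hR, of_apply, if_pos hi]
    exact eval_divByMonic_X_sub_C_eq_derivative (hroot i d hi)
  -- block triangularity
  have htri : ∀ i, ¬ ev i = 0 → ∀ d, ev d = 0 → Rc i d = 0 := by
    intro i hi d hd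
    rw [hRc_ne i d hi, if_neg]
    rintro rfl; exact hi hd
  have hdetRc : Rc.det = (Rc.toSquareBlockProp (fun i => ev i = 0)).det *
      (Rc.toSquareBlockProp fun i => ¬ ev i = 0).det := twoBlockTriangular_det Rc _ htri
  -- the block of non-zero eigenvalues is a non-singular diagonal matrix
  have hblock₂ : (Rc.toSquareBlockProp fun i => ¬ ev i = 0)
      = diagonal (fun i : {i // ¬ ev i = 0} => ((ev i : ℝ) : 𝕜)) := by
    refine Matrix.ext fun i d => ?_
    rw [toSquareBlockProp_def, of_apply, hRc_ne i d i.2, diagonal_apply]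
    simp only [Subtype.ext_iff]
  have hdet₂ : (Rc.toSquareBlockProp fun i => ¬ ev i = 0).det ≠ 0 := by
    rw [hblock₂, det_diagonal]
    exact Finset.prod_ne_zero_iff.2 fun i _ => by exact_mod_cast i.2
  -- the block of zero eigenvalues is `U₀* P′(τ) U₀`, non-singular by transversality
  set D : Matrix (Fin n) (Fin n) 𝕜 := ∑ k : Fin (m + 1), (((k : ℕ) : 𝕜) * c ^ ((k : ℕ) - 1)) • A k with hD
  have hMd : ((matPoly A).map derivative).map (fun p => p.eval c) = D :=
    Matrix.ext fun a b => by
      rw [Matrix.map_apply, Matrix.map_apply]; exact eval_derivative_matPoly_apply A c a b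
  have hQd : (Q.map derivative).map (fun p => p.eval c) = star U * D * U := by
    have h := Matrix.map_mul (L := (star U).map C * (matPoly A).map derivative) (M := U.map C)
      (f := evalRingHom c)
    have h' := Matrix.map_mul (L := (star U).map C) (M := (matPoly A).map derivative) (f := evalRingHom c)
    rw [Polynomial.coe_evalRingHom] at h h'
    rw [hQ, map_derivative_conj]
    change (((star U).map C * (matPoly A).map derivative) * U.map C).map (eval c) = _
    rw [h, h']
    change ((star U).map C).map (fun p => p.eval c) * ((matPoly A).map derivative).map (fun p => p.eval c)
      * (U.map C).map (fun p => p.eval c) = _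
    rw [map_C_map_eval, map_C_map_eval, hMd]
  have hRcD : ∀ i d, ev i = 0 → Rc i d = (star U * D * U) i d := by
    intro i d hi
    rw [hRc_eq i d hi, ← hQd, Matrix.map_apply, Matrix.map_apply]
  have hdet₁ : (Rc.toSquareBlockProp fun i => ev i = 0).det ≠ 0 := by
    intro h0
    obtain ⟨z, hz0, hBz⟩ := Matrix.exists_mulVec_eq_zero_iff.2 h0
    set zh : Fin n → 𝕜 := fun d => if h : ev d = 0 then z ⟨d, h⟩ else 0 with hzh
    set y : Fin n → 𝕜 := U *ᵥ zh with hy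
    have hzh0 : zh ≠ 0 := by
      intro h
      apply hz0
      funext i
      have := congrFun h i.1
      simp only [hzh, dif_pos i.2, Pi.zero_apply] at this
      exact this
    have hy0 : y ≠ 0 := by
      intro h
      apply hzh0
      have : star U *ᵥ y = zh := by rw [hy, mulVec_mulVec, hUU, one_mulVec]
      rw [← this, h, mulVec_zero]
    have hyker : P *ᵥ y = 0 := by
      rw [hy, mulVec_mulVec, hPU, ← mulVec_mulVec]
      have : diagonal (RCLike.ofReal ∘ ev) *ᵥ zh = 0 := by
        funext i
        rw [mulVec_diagonal, Pi.zero_apply]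
        by_cases hi : ev i = 0
        · simp [hi]
        · simp [hzh, hi]
      rw [this, mulVec_zero]
    -- the quadratic form of the block at `z` is the form of `D` at `y`
    have hB : Rc.toSquareBlockProp (fun i => ev i = 0) = (star U * D * U).toSquareBlockProp fun i => ev i = 0 := by
      refine Matrix.ext fun i d => ?_
      rw [toSquareBlockProp_def, toSquareBlockProp_def, of_apply, of_apply]
      exact hRcD i d i.2
    have hform : star z ⬝ᵥ ((Rc.toSquareBlockProp fun i => ev i = 0) *ᵥ z) = star y ⬝ᵥ (D *ᵥ y) := by
      rw [hB, dotProduct_toSquareBlockProp_mulVec, ← hzh, ← mulVec_mulVec, ← mulVec_mulVec,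
        dotProduct_mulVec (star zh) (star U), ← hy]
      congr 1
      rw [hy, star_mulVec, star_eq_conjTranspose]
    rw [hBz, dotProduct_zero] at hform
    have hT := transversal hA hσ hlo hhi hwit hτ hy0 (by rw [hPdef, hc] at hyker; exact hyker)
    have hDeq : (∑ i : Fin (m + 1), ((((i : ℕ) : ℝ) * τ ^ ((i : ℕ) - 1) : ℝ) : 𝕜) • A i) = D := by
      rw [hD]
      refine Finset.sum_congr rfl fun i _ => ?_
      push_cast
      rw [hc]
    rw [hDeq, ← hform, map_zero, mul_zero] at hT
    exact lt_irrefl _ hT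
  -- conclusion
  have hRc : (R.det).eval c ≠ 0 := by
    have h := RingHom.map_det (evalRingHom c) R
    rw [Polynomial.coe_evalRingHom] at h
    rw [h]
    change (R.map (fun p => p.eval c)).det ≠ 0
    rw [← hRc, hdetRc]
    exact mul_ne_zero hdet₁ hdet₂
  have hRdet : R.det ≠ 0 := fun h => hRc (by rw [h, eval_zero])
  have hmult : (matPoly A).det.rootMultiplicity c = Fintype.card {i // ev i = 0} := by
    rw [← hdetQ, hdetQR, rootMultiplicity_mul (mul_ne_zero (pow_ne_zero _ (X_sub_C_ne_zero c)) hRdet),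
      rootMultiplicity_X_sub_C_pow, rootMultiplicity_eq_zero hRc, add_zero]
  -- `card {ev = 0} = n − rank = dim ker`
  have hrank : P.rank = Fintype.card {i // ev i ≠ 0} := hP.rank_eq_card_non_zero_eigs
  have hrn : Module.finrank 𝕜 ↥(LinearMap.range (Matrix.toLin' P)) +
      Module.finrank 𝕜 ↥(LinearMap.ker (Matrix.toLin' P)) = n := by
    rw [LinearMap.finrank_range_add_finrank_ker, Module.finrank_fin_fun]
  have hrank' : Module.finrank 𝕜 ↥(LinearMap.range (Matrix.toLin' P)) = P.rank := rfl
  have hcompl : Fintype.card {i // ev i ≠ 0} = n - Fintype.card {i // ev i = 0} := by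
    rw [Fintype.card_subtype_compl, Fintype.card_fin]
  have hle : Fintype.card {i // ev i = 0} ≤ n := by
    calc Fintype.card {i // ev i = 0} ≤ Fintype.card (Fin n) := Fintype.card_subtype_le _
      _ = n := Fintype.card_fin n
  rw [hmult]
  omega

/-- **Lemma 6, case `α(P) = 1`: `z⁺(P) ≤ n`, counted with multiplicity.** [folklore] -/
private theorem zplus_le_of_pivot (hA : InS A) (hσ : σ = 1 ∨ σ = -1)
    (hlo : ∀ i : Fin (m + 1), (i : ℕ) < j → coeffSign (A i) = 0 ∨ coeffSign (A i) = σ)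
    (hhi : ∀ i : Fin (m + 1), j ≤ (i : ℕ) → coeffSign (A i) = 0 ∨ coeffSign (A i) = -σ)
    (hwit : ∃ i : Fin (m + 1), (i : ℕ) < j ∧ coeffSign (A i) = σ) : zplus A ≤ n := by
  classical
  obtain ⟨q, hq⟩ := exists_map_eq_det_matPoly (isHermitian_of_inS hA)
  rw [zplus_eq_countP hq]
  set Rts : Finset ℝ := q.roots.toFinset.filter (fun t => 0 < t) with hRts
  -- `countP` as a sum of multiplicities over the distinct positive roots
  have hcount : q.roots.countP (fun t => 0 < t) = ∑ t ∈ Rts, q.rootMultiplicity t := by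
    rw [Multiset.countP_eq_card_filter, ← Multiset.toFinset_sum_count_eq, Multiset.toFinset_filter]
    refine Finset.sum_congr rfl fun t ht => ?_
    rw [Multiset.count_filter, if_pos (Finset.mem_filter.1 ht).2, count_roots]
  -- each multiplicity is at most the kernel dimension
  have hle : ∀ t ∈ Rts, q.rootMultiplicity t ≤ Module.finrank 𝕜
      ↥(LinearMap.ker (Matrix.toLin' (∑ i : Fin (m + 1), ((t : ℝ) : 𝕜) ^ (i : ℕ) • A i))) := by
    intro t ht
    have ht0 : 0 < t := (Finset.mem_filter.1 ht).2
    rw [eq_rootMultiplicity_map (algebraMap ℝ 𝕜).injective t, hq, RCLike.algebraMap_eq_ofReal]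
    exact rootMultiplicity_le_finrank_ker hA hσ hlo hhi hwit ht0
  rw [hcount]
  exact (Finset.sum_le_sum hle).trans
    (sum_finrank_ker_le hA hσ hlo hhi hwit Rts fun t ht => (Finset.mem_filter.1 ht).2)

end OneAlternation

/-- **Lemma 6, case `α(P) = 1`.** [folklore] -/
private theorem zplus_le_of_alpha_eq_one {A : Fin (m + 1) → Matrix (Fin n) (Fin n) 𝕜} (hA : InS A)
    (hα : alpha A = 1) : zplus A ≤ n := by
  obtain ⟨σ, j, hσ, hlo, hhi, hwit, -⟩ := exists_pivot_of_alpha_eq_one hα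
  exact zplus_le_of_pivot hA hσ hlo hhi hwit

/-- `α(P) ≤ m`: a sequence of `m + 1` signs alternates at most `m` times. [folklore] -/
private theorem alpha_le (A : Fin (m + 1) → Matrix (Fin n) (Fin n) 𝕜) : alpha A ≤ m := by
  rw [alpha_eq, alternations_eq]
  refine (List.countP_le_length).trans ?_
  rw [List.length_zip, List.length_tail]
  have h := List.length_filter_le (fun s : ℤ => decide (s ≠ 0)) (List.ofFn fun i => coeffSign (A i))
  rw [List.length_ofFn] at h
  omega


end Rules

namespace Rules

variable {𝕜 : Type*} [RCLike 𝕜] {n m : ℕ}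

/-! ### §6. The reflected polynomial `P(−λ)`: coefficient sequence `i ↦ (−1)ⁱ Aᵢ` -/

/-- `P(−λ)` stays in the class `S`. [folklore] -/
private theorem inS_reflect {A : Fin (m + 1) → Matrix (Fin n) (Fin n) 𝕜} (hA : InS A) :
    InS (fun i => ((-1 : 𝕜) ^ (i : ℕ)) • A i) := by
  intro i
  rcases Nat.even_or_odd (i : ℕ) with h | h
  · simp only [h.neg_one_pow, one_smul]; exact hA i
  · simp only [h.neg_one_pow, neg_smul, one_smul, neg_neg]
    rcases hA i with h1 | h1 | h1
    · exact Or.inr (Or.inl h1)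
    · exact Or.inl h1
    · exact Or.inr (Or.inr (by rw [h1, neg_zero]))

/-- The matrix polynomial of the reflected sequence is `P(−X)`, entrywise. [folklore] -/
private theorem matPoly_reflect (A : Fin (m + 1) → Matrix (Fin n) (Fin n) 𝕜) :
    matPoly (fun i => ((-1 : 𝕜) ^ (i : ℕ)) • A i) = (matPoly A).map (fun p => p.comp (-X)) := by
  refine Matrix.ext fun a b => ?_
  rw [Matrix.map_apply, matPoly_apply, matPoly_apply]
  have h := Polynomial.sum_comp (s := Finset.univ)
    (fun i : Fin (m + 1) => (X : 𝕜[X]) ^ (i : ℕ) * C (A i a b)) (-X)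
  -- `∑ (X^i * C a_i).comp (−X) = (∑ …).comp (−X)`
  rw [show (∑ i : Fin (m + 1), (X : 𝕜[X]) ^ (i : ℕ) * C (A i a b)).comp (-X)
      = ∑ i : Fin (m + 1), ((X : 𝕜[X]) ^ (i : ℕ) * C (A i a b)).comp (-X) from by
    rw [← Polynomial.coe_compRingHom_apply, map_sum]; rfl]
  refine Finset.sum_congr rfl fun i _ => ?_
  rw [mul_comp, pow_comp, X_comp, C_comp, Matrix.smul_apply, smul_eq_mul, C_mul, C_pow, C_neg, C_1,
    neg_pow (X : 𝕜[X])]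
  ring

/-- Hence `det P(−X) = (det P) ∘ (−X)`. [folklore] -/
private theorem det_matPoly_reflect (A : Fin (m + 1) → Matrix (Fin n) (Fin n) 𝕜) :
    (matPoly (fun i => ((-1 : 𝕜) ^ (i : ℕ)) • A i)).det = (matPoly A).det.comp (-X) := by
  rw [matPoly_reflect, ← Polynomial.coe_compRingHom_apply, RingHom.map_det]
  rfl

/-- `P(−λ)` is regular iff `P` is. [folklore] -/
private theorem det_matPoly_reflect_ne_zero {A : Fin (m + 1) → Matrix (Fin n) (Fin n) 𝕜}
    (hdet : (matPoly A).det ≠ 0) : (matPoly (fun i => ((-1 : 𝕜) ^ (i : ℕ)) • A i)).det ≠ 0 := by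
  rw [det_matPoly_reflect]
  intro h
  rw [Polynomial.comp_eq_zero_iff] at h
  rcases h with h | ⟨-, h⟩
  · exact hdet h
  · have := congrArg (fun p => p.coeff 1) h
    simp at this

/-- Root multiplicities of `p ∘ (−X)`: the multiplicity of `μ` is that of `−μ` in `p`. [folklore] -/
private theorem rootMultiplicity_comp_neg_X (p : 𝕜[X]) (μ : 𝕜) :
    (p.comp (-X)).rootMultiplicity μ = p.rootMultiplicity (-μ) := by
  by_cases hp : p = 0
  · simp [hp]
  have hq : p.comp (-X) ≠ 0 := by
    intro h
    rw [Polynomial.comp_eq_zero_iff] at h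
    rcases h with h | ⟨-, h⟩
    · exact hp h
    · have := congrArg (fun p => p.coeff 1) h
      simp at this
  -- key: `(X − C a)^k ∣ q` transfers along `∘ (−X)` with `a ↦ −a`
  have key : ∀ (q : 𝕜[X]) (a : 𝕜) (k : ℕ), (X - C a) ^ k ∣ q → (X - C (-a)) ^ k ∣ q.comp (-X) := by
    intro q a k ⟨g, hg⟩
    refine ⟨(-1) ^ k * g.comp (-X), ?_⟩
    rw [hg, mul_comp, pow_comp, sub_comp, X_comp, C_comp]
    have : (-X - C a : 𝕜[X]) = -1 * (X - C (-a)) := by rw [C_neg]; ring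
    rw [this, mul_pow]; ring
  apply le_antisymm
  · -- `≤`: from `(X − C μ)^r ∣ p ∘ (−X)` get `(X − C(−μ))^r ∣ p`
    rw [Polynomial.le_rootMultiplicity_iff hp]
    have h := key (p.comp (-X)) μ _ ((Polynomial.le_rootMultiplicity_iff hq).1 le_rfl)
    rwa [Polynomial.comp_assoc, neg_comp, X_comp, neg_neg, Polynomial.comp_X] at h
  · rw [Polynomial.le_rootMultiplicity_iff hq]
    have h := key p (-μ) _ ((Polynomial.le_rootMultiplicity_iff hp).1 le_rfl)
    rwa [neg_neg] at h

/-- **`z⁻(P) = z⁺(P(−λ))`**: the number of positive eigenvalues of the reflected polynomial is the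
number of NEGATIVE real eigenvalues of `P`, with multiplicity. [cite: CameronPsarrakos2019, §1 (p. 644), z⁻(P), and proof of Thm 3 ("the second assertion follows by changing P(λ) into P(−λ)")] -/
theorem zplus_reflect (A : Fin (m + 1) → Matrix (Fin n) (Fin n) 𝕜) :
    zplus (fun i => ((-1 : 𝕜) ^ (i : ℕ)) • A i)
      = Multiset.card ((matPoly A).det.roots.filter (fun μ => RCLike.im μ = 0 ∧ RCLike.re μ < 0)) := by
  classical
  unfold zplus
  rw [det_matPoly_reflect]
  -- compare the two filtered multisets count by count, through `μ ↦ −μ`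
  have h : ((matPoly A).det.comp (-X)).roots.filter (fun μ => RCLike.im μ = 0 ∧ 0 < RCLike.re μ)
      = ((matPoly A).det.roots.filter (fun μ => RCLike.im μ = 0 ∧ RCLike.re μ < 0)).map Neg.neg := by
    ext μ
    rw [Multiset.count_filter, show μ = -(-μ) from (neg_neg μ).symm,
      Multiset.count_map_eq_count' _ _ neg_injective, Multiset.count_filter, neg_neg,
      count_roots, count_roots, rootMultiplicity_comp_neg_X]
    simp only [map_neg, neg_eq_zero, neg_lt_zero]
  rw [h, Multiset.card_map]

end Rules

namespace Rules

variable {𝕜 : Type*} [RCLike 𝕜] {n m : ℕ}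

/-! ### §7. Lemma 2 — de Gua's construction `G(λ) = −kP(λ) + λP′(λ)` loses exactly one alternation -/

/-- `alternations` only depends on the subsequence of non-null signs. [folklore] -/
private theorem alternations_eq_of_filter_eq {l₁ l₂ : List ℤ}
    (h : l₁.filter (fun s => s ≠ 0) = l₂.filter (fun s => s ≠ 0)) :
    alternations l₁ = alternations l₂ := by
  rw [alternations_eq, alternations_eq, h]

/-- Negation commutes with discarding the null signs. [folklore] -/
private theorem filter_map_neg (l : List ℤ) :
    (l.map Neg.neg).filter (fun s => s ≠ 0) = (l.filter (fun s => s ≠ 0)).map Neg.neg := by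
  rw [List.filter_map]
  congr 1
  exact List.filter_congr fun x _ => by simp

/-- Negating every sign does not change the alternation count. [folklore] -/
private theorem alternations_map_neg (l : List ℤ) : alternations (l.map Neg.neg) = alternations l := by
  rw [alternations_eq, alternations_eq, filter_map_neg]
  generalize l.filter (fun s => s ≠ 0) = l'
  induction l' with
  | nil => simp
  | cons a t ih =>
    cases t with
    | nil => simp
    | cons b r =>
      simp only [List.map_cons, List.tail_cons, List.zip_cons_cons, List.countP_cons, neg_mul_neg]
        at ih ⊢
      rw [ih]

/-- de Gua's sign bookkeeping: replacing `…, a, −a, …` by `(earlier signs negated), −a, (null), …`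
loses exactly one alternation. [folklore] -/
private theorem alternations_deGua {a : ℤ} (ha : a ≠ 0) (R : List ℤ) :
    ∀ L : List ℤ, alternations (L ++ a :: -a :: R) = alternations (L.map Neg.neg ++ -a :: R) + 1
  | [] => by
    have hf : (-a :: R).filter (fun s => s ≠ 0) = -a :: R.filter (fun s => s ≠ 0) :=
      filter_cons_of_ne (neg_ne_zero.2 ha) R
    rw [List.nil_append, List.map_nil, List.nil_append, alternations_cons_of_filter_eq_cons ha hf]
    have h2 : a * -a < 0 := by
      have : 0 < a * a := mul_self_pos.2 ha
      linarith [mul_neg a a]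
    rw [if_pos h2]
  | c :: L => by
    have ih := alternations_deGua ha R L
    by_cases hc : c = 0
    · subst hc
      rw [List.cons_append, List.map_cons, neg_zero, List.cons_append, alternations_cons_zero,
        alternations_cons_zero, ih]
    · have hc' : -c ≠ 0 := neg_ne_zero.2 hc
      rw [List.cons_append, List.map_cons, List.cons_append]
      cases hf : L.filter (fun s => s ≠ 0) with
      | nil =>
        have hf₁ : (L ++ a :: -a :: R).filter (fun s => s ≠ 0)
            = a :: (-a :: R).filter (fun s => s ≠ 0) := by
          rw [List.filter_append, hf, List.nil_append, filter_cons_of_ne ha]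
        have hf₂ : (L.map Neg.neg ++ -a :: R).filter (fun s => s ≠ 0)
            = -a :: R.filter (fun s => s ≠ 0) := by
          rw [List.filter_append, filter_map_neg, hf, List.map_nil, List.nil_append,
            filter_cons_of_ne (neg_ne_zero.2 ha)]
        rw [alternations_cons_of_filter_eq_cons hc hf₁, alternations_cons_of_filter_eq_cons hc' hf₂,
          ih, neg_mul_neg, add_right_comm]
      | cons d r =>
        have hf₁ : (L ++ a :: -a :: R).filter (fun s => s ≠ 0)
            = d :: (r ++ (a :: -a :: R).filter (fun s => s ≠ 0)) := by
          rw [List.filter_append, hf, List.cons_append]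
        have hf₂ : (L.map Neg.neg ++ -a :: R).filter (fun s => s ≠ 0)
            = -d :: (r.map Neg.neg ++ (-a :: R).filter (fun s => s ≠ 0)) := by
          rw [List.filter_append, filter_map_neg, hf, List.map_cons, List.cons_append]
        rw [alternations_cons_of_filter_eq_cons hc hf₁, alternations_cons_of_filter_eq_cons hc' hf₂,
          ih, neg_mul_neg, add_right_comm]

/-- Splitting `List.ofFn s` around two indices `j < k`. [folklore] -/
private theorem ofFn_eq_take_append (s : Fin (m + 1) → ℤ) {j k : Fin (m + 1)} (hjk : j < k) :
    List.ofFn s = (List.ofFn s).take j ++ s j ::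
      (((List.ofFn s).drop ((j : ℕ) + 1)).take ((k : ℕ) - ((j : ℕ) + 1)) ++
        s k :: (List.ofFn s).drop ((k : ℕ) + 1)) := by
  have hlen : (List.ofFn s).length = m + 1 := List.length_ofFn
  have hjk' : (j : ℕ) < (k : ℕ) := hjk
  have hk : (k : ℕ) < m + 1 := k.2
  have h1 : ((List.ofFn s).drop ((j : ℕ) + 1)).take ((k : ℕ) - ((j : ℕ) + 1))
      ++ (List.ofFn s).drop (k : ℕ) = (List.ofFn s).drop ((j : ℕ) + 1) := by
    have h := List.take_append_drop ((k : ℕ) - ((j : ℕ) + 1)) ((List.ofFn s).drop ((j : ℕ) + 1))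
    rw [List.drop_drop] at h
    have e : (List.ofFn s).drop (k : ℕ) = List.drop ((j : ℕ) + 1 + ((k : ℕ) - ((j : ℕ) + 1))) (List.ofFn s) := by
      congr 1; omega
    rw [e]; exact h
  have h2 : (List.ofFn s).drop (k : ℕ) = s k :: (List.ofFn s).drop ((k : ℕ) + 1) := by
    rw [List.drop_eq_getElem_cons (by rw [hlen]; exact hk), List.getElem_ofFn]
  have h3 : (List.ofFn s).drop (j : ℕ) = s j :: (List.ofFn s).drop ((j : ℕ) + 1) := by
    rw [List.drop_eq_getElem_cons (by rw [hlen]; omega), List.getElem_ofFn]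
  conv_lhs => rw [← List.take_append_drop (j : ℕ) (List.ofFn s), h3, ← h1, h2]

/-- The middle block consists of the entries with index strictly between `j` and `k`. [folklore] -/
private theorem exists_index_of_mem_middle {s : Fin (m + 1) → ℤ} {j k : Fin (m + 1)} {x : ℤ}
    (hx : x ∈ ((List.ofFn s).drop ((j : ℕ) + 1)).take ((k : ℕ) - ((j : ℕ) + 1))) :
    ∃ i : Fin (m + 1), j < i ∧ i < k ∧ s i = x := by
  rw [List.mem_iff_getElem] at hx
  obtain ⟨t, ht, rfl⟩ := hx
  rw [List.length_take, List.length_drop, List.length_ofFn] at ht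
  have ht' : (j : ℕ) + 1 + t < m + 1 := by omega
  refine ⟨⟨(j : ℕ) + 1 + t, ht'⟩, ?_, ?_, ?_⟩
  · show (j : ℕ) < (j : ℕ) + 1 + t; omega
  · show (j : ℕ) + 1 + t < (k : ℕ); omega
  · rw [List.getElem_take, List.getElem_drop, List.getElem_ofFn]

/-- Prefixes before `j` of two sign functions that are opposite below `j`. [folklore] -/
private theorem take_ofFn_eq_map_neg {s s' : Fin (m + 1) → ℤ} {j : Fin (m + 1)}
    (h : ∀ i, i < j → s' i = -s i) :
    (List.ofFn s').take j = ((List.ofFn s).take j).map Neg.neg := by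
  refine List.ext_getElem (by simp) fun t h₁ h₂ => ?_
  rw [List.length_take, List.length_ofFn] at h₁
  have ht : t < m + 1 := by omega
  rw [List.getElem_take, List.getElem_ofFn, List.getElem_map, List.getElem_take, List.getElem_ofFn]
  exact h ⟨t, ht⟩ (show t < (j : ℕ) by omega)

/-- Suffixes after `k` of two sign functions that agree above `k`. [folklore] -/
private theorem drop_ofFn_eq {s s' : Fin (m + 1) → ℤ} {k : Fin (m + 1)}
    (h : ∀ i, k < i → s' i = s i) :
    (List.ofFn s').drop ((k : ℕ) + 1) = (List.ofFn s).drop ((k : ℕ) + 1) := by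
  refine List.ext_getElem (by simp) fun t h₁ h₂ => ?_
  rw [List.length_drop, List.length_ofFn] at h₁
  have ht : (k : ℕ) + 1 + t < m + 1 := by omega
  rw [List.getElem_drop, List.getElem_ofFn, List.getElem_drop, List.getElem_ofFn]
  exact h ⟨(k : ℕ) + 1 + t, ht⟩ (show (k : ℕ) < (k : ℕ) + 1 + t by omega)

/-- **de Gua's count on index functions.**  If `s j ≠ 0`, `s k = −s j` for some `j < k` with only
null signs strictly in between, and `s'` negates `s` below `k`, kills index `k` and copies `s` above
`k`, then `s` has exactly one more alternation than `s'`. [folklore] -/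
private theorem alternations_ofFn_deGua {s s' : Fin (m + 1) → ℤ} {j k : Fin (m + 1)} (hjk : j < k)
    (hj : s j ≠ 0) (hk : s k = -s j) (hgap : ∀ i, j < i → i < k → s i = 0)
    (hlt : ∀ i, i < k → s' i = -s i) (hkk : s' k = 0) (hgt : ∀ i, k < i → s' i = s i) :
    alternations (List.ofFn s) = alternations (List.ofFn s') + 1 := by
  have key := alternations_deGua hj ((List.ofFn s).drop ((k : ℕ) + 1)) ((List.ofFn s).take j)
  -- `filter (ofFn s) = filter (take j ++ s j :: −s j :: drop (k+1))`
  have h1 : (List.ofFn s).filter (fun x => x ≠ 0)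
      = ((List.ofFn s).take j ++ s j :: -s j :: (List.ofFn s).drop ((k : ℕ) + 1)).filter
          (fun x => x ≠ 0) := by
    conv_lhs => rw [ofFn_eq_take_append s hjk]
    have hmid : (((List.ofFn s).drop ((j : ℕ) + 1)).take ((k : ℕ) - ((j : ℕ) + 1))).filter
        (fun x => x ≠ 0) = [] := by
      rw [List.filter_eq_nil_iff]
      intro x hx
      obtain ⟨i, hji, hik, rfl⟩ := exists_index_of_mem_middle hx
      simpa using hgap i hji hik
    rw [List.filter_append, List.filter_append, List.filter_cons, List.filter_append, hmid,
      List.nil_append, hk]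
    simp [hj]
  -- `filter (ofFn s') = filter ((take j (ofFn s)).map neg ++ −s j :: drop (k+1) (ofFn s))`
  have h2 : (List.ofFn s').filter (fun x => x ≠ 0)
      = (((List.ofFn s).take j).map Neg.neg ++ -s j :: (List.ofFn s).drop ((k : ℕ) + 1)).filter
          (fun x => x ≠ 0) := by
    conv_lhs => rw [ofFn_eq_take_append s' hjk]
    have hmid : (((List.ofFn s').drop ((j : ℕ) + 1)).take ((k : ℕ) - ((j : ℕ) + 1))).filter
        (fun x => x ≠ 0) = [] := by
      rw [List.filter_eq_nil_iff]
      intro x hx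
      obtain ⟨i, hji, hik, rfl⟩ := exists_index_of_mem_middle hx
      have := hgap i hji hik
      simp [hlt i hik, this]
    have hsj : s' j = -s j := hlt j hjk
    rw [List.filter_append, List.filter_append, List.filter_cons, List.filter_append, hmid,
      List.nil_append, hkk, List.filter_cons, hsj,
      take_ofFn_eq_map_neg (fun i hi => hlt i (lt_trans hi hjk)), drop_ofFn_eq hgt,
      List.filter_cons]
    simp
  rw [alternations_eq_of_filter_eq h1, alternations_eq_of_filter_eq h2, key]

/-- Real scalars act on matrices over `𝕜` through `ℝ → 𝕜`. [folklore] -/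
private theorem real_smul_eq (c : ℝ) (B : Matrix (Fin n) (Fin n) 𝕜) :
    c • B = ((c : ℝ) : 𝕜) • B := by
  ext a b
  rw [Matrix.smul_apply, Matrix.smul_apply, smul_eq_mul, RCLike.real_smul_eq_coe_mul]

/-- A positive real multiple is positive definite iff the matrix is. [folklore] -/
private theorem posDef_smul_iff {c : ℝ} (hc : 0 < c) (B : Matrix (Fin n) (Fin n) 𝕜) :
    (((c : ℝ) : 𝕜) • B).PosDef ↔ B.PosDef := by
  constructor
  · intro h
    have h' := h.smul (a := c⁻¹) (inv_pos.2 hc)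
    rw [real_smul_eq, smul_smul, ← RCLike.ofReal_mul, inv_mul_cancel₀ hc.ne', RCLike.ofReal_one,
      one_smul] at h'
    exact h'
  · intro h
    have h' := h.smul (a := c) hc
    rwa [real_smul_eq] at h'

/-- Positive real multiples do not change the sign class. [folklore] -/
private theorem coeffSign_smul_of_pos {c : ℝ} (hc : 0 < c) (B : Matrix (Fin n) (Fin n) 𝕜) :
    coeffSign (((c : ℝ) : 𝕜) • B) = coeffSign B := by
  have hc0 : ((c : ℝ) : 𝕜) ≠ 0 := RCLike.ofReal_ne_zero.mpr hc.ne'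
  have h0 : (((c : ℝ) : 𝕜) • B = 0 ↔ B = 0) := by
    constructor
    · intro h
      rcases smul_eq_zero.1 h with h | h
      · exact absurd h hc0
      · exact h
    · intro h
      rw [h, smul_zero]
  unfold coeffSign
  by_cases hB : B = 0
  · rw [if_pos hB, if_pos (h0.2 hB)]
  · rw [if_neg hB, if_neg (fun h => hB (h0.1 h))]
    by_cases hpd : B.PosDef
    · rw [if_pos hpd, if_pos ((posDef_smul_iff hc B).2 hpd)]
    · rw [if_neg hpd, if_neg (fun h => hpd ((posDef_smul_iff hc B).1 h))]

/-- In the sign trichotomy, `coeffSign (−B) = −coeffSign B`. [folklore] -/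
private theorem coeffSign_neg_of_trichotomy {B : Matrix (Fin n) (Fin n) 𝕜}
    (hB : B.PosDef ∨ (-B).PosDef ∨ B = 0) : coeffSign (-B) = -coeffSign B := by
  rcases Nat.eq_zero_or_pos n with hn | hn
  · subst hn
    have h1 : B = 0 := Subsingleton.elim _ _
    subst h1
    rw [neg_zero]
    unfold coeffSign
    simp
  · haveI : NeZero n := NeZero.of_pos hn
    have h00 : ¬ (0 : Matrix (Fin n) (Fin n) 𝕜).PosDef := fun h =>
      not_posDef_of_neg_posDef (by rwa [neg_zero]) h
    unfold coeffSign
    rcases hB with h | h | h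
    · have hB0 : B ≠ 0 := fun h0 => h00 (h0 ▸ h)
      rw [if_neg (neg_ne_zero.2 hB0), if_neg (not_posDef_of_neg_posDef (by rwa [neg_neg])),
        if_neg hB0, if_pos h]
    · have hB0 : B ≠ 0 := fun h0 => h00 (by rw [h0, neg_zero] at h; exact h)
      have hnp : ¬ B.PosDef := not_posDef_of_neg_posDef h
      rw [if_neg (neg_ne_zero.2 hB0), if_pos h, if_neg hB0, if_neg hnp]
      norm_num
    · subst h
      rw [neg_zero]
      simp

/-- Negative real multiples flip the sign class (in the trichotomy). [folklore] -/
private theorem coeffSign_smul_of_neg {c : ℝ} (hc : c < 0) {B : Matrix (Fin n) (Fin n) 𝕜}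
    (hB : B.PosDef ∨ (-B).PosDef ∨ B = 0) : coeffSign (((c : ℝ) : 𝕜) • B) = -coeffSign B := by
  have e : ((c : ℝ) : 𝕜) • B = (((-c : ℝ) : ℝ) : 𝕜) • (-B) := by
    rw [RCLike.ofReal_neg, neg_smul, smul_neg, neg_neg]
  rw [e, coeffSign_smul_of_pos (neg_pos.2 hc), coeffSign_neg_of_trichotomy hB]

/-- The sign trichotomy is stable under real multiples. [folklore] -/
private theorem trichotomy_smul (c : ℝ) {B : Matrix (Fin n) (Fin n) 𝕜}
    (hB : B.PosDef ∨ (-B).PosDef ∨ B = 0) :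
    (((c : ℝ) : 𝕜) • B).PosDef ∨ (-(((c : ℝ) : 𝕜) • B)).PosDef ∨ ((c : ℝ) : 𝕜) • B = 0 := by
  rcases lt_trichotomy c 0 with hc | rfl | hc
  · have e : ((c : ℝ) : 𝕜) • B = (((-c : ℝ) : ℝ) : 𝕜) • (-B) := by
      rw [RCLike.ofReal_neg, neg_smul, smul_neg, neg_neg]
    rcases hB with h | h | h
    · refine Or.inr (Or.inl ?_)
      rw [e, smul_neg, neg_neg]; exact (posDef_smul_iff (neg_pos.2 hc) B).2 h
    · refine Or.inl ?_
      rw [e]; exact (posDef_smul_iff (neg_pos.2 hc) _).2 h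
    · exact Or.inr (Or.inr (by rw [h, smul_zero]))
  · exact Or.inr (Or.inr (by rw [RCLike.ofReal_zero, zero_smul]))
  · rcases hB with h | h | h
    · exact Or.inl ((posDef_smul_iff hc B).2 h)
    · refine Or.inr (Or.inl ?_)
      rw [← smul_neg]; exact (posDef_smul_iff hc _).2 h
    · exact Or.inr (Or.inr (by rw [h, smul_zero]))

/-- The de Gua coefficients `(i − k) Aᵢ` as real multiples. [folklore] -/
private theorem deGua_coeff_eq (A : Fin (m + 1) → Matrix (Fin n) (Fin n) 𝕜) (k : ℕ) (i : Fin (m + 1)) :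
    (((i : ℕ) : 𝕜) - (k : 𝕜)) • A i = ((((i : ℕ) : ℝ) - (k : ℝ) : ℝ) : 𝕜) • A i := by
  push_cast
  rfl

/-- **`G = −kP + λP′` stays in the class `S`.** [cite: CameronPsarrakos2019, Lemma 2 and §2 ("we can use Lemma 2 to form a G(λ) ∈ S")] -/
theorem inS_deGua {A : Fin (m + 1) → Matrix (Fin n) (Fin n) 𝕜} (hA : InS A) (k : ℕ) :
    InS (fun i => (((i : ℕ) : 𝕜) - (k : 𝕜)) • A i) := by
  intro i
  simp only [deGua_coeff_eq]
  exact trichotomy_smul _ (hA i)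

/-- The signs of the de Gua coefficients. [folklore] -/
private theorem coeffSign_deGua {A : Fin (m + 1) → Matrix (Fin n) (Fin n) 𝕜} (hA : InS A)
    (k i : Fin (m + 1)) :
    coeffSign ((((i : ℕ) : 𝕜) - ((k : ℕ) : 𝕜)) • A i)
      = if i < k then -coeffSign (A i) else if i = k then 0 else coeffSign (A i) := by
  rw [deGua_coeff_eq]
  split_ifs with h1 h2
  · have hc : ((i : ℕ) : ℝ) - ((k : ℕ) : ℝ) < 0 := by
      have : (i : ℕ) < (k : ℕ) := h1
      have : ((i : ℕ) : ℝ) < ((k : ℕ) : ℝ) := by exact_mod_cast this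
      linarith
    exact coeffSign_smul_of_neg hc (hA i)
  · subst h2
    rw [sub_self, RCLike.ofReal_zero, zero_smul]
    unfold coeffSign; simp
  · have hc : 0 < ((i : ℕ) : ℝ) - ((k : ℕ) : ℝ) := by
      have : (k : ℕ) < (i : ℕ) := lt_of_le_of_ne (not_lt.1 h1) (fun h => h2 (Fin.ext h).symm)
      have : ((k : ℕ) : ℝ) < ((i : ℕ) : ℝ) := by exact_mod_cast this
      linarith
    exact coeffSign_smul_of_pos hc (A i)

/-- **de Gua's construction loses exactly one alternation** (the heart of Lemma 2, allowing null
coefficients between the two opposite ones): if `A_j` is non-null, `A_k` (`j < k`) has the opposite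
sign and the coefficients strictly between them are null, then `G = ∑ (i − k) Aᵢ λⁱ = −kP + λP′`
satisfies `α(G) + 1 = α(P)`. [cite: CameronPsarrakos2019, Lemma 2 (p. 645) and its proof] -/
theorem alpha_deGua {A : Fin (m + 1) → Matrix (Fin n) (Fin n) 𝕜} (hA : InS A) {j k : Fin (m + 1)}
    (hjk : j < k) (hj : A j ≠ 0) (hopp : coeffSign (A k) = -coeffSign (A j))
    (hgap : ∀ i, j < i → i < k → A i = 0) :
    alpha (fun i => (((i : ℕ) : 𝕜) - ((k : ℕ) : 𝕜)) • A i) + 1 = alpha A := by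
  unfold alpha
  refine (alternations_ofFn_deGua (s := fun i => coeffSign (A i))
    (s' := fun i => coeffSign ((((i : ℕ) : 𝕜) - ((k : ℕ) : 𝕜)) • A i)) hjk ?_ hopp ?_ ?_ ?_ ?_).symm
  · exact fun h => hj ((coeffSign_eq_zero_iff _).1 h)
  · intro i hji hik
    rw [hgap i hji hik]
    unfold coeffSign; simp
  · intro i hik
    simp only [coeffSign_deGua hA, if_pos hik]
  · simp only [coeffSign_deGua hA, lt_irrefl, if_false, if_true]
  · intro i hki
    simp only [coeffSign_deGua hA, if_neg (not_lt.2 (le_of_lt hki)), if_neg (ne_of_gt hki)]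

/-- `X · (Xⁱ)′ = i · Xⁱ`. [folklore] -/
private theorem X_mul_derivative_X_pow (i : ℕ) :
    (X : 𝕜[X]) * derivative ((X : 𝕜[X]) ^ i) = C ((i : ℕ) : 𝕜) * X ^ i := by
  rcases Nat.eq_zero_or_pos i with rfl | hi
  · simp
  · obtain ⟨i', rfl⟩ : ∃ i', i = i' + 1 := ⟨i - 1, by omega⟩
    rw [derivative_X_pow, Nat.add_sub_cancel, mul_left_comm, ← pow_succ']

/-- **`G(λ) = −kP(λ) + λP′(λ)`**: the matrix polynomial of the de Gua coefficients `(i − k)Aᵢ`.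
[cite: CameronPsarrakos2019, proof of Lemma 2 (p. 645), first display] -/
theorem matPoly_deGua (A : Fin (m + 1) → Matrix (Fin n) (Fin n) 𝕜) (k : ℕ) :
    matPoly (fun i => (((i : ℕ) : 𝕜) - (k : 𝕜)) • A i)
      = (X : 𝕜[X]) • (matPoly A).map (fun p => derivative p) - (C (k : 𝕜)) • matPoly A := by
  refine Matrix.ext fun a b => ?_
  simp only [matPoly_apply, Matrix.sub_apply, Matrix.smul_apply, Matrix.map_apply, smul_eq_mul,
    derivative_sum, derivative_mul, derivative_C, mul_zero, add_zero, Finset.mul_sum,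
    ← Finset.sum_sub_distrib]
  refine Finset.sum_congr rfl fun i _ => ?_
  rw [← mul_assoc, X_mul_derivative_X_pow, C_mul, C_sub]
  ring

/-! ### §8. Diagonalizable by congruence: the diagonal count, Rolle–de Gua, Proposition 4 and (6) -/

/-- The matrix polynomial of a congruent sequence `M Aᵢ Mᴴ`. [folklore] -/
private theorem matPoly_congr (M : Matrix (Fin n) (Fin n) 𝕜) (A : Fin (m + 1) → Matrix (Fin n) (Fin n) 𝕜) :
    matPoly (fun i => M * A i * Mᴴ) = M.map C * matPoly A * Mᴴ.map C := by
  unfold matPoly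
  rw [Finset.mul_sum, Finset.sum_mul]
  refine Finset.sum_congr rfl fun i _ => ?_
  rw [Matrix.map_mul, Matrix.map_mul, Matrix.mul_smul, Matrix.smul_mul]

/-- Its determinant: `det (M P Mᴴ) = (det M · conj (det M)) · det P`. [folklore] -/
private theorem det_matPoly_congr (M : Matrix (Fin n) (Fin n) 𝕜)
    (A : Fin (m + 1) → Matrix (Fin n) (Fin n) 𝕜) :
    (matPoly (fun i => M * A i * Mᴴ)).det = C (M.det * star M.det) * (matPoly A).det := by
  rw [matPoly_congr, det_mul, det_mul]
  have h1 : (M.map (C : 𝕜 → 𝕜[X])).det = C M.det := by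
    rw [show M.map (C : 𝕜 → 𝕜[X]) = (C : 𝕜 →+* 𝕜[X]).mapMatrix M from rfl, ← RingHom.map_det]
  have h2 : (Mᴴ.map (C : 𝕜 → 𝕜[X])).det = C (star M.det) := by
    rw [show Mᴴ.map (C : 𝕜 → 𝕜[X]) = (C : 𝕜 →+* 𝕜[X]).mapMatrix Mᴴ from rfl, ← RingHom.map_det,
      det_conjTranspose]
  rw [h1, h2, C_mul]
  ring

/-- The matrix polynomial of a real diagonal sequence is the diagonal of the entry polynomials.
[folklore] -/
private theorem matPoly_diagonal (d : Fin n → Fin (m + 1) → ℝ) :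
    matPoly (fun i => Matrix.diagonal (fun a => ((d a i : ℝ) : 𝕜)))
      = Matrix.diagonal
          (fun a => (∑ i : Fin (m + 1), C (d a i) * X ^ (i : ℕ)).map (algebraMap ℝ 𝕜)) := by
  refine Matrix.ext fun a b => ?_
  rw [matPoly_apply]
  by_cases hab : a = b
  · subst hab
    simp only [Matrix.diagonal_apply_eq, Polynomial.map_sum, Polynomial.map_mul, Polynomial.map_pow,
      map_C, map_X, RCLike.algebraMap_eq_ofReal]
    refine Finset.sum_congr rfl fun i _ => ?_
    rw [mul_comm]
  · simp [Matrix.diagonal_apply_ne _ hab]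

/-- For a sequence diagonalised by the congruence `M`: `C(det M · conj det M) · det P = ∏ₐ dₐ`
(mapped to `𝕜`). [folklore] -/
private theorem det_matPoly_of_congr_diagonal {A : Fin (m + 1) → Matrix (Fin n) (Fin n) 𝕜}
    {M : Matrix (Fin n) (Fin n) 𝕜} {d : Fin n → Fin (m + 1) → ℝ}
    (hd : ∀ i, M * A i * Mᴴ = Matrix.diagonal (fun a => ((d a i : ℝ) : 𝕜))) :
    C (M.det * star M.det) * (matPoly A).det
      = (∏ a, ∑ i : Fin (m + 1), C (d a i) * X ^ (i : ℕ)).map (algebraMap ℝ 𝕜) := by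
  rw [← det_matPoly_congr,
    show (fun i => M * A i * Mᴴ) = fun i => Matrix.diagonal (fun a => ((d a i : ℝ) : 𝕜)) from funext hd,
    matPoly_diagonal, det_diagonal, Polynomial.map_prod]

/-- Root counts of a non-zero product add up. [folklore] -/
private theorem countP_roots_prod {ι : Type*} (s : Finset ι) (f : ι → ℝ[X]) (h : ∏ i ∈ s, f i ≠ 0)
    (p : ℝ → Prop) [DecidablePred p] :
    (∏ i ∈ s, f i).roots.countP p = ∑ i ∈ s, (f i).roots.countP p := by
  classical
  induction s using Finset.induction_on with
  | empty => simp
  | insert a s ha ih =>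
    rw [Finset.prod_insert ha] at h ⊢
    rw [Polynomial.roots_mul h, Multiset.countP_add, Finset.sum_insert ha,
      ih (right_ne_zero_of_mul h)]

/-- **The diagonal count.**  For a REGULAR sequence diagonalised by a nonsingular congruence,
`z⁺(P)` is the total number of positive roots (with multiplicity) of the diagonal entries `dₐ`.
[folklore] -/
private theorem zplus_eq_diagCount {A : Fin (m + 1) → Matrix (Fin n) (Fin n) 𝕜}
    {M : Matrix (Fin n) (Fin n) 𝕜} (hM : M.det ≠ 0) {d : Fin n → Fin (m + 1) → ℝ}
    (hd : ∀ i, M * A i * Mᴴ = Matrix.diagonal (fun a => ((d a i : ℝ) : 𝕜)))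
    (hdet : (matPoly A).det ≠ 0) :
    zplus A = ∑ a, (∑ i : Fin (m + 1), C (d a i) * X ^ (i : ℕ)).roots.countP (fun x => 0 < x) := by
  classical
  set c : ℝ := ‖M.det‖ ^ 2 with hc
  have hc0 : c ≠ 0 := pow_ne_zero _ (norm_ne_zero_iff.2 hM)
  have hcc : C (M.det * star M.det) = (C c).map (algebraMap ℝ 𝕜) := by
    rw [map_C, RCLike.algebraMap_eq_ofReal]
    congr 1
    rw [RCLike.star_def, RCLike.mul_conj, hc]
    norm_cast
  have hq : (C c⁻¹ * ∏ a, ∑ i : Fin (m + 1), C (d a i) * X ^ (i : ℕ)).map (algebraMap ℝ 𝕜)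
      = (matPoly A).det := by
    rw [Polynomial.map_mul, ← det_matPoly_of_congr_diagonal hd, hcc, ← mul_assoc,
      ← Polynomial.map_mul, ← C_mul, inv_mul_cancel₀ hc0, C_1, Polynomial.map_one, one_mul]
  have hprod : ∏ a, ∑ i : Fin (m + 1), C (d a i) * X ^ (i : ℕ) ≠ 0 := by
    intro h0
    apply hdet
    rw [← hq, h0, mul_zero, Polynomial.map_zero]
  rw [zplus_eq_countP hq, roots_C_mul _ (inv_ne_zero hc0)]
  exact countP_roots_prod _ _ hprod _

/-- A diagonal entry of `M B Mᴴ` is the Hermitian form of `B` at the conjugate of a row of `M`.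
[folklore] -/
private theorem mul_mul_conjTranspose_apply_self (M B : Matrix (Fin n) (Fin n) 𝕜) (a : Fin n) :
    (M * B * Mᴴ) a a = star (star (M a)) ⬝ᵥ (B *ᵥ star (M a)) := by
  rw [star_star]
  simp only [Matrix.mul_apply, Matrix.conjTranspose_apply, dotProduct, Matrix.mulVec,
    Pi.star_apply, Finset.sum_mul, Finset.mul_sum]
  rw [Finset.sum_comm]
  refine Finset.sum_congr rfl fun b _ => Finset.sum_congr rfl fun c _ => ?_
  ring

/-- Signs of the diagonal entries of a congruence-diagonalised member of `S`: they carry the signs of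
the coefficients. [folklore] -/
private theorem diag_sign {A : Fin (m + 1) → Matrix (Fin n) (Fin n) 𝕜} (hA : InS A)
    {M : Matrix (Fin n) (Fin n) 𝕜} (hM : M.det ≠ 0) {d : Fin n → Fin (m + 1) → ℝ}
    (hd : ∀ i, M * A i * Mᴴ = Matrix.diagonal (fun a => ((d a i : ℝ) : 𝕜))) (a : Fin n)
    (i : Fin (m + 1)) :
    (coeffSign (A i) = 1 → 0 < d a i) ∧ (coeffSign (A i) = -1 → d a i < 0) ∧
      (coeffSign (A i) = 0 → d a i = 0) := by
  set v : Fin n → 𝕜 := star (M a) with hv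
  have hva : M a ≠ 0 := by
    intro h0
    apply hM
    exact Matrix.det_eq_zero_of_row_eq_zero a (fun j => by rw [h0]; rfl)
  have hv0 : v ≠ 0 := by
    intro h0
    apply hva
    have := congrArg star h0
    rwa [hv, star_star, star_zero] at this
  have key : ((d a i : ℝ) : 𝕜) = star v ⬝ᵥ (A i *ᵥ v) := by
    have h := congrFun (congrFun (hd i) a) a
    rw [Matrix.diagonal_apply_eq, mul_mul_conjTranspose_apply_self] at h
    rw [hv]
    exact h.symm
  have hre : d a i = RCLike.re (star v ⬝ᵥ (A i *ᵥ v)) := by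
    rw [← key, RCLike.ofReal_re]
  refine ⟨fun h => ?_, fun h => ?_, fun h => ?_⟩
  · rw [hre]; exact re_form_pos_of_coeffSign_eq_one h hv0
  · rw [hre]; exact re_form_neg_of_coeffSign_eq_neg_one hA h hv0
  · rw [hre]; exact re_form_eq_zero_of_coeffSign_eq_zero h v

/-- Coefficients of an entry polynomial `∑ C (c i) Xⁱ`. [folklore] -/
private theorem coeff_sum_C_mul_X_pow (c : Fin (m + 1) → ℝ) (j : ℕ) :
    (∑ i : Fin (m + 1), C (c i) * X ^ (i : ℕ)).coeff j = if h : j < m + 1 then c ⟨j, h⟩ else 0 := by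
  rw [finsetSum_coeff]
  simp only [coeff_C_mul_X_pow]
  split_ifs with h
  · rw [Finset.sum_eq_single ⟨j, h⟩]
    · simp
    · intro i _ hi
      rw [if_neg]
      intro e
      apply hi
      exact Fin.ext e.symm
    · simp
  · refine Finset.sum_eq_zero fun i _ => ?_
    rw [if_neg]
    intro e
    apply h
    rw [e]
    exact i.2

/-- Descartes with `Var = 0`: one-signed coefficients (`≥ 0`) ⇒ no positive root. [folklore] -/
private theorem countP_roots_eq_zero_of_nonneg {c : Fin (m + 1) → ℝ} (hc : ∀ i, 0 ≤ c i) :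
    (∑ i : Fin (m + 1), C (c i) * X ^ (i : ℕ)).roots.countP (fun x => 0 < x) = 0 := by
  have hV : (∑ i : Fin (m + 1), C (c i) * X ^ (i : ℕ)).signVariations = 0 := by
    refine Literature.Algebra.Polynomial.Descartes.signVariations_eq_zero_of_coeff_nonneg fun j => ?_
    rw [coeff_sum_C_mul_X_pow]
    split_ifs
    · exact hc _
    · exact le_rfl
  have h := Polynomial.roots_countP_pos_le_signVariations (∑ i : Fin (m + 1), C (c i) * X ^ (i : ℕ))
  rw [hV] at h
  exact Nat.le_zero.1 h

/-- … and (`≤ 0`) ⇒ no positive root. [folklore] -/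
private theorem countP_roots_eq_zero_of_nonpos {c : Fin (m + 1) → ℝ} (hc : ∀ i, c i ≤ 0) :
    (∑ i : Fin (m + 1), C (c i) * X ^ (i : ℕ)).roots.countP (fun x => 0 < x) = 0 := by
  have h := countP_roots_eq_zero_of_nonneg (c := fun i => -c i) (fun i => neg_nonneg.2 (hc i))
  have e : (∑ i : Fin (m + 1), C (-c i) * X ^ (i : ℕ)) = -∑ i : Fin (m + 1), C (c i) * X ^ (i : ℕ) := by
    rw [← Finset.sum_neg_distrib]
    refine Finset.sum_congr rfl fun i _ => ?_
    rw [C_neg, neg_mul]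
  rwa [e, roots_neg] at h

/-- If `X·p′ − k·p = 0` then `p = c·X^k`, which has no positive root. [folklore] -/
private theorem countP_roots_eq_zero_of_deGua_eq_zero {p : ℝ[X]} {k : ℕ}
    (h : X * derivative p - C (k : ℝ) * p = 0) : p.roots.countP (fun x => 0 < x) = 0 := by
  -- all coefficients off degree `k` vanish
  have hcoeff : ∀ j, j ≠ k → p.coeff j = 0 := by
    intro j hj
    have hj' := congrArg (fun q => q.coeff j) h
    simp only [coeff_sub, coeff_C_mul, coeff_zero] at hj'
    have hX : (X * derivative p).coeff j = (j : ℝ) * p.coeff j := by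
      rcases j with _ | j
      · simp
      · rw [coeff_X_mul, coeff_derivative]
        push_cast
        ring
    rw [hX, ← sub_mul] at hj'
    rcases mul_eq_zero.1 hj' with h1 | h1
    · exfalso
      apply hj
      exact_mod_cast (sub_eq_zero.1 h1)
    · exact h1
  have hp : p = C (p.coeff k) * X ^ k := by
    ext j
    rw [coeff_C_mul_X_pow]
    split_ifs with hj
    · rw [hj]
    · exact hcoeff j hj
  by_cases hc : p.coeff k = 0
  · rw [hp, hc, C_0, zero_mul, roots_zero]
    rfl
  · rw [hp, roots_C_mul_X_pow hc, Multiset.countP_eq_zero]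
    intro x hx
    have : x = 0 := by
      have := Multiset.mem_of_mem_nsmul hx
      simpa using this
    rw [this]
    exact lt_irrefl 0

/-- **Rolle–de Gua on `(0, ∞)`.**  The positive roots of a real polynomial `p`, with multiplicity,
number at most one more than those of `X·p′ − k·p` (for `k = 0`: Rolle's theorem for `p′`; in
general: Rolle for `x ↦ x^{−k} p(x)`, whose derivative is `x^{−k−1}(x p′(x) − k p(x))`, plus the
multiplicity count `(X − c)^{μ−1} ∣ X·p′ − k·p`). [folklore] -/
private theorem countP_roots_le_deGua (p : ℝ[X]) (k : ℕ) :
    p.roots.countP (fun x => 0 < x)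
      ≤ (X * derivative p - C (k : ℝ) * p).roots.countP (fun x => 0 < x) + 1 := by
  classical
  rcases eq_or_ne (X * derivative p - C (k : ℝ) * p) 0 with hg0 | hg0
  · rw [countP_roots_eq_zero_of_deGua_eq_zero hg0]
    exact Nat.zero_le _
  have hp : p ≠ 0 := by
    rintro rfl
    apply hg0
    simp
  set S := p.roots.filter (fun x => 0 < x) with hS
  set T := (X * derivative p - C (k : ℝ) * p).roots.filter (fun x => 0 < x) with hT
  rw [Multiset.countP_eq_card_filter, Multiset.countP_eq_card_filter]
  -- (i) distinct positive roots interleave: Rolle for `x^{-k} p(x)`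
  have hdist : S.toFinset.card ≤ (T.toFinset \ S.toFinset).card + 1 := by
    refine Finset.card_le_sdiff_of_interleaved fun x hx y hy hxy _ => ?_
    rw [Multiset.mem_toFinset, hS, Multiset.mem_filter, mem_roots hp] at hx hy
    obtain ⟨hxr, hx0⟩ := hx
    obtain ⟨hyr, hy0⟩ := hy
    have hf : ∀ u ∈ Set.Ioo x y, HasDerivAt (fun u => p.eval u * u ^ (-(k : ℤ)))
        (p.derivative.eval u * u ^ (-(k : ℤ))
          + p.eval u * (((-(k : ℤ) : ℤ) : ℝ) * u ^ (-(k : ℤ) - 1))) u := by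
      intro u hu
      have hu0 : u ≠ 0 := (hx0.trans hu.1).ne'
      exact (p.hasDerivAt u).mul (hasDerivAt_zpow (-(k : ℤ)) u (Or.inl hu0))
    have hcont : ContinuousOn (fun u => p.eval u * u ^ (-(k : ℤ))) (Set.Icc x y) := by
      refine continuousOn_of_forall_continuousAt fun u hu => ?_
      have hu0 : u ≠ 0 := (hx0.trans_le hu.1).ne'
      exact ((p.hasDerivAt u).mul (hasDerivAt_zpow (-(k : ℤ)) u (Or.inl hu0))).continuousAt
    have hends : (fun u => p.eval u * u ^ (-(k : ℤ))) x = (fun u => p.eval u * u ^ (-(k : ℤ))) y := by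
      have hx' : p.eval x = 0 := hxr
      have hy' : p.eval y = 0 := hyr
      simp only [hx', hy', zero_mul]
    obtain ⟨c, hc, hdc⟩ := exists_hasDerivAt_eq_zero hxy hcont hends hf
    have hc0 : 0 < c := hx0.trans hc.1
    refine ⟨c, ?_, hc.1, hc.2⟩
    rw [Multiset.mem_toFinset, hT, Multiset.mem_filter, mem_roots hg0]
    refine ⟨?_, hc0⟩
    have hzpow : c ^ (-(k : ℤ)) = c ^ (-(k : ℤ) - 1) * c := by
      rw [← zpow_add_one₀ hc0.ne', sub_add_cancel]
    have hne : c ^ (-(k : ℤ) - 1) ≠ 0 := zpow_ne_zero _ hc0.ne'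
    rw [hzpow] at hdc
    have h2 : c ^ (-(k : ℤ) - 1) * (c * p.derivative.eval c - (k : ℝ) * p.eval c) = 0 := by
      rw [← hdc]
      push_cast
      ring
    rcases mul_eq_zero.1 h2 with h | h
    · exact absurd h hne
    · show (X * derivative p - C (k : ℝ) * p).IsRoot c
      rw [IsRoot.def, eval_sub, eval_mul, eval_X, eval_mul, eval_C]
      exact h
  -- (ii) multiplicities drop by at most one
  have hmult : ∀ x, p.rootMultiplicity x ≤
      (X * derivative p - C (k : ℝ) * p).rootMultiplicity x + 1 := by
    intro x
    suffices h : p.rootMultiplicity x - 1 ≤ (X * derivative p - C (k : ℝ) * p).rootMultiplicity x by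
      omega
    rw [Polynomial.le_rootMultiplicity_iff hg0]
    have h1 : (X - C x) ^ (p.rootMultiplicity x - 1) ∣ p :=
      (pow_dvd_pow _ (Nat.sub_le _ _)).trans (p.pow_rootMultiplicity_dvd x)
    have h2 : (X - C x) ^ (p.rootMultiplicity x - 1) ∣ derivative p :=
      pow_sub_one_dvd_derivative_of_pow_dvd (p.pow_rootMultiplicity_dvd x)
    exact dvd_sub (dvd_mul_of_dvd_right h2 _) (dvd_mul_of_dvd_right h1 _)
  -- (iii) counting
  have hcountS : ∀ x ∈ S.toFinset, S.count x = p.rootMultiplicity x := by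
    intro x hx
    rw [Multiset.mem_toFinset, hS, Multiset.mem_filter] at hx
    rw [hS, Multiset.count_filter_of_pos hx.2, count_roots]
  have hcountT : ∀ x ∈ S.toFinset, T.count x = (X * derivative p - C (k : ℝ) * p).rootMultiplicity x := by
    intro x hx
    rw [Multiset.mem_toFinset, hS, Multiset.mem_filter] at hx
    rw [hT, Multiset.count_filter_of_pos hx.2, count_roots]
  calc Multiset.card S = ∑ x ∈ S.toFinset, S.count x := (Multiset.toFinset_sum_count_eq _).symm
    _ ≤ ∑ x ∈ S.toFinset, (T.count x + 1) := by
        refine Finset.sum_le_sum fun x hx => ?_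
        rw [hcountS x hx, hcountT x hx]
        exact hmult x
    _ = (∑ x ∈ S.toFinset, T.count x) + S.toFinset.card := by
        rw [Finset.sum_add_distrib, Finset.card_eq_sum_ones]
    _ ≤ (∑ x ∈ S.toFinset, T.count x) + ((T.toFinset \ S.toFinset).card + 1) :=
        Nat.add_le_add_left hdist _
    _ ≤ (∑ x ∈ S.toFinset, T.count x) + ((∑ x ∈ T.toFinset \ S.toFinset, T.count x) + 1) := by
        refine Nat.add_le_add_left (Nat.add_le_add_right ?_ 1) _
        rw [Finset.card_eq_sum_ones]
        refine Finset.sum_le_sum fun x hx => ?_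
        rw [Nat.succ_le_iff, Multiset.count_pos, ← Multiset.mem_toFinset]
        exact (Finset.mem_sdiff.1 hx).1
    _ = Multiset.card T + 1 := by
        rw [← add_assoc, ← Finset.sum_union Finset.disjoint_sdiff, Finset.union_sdiff_self_eq_union,
          ← Multiset.toFinset_sum_count_eq, ← Finset.sum_subset Finset.subset_union_right]
        intro x _ hx₂
        simpa only [Multiset.mem_toFinset, Multiset.count_eq_zero] using hx₂

/-- Positive roots of `X·q` are those of `q`. [folklore] -/
private theorem countP_roots_X_mul (q : ℝ[X]) :
    (X * q).roots.countP (fun x => 0 < x) = q.roots.countP (fun x => 0 < x) := by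
  by_cases hq : q = 0
  · rw [hq, mul_zero]
  · rw [roots_mul (mul_ne_zero X_ne_zero hq), Multiset.countP_add, roots_X,
      Multiset.countP_eq_zero.2 (fun x hx => ?_), zero_add]
    rw [Multiset.mem_singleton] at hx
    subst hx
    exact lt_irrefl 0

/-- A sequence of `S` with an alternation has a de Gua pair: indices `j < k` with `A_j ≠ 0`,
`coeffSign A_k = −coeffSign A_j`, and only null coefficients strictly in between. [folklore] -/
private theorem exists_deGua_pair {A : Fin (m + 1) → Matrix (Fin n) (Fin n) 𝕜} (hα : alpha A ≠ 0) :
    ∃ j k : Fin (m + 1), j < k ∧ A j ≠ 0 ∧ coeffSign (A k) = -coeffSign (A j) ∧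
      ∀ i, j < i → i < k → A i = 0 := by
  classical
  set S := (Finset.univ : Finset (Fin (m + 1))).filter (fun i => coeffSign (A i) ≠ 0) with hSdef
  have hSne : S.Nonempty := by
    by_contra h
    rw [Finset.not_nonempty_iff_eq_empty] at h
    apply hα
    unfold alpha
    refine alternations_eq_zero_of_forall_eq _ 1 fun x hx hx0 => ?_
    rw [List.mem_ofFn] at hx
    obtain ⟨i, rfl⟩ := hx
    have : i ∈ S := Finset.mem_filter.2 ⟨Finset.mem_univ _, hx0⟩
    rw [h] at this
    simp at this
  set k₀ := S.min' hSne with hk₀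
  have hk₀S : coeffSign (A k₀) ≠ 0 := (Finset.mem_filter.1 (S.min'_mem hSne)).2
  set S' := (Finset.univ : Finset (Fin (m + 1))).filter
    (fun i => coeffSign (A i) ≠ 0 ∧ coeffSign (A i) ≠ coeffSign (A k₀)) with hS'def
  have hS'ne : S'.Nonempty := by
    by_contra h
    rw [Finset.not_nonempty_iff_eq_empty] at h
    apply hα
    unfold alpha
    refine alternations_eq_zero_of_forall_eq _ (coeffSign (A k₀)) fun x hx hx0 => ?_
    rw [List.mem_ofFn] at hx
    obtain ⟨i, rfl⟩ := hx
    by_contra hne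
    have : i ∈ S' := Finset.mem_filter.2 ⟨Finset.mem_univ _, hx0, hne⟩
    rw [h] at this
    simp at this
  set k := S'.min' hS'ne with hk
  obtain ⟨hk1, hk2⟩ := (Finset.mem_filter.1 (S'.min'_mem hS'ne)).2
  have hk₀k : k₀ < k := by
    refine lt_of_le_of_ne (S.min'_le k (Finset.mem_filter.2 ⟨Finset.mem_univ _, hk1⟩)) ?_
    intro h
    apply hk2
    rw [h]
  set J := (Finset.univ : Finset (Fin (m + 1))).filter (fun i => i < k ∧ coeffSign (A i) ≠ 0)
    with hJdef
  have hJne : J.Nonempty := ⟨k₀, Finset.mem_filter.2 ⟨Finset.mem_univ _, hk₀k, hk₀S⟩⟩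
  set j := J.max' hJne with hj
  obtain ⟨hjk, hj0⟩ := (Finset.mem_filter.1 (J.max'_mem hJne)).2
  have hjσ : coeffSign (A j) = coeffSign (A k₀) := by
    by_contra hne
    have : j ∈ S' := Finset.mem_filter.2 ⟨Finset.mem_univ _, hj0, hne⟩
    exact absurd (S'.min'_le j this) (not_le.2 hjk)
  refine ⟨j, k, hjk, fun h => hj0 ((coeffSign_eq_zero_iff _).2 h), ?_, fun i hji hik => ?_⟩
  · rw [hjσ]
    rcases coeffSign_trichotomy (A k) with h | h | h
    · exact absurd h hk1
    · rcases coeffSign_trichotomy (A k₀) with h' | h' | h'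
      · exact absurd h' hk₀S
      · exact absurd (h.trans h'.symm) hk2
      · rw [h, h']; norm_num
    · rcases coeffSign_trichotomy (A k₀) with h' | h' | h'
      · exact absurd h' hk₀S
      · rw [h, h']
      · exact absurd (h.trans h'.symm) hk2
  · by_contra hne
    have hi0 : coeffSign (A i) ≠ 0 := fun h0 => hne ((coeffSign_eq_zero_iff _).1 h0)
    have : i ∈ J := Finset.mem_filter.2 ⟨Finset.mem_univ _, hik, hi0⟩
    exact absurd (J.le_max' i this) (not_le.2 hji)

/-- The scalar de Gua identity on entry polynomials: `∑ (i − k) cᵢ Xⁱ = X·(∑ cᵢ Xⁱ)′ − k·∑ cᵢ Xⁱ`.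
[folklore] -/
private theorem sum_C_deGua (c : Fin (m + 1) → ℝ) (k : ℕ) :
    (∑ i : Fin (m + 1), C ((((i : ℕ) : ℝ) - k) * c i) * X ^ (i : ℕ))
      = X * derivative (∑ i : Fin (m + 1), C (c i) * X ^ (i : ℕ))
          - C (k : ℝ) * ∑ i : Fin (m + 1), C (c i) * X ^ (i : ℕ) := by
  rw [derivative_sum, Finset.mul_sum, Finset.mul_sum, ← Finset.sum_sub_distrib]
  refine Finset.sum_congr rfl fun i _ => ?_
  rw [derivative_C_mul, mul_left_comm, X_mul_derivative_X_pow, C_mul, C_sub]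
  ring

/-- **The diagonal count obeys (6).**  For a member of `S` diagonalised by a nonsingular congruence,
`∑ₐ #{positive roots of dₐ, with multiplicity} ≤ n·α(P)` — by induction on `α(P)` along de Gua's
construction (the paper's route "(3) ⇒ (6)", §2), the base case being Descartes' rule with no sign
variation and the step Rolle–de Gua entry by entry. [folklore] -/
private theorem diagCount_le {M : Matrix (Fin n) (Fin n) 𝕜} (hM : M.det ≠ 0) :
    ∀ (N : ℕ) (A : Fin (m + 1) → Matrix (Fin n) (Fin n) 𝕜) (d : Fin n → Fin (m + 1) → ℝ),
      InS A → (∀ i, M * A i * Mᴴ = Matrix.diagonal (fun a => ((d a i : ℝ) : 𝕜))) → alpha A = N →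
      ∑ a, (∑ i : Fin (m + 1), C (d a i) * X ^ (i : ℕ)).roots.countP (fun x => 0 < x) ≤ n * N
  | 0, A, d, hA, hd, hα => by
    have hl : ∀ x ∈ (List.ofFn fun i => coeffSign (A i)), x = 0 ∨ x = 1 ∨ x = -1 := by
      intro x hx
      rw [List.mem_ofFn] at hx
      obtain ⟨i, rfl⟩ := hx
      exact coeffSign_trichotomy (A i)
    obtain ⟨σ, hσ, hall⟩ := exists_forall_eq_of_alternations_eq_zero _ hl hα
    have hsgn : ∀ i, coeffSign (A i) ≠ 0 → coeffSign (A i) = σ := fun i hi =>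
      hall _ (List.mem_ofFn.2 ⟨i, rfl⟩) hi
    rw [Nat.mul_zero, Nat.le_zero, Finset.sum_eq_zero_iff]
    intro a _
    rcases hσ with rfl | rfl
    · refine countP_roots_eq_zero_of_nonneg fun i => ?_
      rcases coeffSign_trichotomy (A i) with h | h | h
      · exact ((diag_sign hA hM hd a i).2.2 h).symm.le
      · exact ((diag_sign hA hM hd a i).1 h).le
      · exact absurd (hsgn i (by rw [h]; norm_num)) (by rw [h]; norm_num)
    · refine countP_roots_eq_zero_of_nonpos fun i => ?_
      rcases coeffSign_trichotomy (A i) with h | h | h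
      · exact ((diag_sign hA hM hd a i).2.2 h).le
      · exact absurd (hsgn i (by rw [h]; norm_num)) (by rw [h]; norm_num)
      · exact ((diag_sign hA hM hd a i).2.1 h).le
  | N + 1, A, d, hA, hd, hα => by
    obtain ⟨j, k, hjk, hj, hopp, hgap⟩ :=
      exists_deGua_pair (A := A) (by rw [hα]; exact Nat.succ_ne_zero N)
    -- de Gua's sequence, diagonalised by the same congruence
    have hGd : ∀ i : Fin (m + 1), M * ((((i : ℕ) : 𝕜) - ((k : ℕ) : 𝕜)) • A i) * Mᴴ
        = Matrix.diagonal (fun a => (((((i : ℕ) : ℝ) - (k : ℕ)) * d a i : ℝ) : 𝕜)) := by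
      intro i
      rw [deGua_coeff_eq, Matrix.mul_smul, Matrix.smul_mul, hd i, ← Matrix.diagonal_smul]
      congr 1
      funext a
      simp only [Pi.smul_apply, smul_eq_mul]
      push_cast
      ring
    have hGα : alpha (fun i => (((i : ℕ) : 𝕜) - ((k : ℕ) : 𝕜)) • A i) = N := by
      have := alpha_deGua hA hjk hj hopp hgap
      omega
    have ih := diagCount_le hM N _ (fun a (i : Fin (m + 1)) => (((i : ℕ) : ℝ) - (k : ℕ)) * d a i)
      (inS_deGua hA k)
      hGd hGα
    have hstep : ∀ a, (∑ i : Fin (m + 1), C (d a i) * X ^ (i : ℕ)).roots.countP (fun x => 0 < x)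
        ≤ (∑ i : Fin (m + 1), C ((((i : ℕ) : ℝ) - (k : ℕ)) * d a i) * X ^ (i : ℕ)).roots.countP
            (fun x => 0 < x) + 1 := by
      intro a
      rw [sum_C_deGua (d a) k]
      exact countP_roots_le_deGua _ _
    calc ∑ a, (∑ i : Fin (m + 1), C (d a i) * X ^ (i : ℕ)).roots.countP (fun x => 0 < x)
        ≤ ∑ a, ((∑ i : Fin (m + 1), C ((((i : ℕ) : ℝ) - (k : ℕ)) * d a i) * X ^ (i : ℕ)).roots.countP
            (fun x => 0 < x) + 1) := by
          exact Finset.sum_le_sum fun a _ => hstep a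
      _ = (∑ a, (∑ i : Fin (m + 1), C ((((i : ℕ) : ℝ) - (k : ℕ)) * d a i) * X ^ (i : ℕ)).roots.countP
            (fun x => 0 < x)) + n := by
          rw [Finset.sum_add_distrib]
          simp
      _ ≤ n * N + n := Nat.add_le_add_right ih n
      _ = n * (N + 1) := by ring

/-- Shifting coefficients differentiates: `∑_{i<m} (i+1) c_{i+1} Xⁱ = (∑ cᵢ Xⁱ)′`. [folklore] -/
private theorem sum_C_derivSeq {R : Type*} [CommSemiring R] (c : Fin (m + 1) → R) :
    (∑ i : Fin (m + 1), C (if h : (i : ℕ) + 1 < m + 1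
        then (((i : ℕ) + 1 : ℕ) : R) * c ⟨(i : ℕ) + 1, h⟩ else 0) * X ^ (i : ℕ))
      = derivative (∑ i : Fin (m + 1), C (c i) * X ^ (i : ℕ)) := by
  rw [derivative_sum, Fin.sum_univ_castSucc, Fin.sum_univ_succ]
  have hlast : (if h : ((Fin.last m : Fin (m + 1)) : ℕ) + 1 < m + 1 then
      ((((Fin.last m : Fin (m + 1)) : ℕ) + 1 : ℕ) : R) * c ⟨((Fin.last m : Fin (m + 1)) : ℕ) + 1, h⟩
      else 0) = 0 := by
    rw [dif_neg]
    simp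
  have hfirst : derivative (C (c 0) * X ^ (((0 : Fin (m + 1)) : ℕ))) = 0 := by
    simp
  rw [hlast, C_0, zero_mul, add_zero, hfirst, zero_add]
  refine Finset.sum_congr rfl fun i _ => ?_
  have hi : ((Fin.castSucc i : Fin (m + 1)) : ℕ) + 1 < m + 1 := by
    rw [Fin.val_castSucc]
    have := i.2
    omega
  have e : (⟨((Fin.castSucc i : Fin (m + 1)) : ℕ) + 1, hi⟩ : Fin (m + 1)) = i.succ :=
    Fin.ext (by simp)
  rw [dif_pos hi, e, derivative_C_mul, derivative_X_pow, Fin.val_castSucc, Fin.val_succ,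
    Nat.add_sub_cancel, C_mul]
  push_cast
  ring

/-- **`P′(λ)`**: the matrix polynomial of the shifted sequence `i ↦ (i+1) A_{i+1}` (and `0` on top)
is the entrywise derivative of `P`. [cite: CameronPsarrakos2019, §2 (p. 644–645), P′(λ)] -/
theorem matPoly_derivSeq (A : Fin (m + 1) → Matrix (Fin n) (Fin n) 𝕜) :
    matPoly (fun i : Fin (m + 1) => if h : (i : ℕ) + 1 < m + 1
        then ((((i : ℕ) + 1 : ℕ) : 𝕜)) • A ⟨(i : ℕ) + 1, h⟩ else 0)
      = (matPoly A).map (fun p => derivative p) := by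
  refine Matrix.ext fun a b => ?_
  rw [Matrix.map_apply, matPoly_apply, matPoly_apply]
  have h := sum_C_derivSeq (R := 𝕜) (fun i => A i a b)
  rw [show (∑ i : Fin (m + 1), (X : 𝕜[X]) ^ (i : ℕ) * C (A i a b))
      = ∑ i : Fin (m + 1), C (A i a b) * X ^ (i : ℕ) from Finset.sum_congr rfl fun i _ => mul_comm _ _,
    ← h]
  refine Finset.sum_congr rfl fun i _ => ?_
  rw [mul_comm]
  congr 2
  by_cases hi : (i : ℕ) + 1 < m + 1
  · rw [dif_pos hi, dif_pos hi, Matrix.smul_apply, smul_eq_mul]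
  · rw [dif_neg hi, dif_neg hi, Matrix.zero_apply]

/-- `P′` stays in the class `S`. [cite: CameronPsarrakos2019, §2 (p. 644), P′(λ) for P ∈ S] -/
theorem inS_derivSeq {A : Fin (m + 1) → Matrix (Fin n) (Fin n) 𝕜} (hA : InS A) :
    InS (fun i : Fin (m + 1) => if h : (i : ℕ) + 1 < m + 1
        then ((((i : ℕ) + 1 : ℕ) : 𝕜)) • A ⟨(i : ℕ) + 1, h⟩ else 0) := by
  intro i
  by_cases hi : (i : ℕ) + 1 < m + 1
  · simp only [dif_pos hi]
    rw [show ((((i : ℕ) + 1 : ℕ) : 𝕜)) = ((((i : ℕ) + 1 : ℕ) : ℝ) : 𝕜) by norm_cast]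
    exact trichotomy_smul _ (hA _)
  · refine Or.inr (Or.inr ?_)
    simp only [dif_neg hi]

/-- The congruence diagonalising `P` diagonalises `P′`, with the shifted diagonal data. [folklore] -/
private theorem derivSeq_congr {A : Fin (m + 1) → Matrix (Fin n) (Fin n) 𝕜}
    {M : Matrix (Fin n) (Fin n) 𝕜} {d : Fin n → Fin (m + 1) → ℝ}
    (hd : ∀ i, M * A i * Mᴴ = Matrix.diagonal (fun a => ((d a i : ℝ) : 𝕜))) (i : Fin (m + 1)) :
    M * (if h : (i : ℕ) + 1 < m + 1 then ((((i : ℕ) + 1 : ℕ) : 𝕜)) • A ⟨(i : ℕ) + 1, h⟩ else 0) * Mᴴ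
      = Matrix.diagonal (fun a => ((if h : (i : ℕ) + 1 < m + 1
          then (((i : ℕ) + 1 : ℕ) : ℝ) * d a ⟨(i : ℕ) + 1, h⟩ else 0 : ℝ) : 𝕜)) := by
  by_cases hi : (i : ℕ) + 1 < m + 1
  · simp only [dif_pos hi]
    rw [Matrix.mul_smul, Matrix.smul_mul, hd, ← Matrix.diagonal_smul]
    congr 1
    funext a
    simp only [Pi.smul_apply, smul_eq_mul]
    push_cast
    ring
  · simp only [dif_neg hi, Matrix.mul_zero, Matrix.zero_mul, RCLike.ofReal_zero, Matrix.diagonal_zero]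

/-! ### §9. Theorem 8: `α(P) + π(P) ≤ m`, and sharpness when all eigenvalues are real -/

/-- Dropping the head sign loses at most its one alternation. [folklore] -/
private theorem alternations_le_cons (a : ℤ) (l : List ℤ) :
    alternations l ≤ alternations (a :: l) ∧ alternations (a :: l) ≤ alternations l + 1 := by
  by_cases ha : a = 0
  · subst ha
    rw [alternations_cons_zero]
    exact ⟨le_rfl, Nat.le_succ _⟩
  · cases hf : l.filter (fun s => s ≠ 0) with
    | nil =>
      have h0 : alternations l = 0 := by
        rw [alternations_eq_of_filter_eq (l₂ := []) (by rw [hf]; rfl), alternations_nil]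
      rw [alternations_cons_of_filter_eq_nil ha hf, h0]
      exact ⟨le_rfl, Nat.zero_le _⟩
    | cons b r =>
      rw [alternations_cons_of_filter_eq_cons ha hf]
      constructor
      · exact Nat.le_add_right _ _
      · split_ifs <;> omega

/-- The reflected sign list `i ↦ (−1)ⁱ sᵢ` of a cons. [folklore] -/
private theorem mapIdx_negAlt_cons (a : ℤ) (l : List ℤ) :
    (a :: l).mapIdx (fun i x => (-1 : ℤ) ^ i * x)
      = a :: (l.mapIdx (fun i x => (-1 : ℤ) ^ i * x)).map Neg.neg := by
  rw [List.mapIdx_cons, pow_zero, one_mul]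
  congr 1
  refine List.ext_getElem (by simp) fun t h₁ h₂ => ?_
  rw [List.getElem_mapIdx, List.getElem_map, List.getElem_mapIdx, pow_succ]
  ring

/-- **`α + π ≤ m` on sign lists with a non-null head:** the alternation counts of a sign list of length
`m + 1` and of its reflection `i ↦ (−1)ⁱ sᵢ` add up to at most `m`. [folklore] -/
private theorem alternations_add_reflect_le_of_head :
    ∀ (t : List ℤ) (a : ℤ), (∀ x ∈ t, x = 0 ∨ x = 1 ∨ x = -1) → (a = 1 ∨ a = -1) →
      alternations (a :: t) + alternations ((a :: t).mapIdx (fun i x => (-1 : ℤ) ^ i * x))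
        ≤ t.length
  | [], a, _, _ => by
    rw [mapIdx_negAlt_cons]
    simp [alternations_singleton]
  | b :: u, a, ht, ha => by
    have hu : ∀ x ∈ u, x = 0 ∨ x = 1 ∨ x = -1 := fun x hx => ht x (List.mem_cons_of_mem b hx)
    have ha0 : a ≠ 0 := by rcases ha with rfl | rfl <;> norm_num
    rw [mapIdx_negAlt_cons, mapIdx_negAlt_cons, List.map_cons, List.map_map]
    have hnn : (Neg.neg ∘ Neg.neg : ℤ → ℤ) = id := funext fun x => neg_neg x
    rw [hnn, List.map_id, List.length_cons]
    by_cases hb : b = 0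
    · subst hb
      rw [neg_zero]
      -- drop the null sign `b = 0` on both sides
      have e1 : alternations (a :: 0 :: u) = alternations (a :: u) :=
        alternations_eq_of_filter_eq (by rw [List.filter_cons, filter_cons_zero, List.filter_cons])
      have e2 : alternations (a :: (0 :: u.mapIdx (fun i x => (-1 : ℤ) ^ i * x)))
          = alternations (a :: u.mapIdx (fun i x => (-1 : ℤ) ^ i * x)) :=
        alternations_eq_of_filter_eq (by rw [List.filter_cons, filter_cons_zero, List.filter_cons])
      rw [e1, e2]
      have ih := alternations_add_reflect_le_of_head u a hu ha
      rw [mapIdx_negAlt_cons] at ih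
      -- negating the tail after `a` changes the count by at most one
      have hflip : alternations (a :: u.mapIdx (fun i x => (-1 : ℤ) ^ i * x))
          ≤ alternations (a :: (u.mapIdx (fun i x => (-1 : ℤ) ^ i * x)).map Neg.neg) + 1 := by
        have h1 := (alternations_le_cons a (u.mapIdx (fun i x => (-1 : ℤ) ^ i * x))).2
        have h2 := (alternations_le_cons a ((u.mapIdx (fun i x => (-1 : ℤ) ^ i * x)).map Neg.neg)).1
        rw [alternations_map_neg] at h2
        omega
      omega
    · have hb' : b = 1 ∨ b = -1 := by rcases ht b List.mem_cons_self with h | h <;> tauto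
      have ih := alternations_add_reflect_le_of_head u b hu hb'
      rw [mapIdx_negAlt_cons] at ih
      -- heads: `a` in front of `b :: u`, and `a` in front of `−b :: M`
      have hf1 : (b :: u).filter (fun s => s ≠ 0) = b :: u.filter (fun s => s ≠ 0) :=
        filter_cons_of_ne hb u
      have hf2 : (-b :: u.mapIdx (fun i x => (-1 : ℤ) ^ i * x)).filter (fun s => s ≠ 0)
          = -b :: (u.mapIdx (fun i x => (-1 : ℤ) ^ i * x)).filter (fun s => s ≠ 0) :=
        filter_cons_of_ne (neg_ne_zero.2 hb) _
      rw [alternations_cons_of_filter_eq_cons ha0 hf1, alternations_cons_of_filter_eq_cons ha0 hf2]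
      -- `−b :: M` is the negation of `b :: M.map neg`
      have e3 : alternations (-b :: u.mapIdx (fun i x => (-1 : ℤ) ^ i * x))
          = alternations (b :: (u.mapIdx (fun i x => (-1 : ℤ) ^ i * x)).map Neg.neg) := by
        rw [← alternations_map_neg (b :: (u.mapIdx (fun i x => (-1 : ℤ) ^ i * x)).map Neg.neg),
          List.map_cons, List.map_map, hnn, List.map_id]
      rw [e3]
      have hone : (if a * b < 0 then 1 else 0) + (if a * -b < 0 then 1 else 0) = 1 := by
        rcases ha with rfl | rfl <;> rcases hb' with rfl | rfl <;> norm_num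
      omega

/-- **`α + π ≤ m` on sign lists.** [folklore] -/
private theorem alternations_add_reflect_lt :
    ∀ l : List ℤ, (∀ x ∈ l, x = 0 ∨ x = 1 ∨ x = -1) → l ≠ [] →
      alternations l + alternations (l.mapIdx (fun i x => (-1 : ℤ) ^ i * x)) + 1 ≤ l.length
  | [], _, h => absurd rfl h
  | a :: t, hl, _ => by
    have ht : ∀ x ∈ t, x = 0 ∨ x = 1 ∨ x = -1 := fun x hx => hl x (List.mem_cons_of_mem a hx)
    by_cases ha : a = 0
    · subst ha
      rw [mapIdx_negAlt_cons, alternations_cons_zero, alternations_cons_zero, alternations_map_neg,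
        List.length_cons]
      by_cases ht0 : t = []
      · subst ht0; simp
      · have := alternations_add_reflect_lt t ht ht0
        omega
    · have ha' : a = 1 ∨ a = -1 := by rcases hl a List.mem_cons_self with h | h <;> tauto
      have := alternations_add_reflect_le_of_head t a ht ha'
      rw [List.length_cons]
      omega

/-- Signs of the reflected sequence: `coeffSign ((−1)ⁱ Aᵢ) = (−1)ⁱ coeffSign Aᵢ`. [folklore] -/
private theorem coeffSign_reflect {A : Fin (m + 1) → Matrix (Fin n) (Fin n) 𝕜} (hA : InS A)
    (i : Fin (m + 1)) :
    coeffSign (((-1 : 𝕜) ^ (i : ℕ)) • A i) = (-1 : ℤ) ^ (i : ℕ) * coeffSign (A i) := by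
  rcases Nat.even_or_odd (i : ℕ) with h | h
  · rw [h.neg_one_pow, h.neg_one_pow, one_smul, one_mul]
  · rw [h.neg_one_pow, h.neg_one_pow, neg_smul, one_smul, coeffSign_neg_of_trichotomy (hA i)]
    ring

/-- **`α(P) + π(P) ≤ m`** ("each pair of consecutive coefficients can contribute at most one
alternation or permanence"), with `π(P) = α(P(−λ))`. [cite: CameronPsarrakos2019, proof of Thm 8 (p. 650)] -/
theorem alpha_add_alpha_reflect_le {A : Fin (m + 1) → Matrix (Fin n) (Fin n) 𝕜} (hA : InS A) :
    alpha A + alpha (fun i => ((-1 : 𝕜) ^ (i : ℕ)) • A i) ≤ m := by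
  unfold alpha
  have e : (List.ofFn fun i : Fin (m + 1) => coeffSign (((-1 : 𝕜) ^ (i : ℕ)) • A i))
      = (List.ofFn fun i : Fin (m + 1) => coeffSign (A i)).mapIdx (fun i x => (-1 : ℤ) ^ i * x) := by
    refine List.ext_getElem (by simp) fun t h₁ h₂ => ?_
    rw [List.getElem_ofFn, List.getElem_mapIdx, List.getElem_ofFn, coeffSign_reflect hA]
  rw [e]
  have hl : ∀ x ∈ (List.ofFn fun i : Fin (m + 1) => coeffSign (A i)), x = 0 ∨ x = 1 ∨ x = -1 := by
    intro x hx
    rw [List.mem_ofFn] at hx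
    obtain ⟨i, rfl⟩ := hx
    exact coeffSign_trichotomy (A i)
  have h := alternations_add_reflect_lt _ hl (by simp)
  rw [List.length_ofFn] at h
  omega

/-- `P(0) = A_0`: `∑ 0ⁱ Aᵢ = A_0`. [folklore] -/
private theorem sum_zero_pow_smul (A : Fin (m + 1) → Matrix (Fin n) (Fin n) 𝕜) :
    (∑ i : Fin (m + 1), (0 : 𝕜) ^ (i : ℕ) • A i) = A 0 := by
  rw [Fin.sum_univ_succ]
  simp

/-- A definite matrix is nonsingular. [folklore] -/
private theorem det_ne_zero_of_trichotomy {B : Matrix (Fin n) (Fin n) 𝕜}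
    (hB : B.PosDef ∨ (-B).PosDef ∨ B = 0) (hB0 : B ≠ 0) : B.det ≠ 0 := by
  rcases hB with h | h | h
  · exact h.det_pos.ne'
  · have h1 := h.det_pos.ne'
    rw [Matrix.det_neg] at h1
    intro h0
    apply h1
    rw [h0, mul_zero]
  · exact absurd h hB0

/-- With `A_0` non-null, `0` is not an eigenvalue, so the real eigenvalues are the positive and the
negative ones: `#real = z⁺ + z⁻`. [folklore] -/
private theorem card_real_roots_eq {A : Fin (m + 1) → Matrix (Fin n) (Fin n) 𝕜} (hA : InS A)
    (hA0 : A 0 ≠ 0) :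
    Multiset.card ((matPoly A).det.roots.filter (fun μ => RCLike.im μ = 0))
      = zplus A + zplus (fun i => ((-1 : 𝕜) ^ (i : ℕ)) • A i) := by
  classical
  rw [zplus_reflect]
  unfold zplus
  -- `0` is not a root
  have h0 : ∀ μ ∈ (matPoly A).det.roots, μ ≠ 0 := by
    intro μ hμ hμ0
    subst hμ0
    have hdet : (matPoly A).det ≠ 0 := fun h => by rw [h, Polynomial.roots_zero] at hμ; simp at hμ
    rw [mem_roots hdet, IsRoot.def, eval_det_matPoly, sum_zero_pow_smul] at hμ
    exact det_ne_zero_of_trichotomy (hA 0) hA0 hμ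
  rw [← Multiset.card_add]
  congr 1
  rw [Multiset.filter_add_filter]
  have hand : (matPoly A).det.roots.filter
      (fun μ => (RCLike.im μ = 0 ∧ 0 < RCLike.re μ) ∧ (RCLike.im μ = 0 ∧ RCLike.re μ < 0)) = 0 := by
    rw [Multiset.filter_eq_nil]
    intro μ _ h
    linarith [h.1.2, h.2.2]
  rw [hand, add_zero]
  refine Multiset.filter_congr fun μ hμ => ⟨fun h => ?_, fun h => ?_⟩
  · by_contra hre
    have hre0 : RCLike.re μ = 0 := by
      by_contra hne
      rcases lt_or_gt_of_ne hne with hlt | hgt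
      · exact hre (Or.inr ⟨h, hlt⟩)
      · exact hre (Or.inl ⟨h, hgt⟩)
    exact h0 μ hμ (RCLike.ext (by simpa using hre0) (by simpa using h))
  · rcases h with h | h <;> exact h.1

end Rules

/-! ## The statements, over the vocabulary of `…CameronPsarrakos2019.General` -/

section Statements

variable {𝕜 : Type*} [RCLike 𝕜] {n m : ℕ}

/-- **[CameronPsarrakos2019, Lemma 6], case `α(P) = 0`.** For a regular `P ∈ S` of size `n` and degree
`≤ m` over `𝕜 = ℝ` or `ℂ` with NO sign alternation, `z⁺(P) ≤ n·α(P)`, i.e. `P` has no positive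
eigenvalue.  (A true restriction of the REFUTED rule (6) `CameronPsarrakosRule`, cf.
`cameronPsarrakosRule_real_false`, `not_matrixDescartes_two_two`.)
[cite: CameronPsarrakos2019, Lemma 6 (p. 647); proof of Thm 3, first step] -/
theorem lemma_6_of_alpha_eq_zero (A : Fin (m + 1) → Matrix (Fin n) (Fin n) 𝕜) (hA : InS A)
    (hdet : (matPoly A).det ≠ 0) (hα : alpha A = 0) : zplus A ≤ n * alpha A := by
  rw [Rules.zplus_eq_zero_of_alpha_eq_zero hA hdet hα]
  exact Nat.zero_le _

/-- The sharper form of the case `α(P) = 0`: `z⁺(P) = 0`. [cite: CameronPsarrakos2019, proof of Thm 3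
("Thus, z⁺(P) = 0")] -/
theorem zplus_eq_zero_of_alpha_eq_zero (A : Fin (m + 1) → Matrix (Fin n) (Fin n) 𝕜) (hA : InS A)
    (hdet : (matPoly A).det ≠ 0) (hα : alpha A = 0) : zplus A = 0 :=
  Rules.zplus_eq_zero_of_alpha_eq_zero hA hdet hα

/-- **[CameronPsarrakos2019, Lemma 6], case `α(P) = m`** ("trivial since the total number of eigenvalues
of `P(λ)` is equal to `mn`"): `z⁺(P) ≤ n·α(P)` when `α(P) = m`.  In the tree's encoding (degree `≤ m`)
`z⁺(P) ≤ n·m` holds for every `P` (`Rules.zplus_le`). [cite: CameronPsarrakos2019, Lemma 6 (p. 647)] -/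
theorem lemma_6_of_alpha_eq_degree (A : Fin (m + 1) → Matrix (Fin n) (Fin n) 𝕜)
    (hα : alpha A = m) : zplus A ≤ n * alpha A := by
  rw [hα]; exact Rules.zplus_le A

/-- **[CameronPsarrakos2019, Theorem 9] (Fourier's parity rule for matrix polynomials), first assertion:**
for a regular `P ∈ S`, `n·α(P)` and `z⁺(P)` are of the same parity.  (The second assertion, on
`z⁻(P)` and `n·π(P)`, is this one for `P(−λ)`, coefficient sequence `i ↦ (−1)ⁱ Aᵢ`.)
[cite: CameronPsarrakos2019, Thm 9 (p. 650)] -/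
theorem thm_9 (A : Fin (m + 1) → Matrix (Fin n) (Fin n) 𝕜) (hA : InS A)
    (hdet : (matPoly A).det ≠ 0) : Even (zplus A) ↔ Even (n * alpha A) :=
  Rules.even_zplus_iff hA hdet
/-- **[CameronPsarrakos2019, Lemma 6], case `α(P) = 1`.** For a regular `P ∈ S` with exactly one sign
alternation, `z⁺(P) ≤ n·α(P) = n` — positive eigenvalues counted WITH multiplicity (regularity is not
needed in this case: a singular `P` has no eigenvalue count at all in the encoding).  Printed proof:
Markus' spectral factorisation [Markus 1988, Thm 30.6]; proof here: for the split index `j` the family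
`t ↦ ∓t^{−j} P(t)` is strictly Loewner increasing on `(0, ∞)` (`Rules.gform_strictMono`), the kernels
at the positive eigenvalues are independent subspaces (`Rules.kernel_chain`; the Summit-side twin for
DISTINCT zeros of real symmetric pencils is
`Summit.ValiantsHypothesis.ValiantsHypothesis.Theorems.LacunarySymmetroidMatrixDescartes.oneAlternation`),
and at each positive eigenvalue the root multiplicity of `det P` equals the kernel dimension by
transversality of `P′` on the kernel (`Rules.rootMultiplicity_le_finrank_ker`).  (A true restriction of
the REFUTED rule `CameronPsarrakosRule`, cf. `cameronPsarrakosRule_real_false`,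
`not_matrixDescartes_two_two`.) [cite: CameronPsarrakos2019, Lemma 6 (p. 647)] -/
theorem lemma_6_of_alpha_eq_one (A : Fin (m + 1) → Matrix (Fin n) (Fin n) 𝕜) (hA : InS A)
    (hα : alpha A = 1) : zplus A ≤ n * alpha A := by
  rw [hα, mul_one]
  exact Rules.zplus_le_of_alpha_eq_one hA hα

/-- **[CameronPsarrakos2019, Lemma 6]** as printed: "Let `P(λ) ∈ S`. Then `z⁺(P) ≤ n·α(P)` provided
that `α(P) ∈ {0, 1, m}`."  (`P` regular, as throughout the paper; a true restriction of the REFUTED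
rule `CameronPsarrakosRule`.) [cite: CameronPsarrakos2019, Lemma 6 (p. 647)] -/
theorem lemma_6 (A : Fin (m + 1) → Matrix (Fin n) (Fin n) 𝕜) (hA : InS A)
    (hdet : (matPoly A).det ≠ 0) (hα : alpha A = 0 ∨ alpha A = 1 ∨ alpha A = m) :
    zplus A ≤ n * alpha A := by
  rcases hα with h | h | h
  · exact lemma_6_of_alpha_eq_zero A hA hdet h
  · exact lemma_6_of_alpha_eq_one A hA h
  · exact lemma_6_of_alpha_eq_degree A h

/-- **[CameronPsarrakos2019, Theorem 7] for degree `m ≤ 2`** ("for degree `m = 1`, or `m = 2`, the only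
cases to consider are covered by Lemma 6"): every regular `P ∈ S` of degree at most `2` satisfies
`z⁺(P) ≤ n·α(P)`.  The case `m = 3` (Markus' spectral factorisation [Markus 1988, Thm 26.19]) is NOT
typed. [cite: CameronPsarrakos2019, Thm 7 (p. 648)] -/
theorem thm_7_of_degree_le_two (hm : m ≤ 2) (A : Fin (m + 1) → Matrix (Fin n) (Fin n) 𝕜)
    (hA : InS A) (hdet : (matPoly A).det ≠ 0) : zplus A ≤ n * alpha A := by
  have hle := Rules.alpha_le A
  refine lemma_6 A hA hdet ?_
  omega

/-- **[CameronPsarrakos2019, Theorem 9], second assertion:** for a regular `P ∈ S`, `n·π(P)` and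
`z⁻(P)` are of the same parity — "follows by changing `P(λ)` into `P(−λ)`".  Here `P(−λ)` is the
coefficient sequence `i ↦ (−1)ⁱ Aᵢ`, `π(P) = α(P(−λ))` by the paper's convention for permanences
("this is the same as counting the alternations of `P(−λ)`", p. 644), and
`z⁻(P) = z⁺(P(−λ))` (`Rules.zplus_reflect`: the negative real eigenvalues of `P`, with multiplicity).
[cite: CameronPsarrakos2019, Thm 9 (p. 650)] -/
theorem thm_9_neg (A : Fin (m + 1) → Matrix (Fin n) (Fin n) 𝕜) (hA : InS A)
    (hdet : (matPoly A).det ≠ 0) :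
    Even (zplus (fun i => ((-1 : 𝕜) ^ (i : ℕ)) • A i))
      ↔ Even (n * alpha (fun i => ((-1 : 𝕜) ^ (i : ℕ)) • A i)) :=
  thm_9 _ (Rules.inS_reflect hA) (Rules.det_matPoly_reflect_ne_zero hdet)

/-- **[CameronPsarrakos2019, Theorem 7] for degree `m ≤ 2`, both assertions of (6):**
`z⁺(P) ≤ n·α(P)` and `z⁻(P) ≤ n·π(P)` (the latter as `z⁺`/`α` of `P(−λ)`, cf. `thm_9_neg`).
[cite: CameronPsarrakos2019, Thm 7 (p. 648), display (6)] -/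
theorem thm_7_of_degree_le_two' (hm : m ≤ 2) (A : Fin (m + 1) → Matrix (Fin n) (Fin n) 𝕜)
    (hA : InS A) (hdet : (matPoly A).det ≠ 0) :
    zplus A ≤ n * alpha A ∧
      zplus (fun i => ((-1 : 𝕜) ^ (i : ℕ)) • A i) ≤ n * alpha (fun i => ((-1 : 𝕜) ^ (i : ℕ)) • A i) :=
  ⟨thm_7_of_degree_le_two hm A hA hdet,
    thm_7_of_degree_le_two hm _ (Rules.inS_reflect hA) (Rules.det_matPoly_reflect_ne_zero hdet)⟩

/-- The reading of `z⁻`: `z⁺(P(−λ))` is the number of negative real eigenvalues of `P`, counted with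
multiplicity. [cite: CameronPsarrakos2019, §1 (p. 644), z⁻(P)] -/
theorem zplus_reflect_eq_card_neg (A : Fin (m + 1) → Matrix (Fin n) (Fin n) 𝕜) :
    zplus (fun i => ((-1 : 𝕜) ^ (i : ℕ)) • A i)
      = Multiset.card ((matPoly A).det.roots.filter (fun μ => RCLike.im μ = 0 ∧ RCLike.re μ < 0)) :=
  Rules.zplus_reflect A

/-- **[CameronPsarrakos2019, Lemma 2].** "Let `P(λ) ∈ S`. Suppose that the consecutive coefficients
`A_k` and `A_{k−1}` are of opposite sign and define `F(λ) = λ^{−k} P(λ)`. Then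
`G(λ) = λ^{k+1} F′(λ) = −kP(λ) + λP′(λ) = ∑ (i − k) Aᵢ λⁱ` has exactly one less alternation than
`P(λ)`."  Here `G` is the coefficient sequence `i ↦ (i − k) • Aᵢ` (its matrix polynomial IS
`−k·P + X·P′`: `Rules.matPoly_deGua`; it stays in `S`: `Rules.inS_deGua`), and "of opposite sign" is
`coeffSign (A k) · coeffSign (A (k−1)) = −1` (both non-null, one positive and one negative definite).
The version allowing null coefficients between the two opposite ones (used in the inductions of §2 of
the paper) is `Rules.alpha_deGua`. [cite: CameronPsarrakos2019, Lemma 2 (p. 645)] -/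
theorem lemma_2 (A : Fin (m + 1) → Matrix (Fin n) (Fin n) 𝕜) (hA : InS A) (k : Fin (m + 1))
    (hk : 0 < (k : ℕ))
    (hopp : coeffSign (A k) * coeffSign (A ⟨(k : ℕ) - 1, by omega⟩) = -1) :
    alpha (fun i => (((i : ℕ) : 𝕜) - ((k : ℕ) : 𝕜)) • A i) + 1 = alpha A := by
  set j : Fin (m + 1) := ⟨(k : ℕ) - 1, by omega⟩ with hj
  have hjk : j < k := by
    show (k : ℕ) - 1 < (k : ℕ); omega
  -- both signs are non-null and opposite
  have hj0 : coeffSign (A j) ≠ 0 := fun h => by rw [h, mul_zero] at hopp; exact absurd hopp (by norm_num)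
  have hAj : A j ≠ 0 := fun h => hj0 ((Rules.coeffSign_eq_zero_iff _).2 h)
  have hopp' : coeffSign (A k) = -coeffSign (A j) := by
    rcases Rules.coeffSign_trichotomy (A k) with h | h | h <;>
      rcases Rules.coeffSign_trichotomy (A j) with h' | h' | h' <;>
      rw [h, h'] at hopp ⊢ <;> revert hopp <;> decide
  refine Rules.alpha_deGua hA hjk hAj hopp' fun i hji hik => ?_
  exfalso
  have h1 : (j : ℕ) < (i : ℕ) := hji
  have h2 : (i : ℕ) < (k : ℕ) := hik
  simp only [hj] at h1
  omega

/-- **(6) for matrix polynomials diagonalizable by congruence** ("the following proposition implies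
that (6) holds for all `P(λ) ∈ S` that are diagonalizable by congruence", p. 646): if `P ∈ S` and a
nonsingular `M` makes every `M Aᵢ Mᴴ` a REAL diagonal matrix, then `z⁺(P) ≤ n·α(P)`.  Proof as in
the paper's §2: induction on `α(P)`; `α(P) = 0` is Descartes' rule without sign variation for each
diagonal entry `dₐ(λ) = ∑ᵢ (M Aᵢ Mᴴ)ₐₐ λⁱ` (whose coefficient signs ARE the signs of the `Aᵢ`:
`(M Aᵢ Mᴴ)ₐₐ = x* Aᵢ x` for the row `x ≠ 0`); the step is Lemma 2 (`Rules.alpha_deGua`) with the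
entrywise Rolle–de Gua count `#pos.roots(dₐ) ≤ #pos.roots(X dₐ′ − k dₐ) + 1`
(`Rules.countP_roots_le_deGua`), i.e. (3)/(5) for the diagonal data (`Rules.diagCount_le`).  No
regularity hypothesis is needed (a singular `P` has `zplus = 0` in the encoding).  A true restriction
of the REFUTED rule `CameronPsarrakosRule`, cf. `cameronPsarrakosRule_real_false`,
`not_matrixDescartes_two_two`. [cite: CameronPsarrakos2019, §2, Prop 4 and the paragraph before it (p. 646)] -/
theorem zplus_le_of_congruence_diagonalizable (A : Fin (m + 1) → Matrix (Fin n) (Fin n) 𝕜)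
    (hA : InS A) (M : Matrix (Fin n) (Fin n) 𝕜) (hM : M.det ≠ 0) (d : Fin n → Fin (m + 1) → ℝ)
    (hd : ∀ i, M * A i * Mᴴ = Matrix.diagonal (fun a => ((d a i : ℝ) : 𝕜))) :
    zplus A ≤ n * alpha A := by
  by_cases hdet : (matPoly A).det = 0
  · unfold zplus
    rw [hdet, Polynomial.roots_zero]
    simp
  · rw [Rules.zplus_eq_diagCount hM hd hdet]
    exact Rules.diagCount_le hM _ A d hA hd rfl

/-- **[CameronPsarrakos2019, Proposition 4].** "If `P(λ) ∈ S` is diagonalizable by congruence then (3)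
holds", (3) being `z⁺(P′) ≥ z⁺(P) − n`.  Here `P′` is the coefficient sequence
`i ↦ (i + 1) A_{i+1}` (top coefficient `0`; its matrix polynomial IS the derivative:
`Rules.matPoly_derivSeq`), "diagonalizable by congruence" is the data `M` (nonsingular), `d` (real)
with `M Aᵢ Mᴴ = diag(d·ᵢ)` for all `i` ("`M P(λ) M* = D(λ)`, a diagonal matrix polynomial with real
coefficients"), and the printed `z⁺(P′)` presupposes that `P′` is regular (`hdet'`; in the encoding a
singular `P′` would have `zplus = 0`).  Proof as printed: `D′ = M P′ M*`, Rolle's theorem for each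
diagonal entry (with multiplicity), summed over the `n` entries.  Membership in `S` is not used.
[cite: CameronPsarrakos2019, Prop 4 (p. 646)] -/
theorem prop_4 (A : Fin (m + 1) → Matrix (Fin n) (Fin n) 𝕜) (M : Matrix (Fin n) (Fin n) 𝕜)
    (hM : M.det ≠ 0) (d : Fin n → Fin (m + 1) → ℝ)
    (hd : ∀ i, M * A i * Mᴴ = Matrix.diagonal (fun a => ((d a i : ℝ) : 𝕜)))
    (hdet' : (matPoly (fun i : Fin (m + 1) => if h : (i : ℕ) + 1 < m + 1
        then ((((i : ℕ) + 1 : ℕ) : 𝕜)) • A ⟨(i : ℕ) + 1, h⟩ else 0)).det ≠ 0) :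
    zplus A ≤ zplus (fun i : Fin (m + 1) => if h : (i : ℕ) + 1 < m + 1
        then ((((i : ℕ) + 1 : ℕ) : 𝕜)) • A ⟨(i : ℕ) + 1, h⟩ else 0) + n := by
  classical
  -- `z⁺(P′)` is the diagonal count of the derivatives `dₐ′`
  rw [Rules.zplus_eq_diagCount hM (Rules.derivSeq_congr hd) hdet']
  have hder : ∀ a : Fin n, (∑ i : Fin (m + 1), C (if h : (i : ℕ) + 1 < m + 1
        then (((i : ℕ) + 1 : ℕ) : ℝ) * d a ⟨(i : ℕ) + 1, h⟩ else 0) * X ^ (i : ℕ))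
      = derivative (∑ i : Fin (m + 1), C (d a i) * X ^ (i : ℕ)) := fun a => Rules.sum_C_derivSeq (d a)
  simp only [hder]
  -- `z⁺(P)` is at most the diagonal count of the `dₐ` (equality when `P` is regular)
  have hP : zplus A ≤ ∑ a, (∑ i : Fin (m + 1), C (d a i) * X ^ (i : ℕ)).roots.countP (fun x => 0 < x) := by
    by_cases hdet : (matPoly A).det = 0
    · unfold zplus
      rw [hdet, Polynomial.roots_zero]
      simp
    · rw [Rules.zplus_eq_diagCount hM hd hdet]
  refine hP.trans ?_
  -- Rolle, entry by entry
  calc ∑ a, (∑ i : Fin (m + 1), C (d a i) * X ^ (i : ℕ)).roots.countP (fun x => 0 < x)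
      ≤ ∑ a, ((derivative (∑ i : Fin (m + 1), C (d a i) * X ^ (i : ℕ))).roots.countP
          (fun x => 0 < x) + 1) := by
        refine Finset.sum_le_sum fun a _ => ?_
        have h := Rules.countP_roots_le_deGua (∑ i : Fin (m + 1), C (d a i) * X ^ (i : ℕ)) 0
        rwa [Nat.cast_zero, C_0, zero_mul, sub_zero, Rules.countP_roots_X_mul] at h
    _ = (∑ a, (derivative (∑ i : Fin (m + 1), C (d a i) * X ^ (i : ℕ))).roots.countP
          (fun x => 0 < x)) + n := by
        rw [Finset.sum_add_distrib]
        simp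

/-- **[CameronPsarrakos2019, Theorem 8] (the bounds in (6) are sharp when all eigenvalues are real).**
"Let `P(λ) ∈ S`. If (6) holds and all eigenvalues of `P(λ)` are real, then `z⁺(P) = n·α(P)` and
`z⁻(P) = n·π(P)`."  Typed with the paper's standing normalisation "`P(λ)` has no null coefficients
after its trailing coefficient" (p. 650: otherwise first divide by a power of `λ`) as `A 0 ≠ 0`, with
`z⁻(P)`/`π(P)` read on the reflected sequence `i ↦ (−1)ⁱ Aᵢ` (cf. `thm_9_neg`,
`zplus_reflect_eq_card_neg`), with both halves of (6) as hypotheses (`h6`, `h6'`), and with "all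
eigenvalues of `P(λ)` are real" as: `det P` has `n·m` real roots counted with multiplicity (`hreal`; for
the paper's `P` of degree exactly `m`, `A_m` definite, `nm` is the total number of eigenvalues).
Proof as printed: `α(P) + π(P) ≤ m` (`Rules.alpha_add_alpha_reflect_le`) and `z⁺(P) + z⁻(P) = nm`
(`A_0` definite, so `0` is not an eigenvalue).  A statement about the REFUTED rule (6)
(`CameronPsarrakosRule`, cf. `cameronPsarrakosRule_real_false`, `not_matrixDescartes_two_two`) taken
as a hypothesis. [cite: CameronPsarrakos2019, Thm 8 (p. 650)] -/
theorem thm_8 (A : Fin (m + 1) → Matrix (Fin n) (Fin n) 𝕜) (hA : InS A) (hA0 : A 0 ≠ 0)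
    (h6 : zplus A ≤ n * alpha A)
    (h6' : zplus (fun i => ((-1 : 𝕜) ^ (i : ℕ)) • A i)
      ≤ n * alpha (fun i => ((-1 : 𝕜) ^ (i : ℕ)) • A i))
    (hreal : Multiset.card ((matPoly A).det.roots.filter (fun μ => RCLike.im μ = 0)) = n * m) :
    zplus A = n * alpha A ∧
      zplus (fun i => ((-1 : 𝕜) ^ (i : ℕ)) • A i) = n * alpha (fun i => ((-1 : 𝕜) ^ (i : ℕ)) • A i) := by
  have hsum := Rules.card_real_roots_eq hA hA0
  rw [hreal] at hsum
  have hαπ : n * alpha A + n * alpha (fun i => ((-1 : 𝕜) ^ (i : ℕ)) • A i) ≤ n * m := by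
    rw [← Nat.mul_add]
    exact Nat.mul_le_mul_left n (Rules.alpha_add_alpha_reflect_le hA)
  generalize n * alpha A = X₁ at *
  generalize n * alpha (fun i => ((-1 : 𝕜) ^ (i : ℕ)) • A i) = X₂ at *
  generalize n * m = X₃ at *
  omega

end Statements

end Literature.LinearAlgebra.MatrixPolynomials.CameronPsarrakos2019

end
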